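import Literature.Probability.RandomPlanarGeometry.YangBaxterSAWUnwoundPlaquette
import Literature.Probability.RandomPlanarGeometry.PolygonLeftInterior
import Literature.Probability.RandomPlanarGeometry.PolygonWinding
import Literature.Probability.RandomPlanarGeometry.PolygonLog
import Literature.Topology.PlaneTopology.JordanWindingOne
import HarnessLib

/-!
# The excursion polygon of a Yang–Baxter walk is a simple closed polygon: it winds at most once, and the sign rule

Topic `Literature/Probability/RandomPlanarGeometry`; sequel to `YangBaxterSAWGeneralDomain.lean` and
`YangBaxterSAWUnwoundPlaquette.lean` (Glazman–Manolescu, arXiv:1708.00395v3, Lemma 2.1 = the vertex relation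
(CR) of the parafermionic observable of the Yang–Baxter self-avoiding walk; proof = Glazman, ECP 20 (2015),
Lemma 3.1; hexagonal-lattice original Duminil-Copin–Smirnov, Ann. of Math. 175 (2012), Lemma 1). In that proof
the winding of a walk `ω` of class `B2a` at a rhombus `r` (first hit of `∂r`, one arc of `r`, an excursion in
`D ∖ r` back to `∂r`) is controlled by the *excursion polygon* `J` (the drawn excursion closed by the chord of
`r`), through the swept angle `ΩG.AJ` of `J` at the midpoint of the root (`ΩG.WE_eq_excursionWinding_add_two_AJ`
of the parent file: `WE = excursionWinding + 2·AJ`). The parent files discharge `AJ = 0` for outer roots and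
isthmus roots by transporting the base point; for a HOLE root at its own plaquette the excursion may wind
around the root. This file supplies the planar topology of that case, in three statements valid for every
finite face domain `D`, every non-interior root and every walk of class `B2a`:

* `ΩG.isSimpleClosedPolygon_pJlist` — **the excursion polygon is a simple closed polygon** (in the mesh-`4`
  drawing of `YangBaxterSAWBoundaryWinding.lean`: vertices = inner points, edges = arc segments and crossing
  segments; two crossing segments meet only for the same mid-edge, a crossing segment meets an arc segment only
  through the arc's entry or exit side and then only at the inner point, arcs in different faces are disjoint,
  two arcs of one face with distinct sides meet only if both are straight — `eq_of_mem_crossSeg`,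
  `eq_side_of_mem_crossSeg_arcSeg`, `eq_innerPt_of_mem_crossSeg_arcSeg`, `eq_face_of_mem_arcSeg`,
  `straight_of_mem_arcSeg_arcSeg`; with the walk's self-avoidance (`YBWalk.vtx_injective`,
  `YBWalk.not_straight_of_two_arcs`, `nodup`) this gives pairwise disjoint half-open edges), hence a Jordan loop
  (`ΩG.isJordanLoop_pJ`, via `IsSimpleClosedPolygon`/`injOn_polygonLoop` of `PolygonalDomains.lean`);
* `ΩG.AJ_eq_two_pi_mul_wind` and `ΩG.AJ_trichotomy` — the tree's swept angle `AJ b` equals `2π` times the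
  winding number (`Literature/Topology/PlaneTopology/WindingNumber.lean`) of the polygon loop about `b`, for every
  `b` off the closed edges (generic lemma `wind_polygonLoop_sub_mul_two_pi`: the winding number of a closed
  polygon is `(2π)⁻¹ Σₖ arg((vₖ₊₁ - b)/(vₖ - b))`, by the explicit logarithm of `PolygonWinding.lean`); hence, by the
  Jordan curve theorem of the tree (`IsJordanLoop.wind_eq_one_or_neg_one_of_mem_inside`,
  `mem_outside_iff_wind_eq_zero`), **`AJ b ∈ {0, 2π, -2π}`: an excursion polygon winds at most once**;
* `ΩG.AJ_midPt_side_eq` — **the sign rule**: for every side `σ` of `r` other than the exit side `z₁` and the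
  return side `z₂` of the excursion, `AJ (midPt (r.side σ)) ∈ {0, 2π·ε(σ; z₁, z₂)}` with the explicit chord sign
  `chordSign` (`+1` iff the midpoint of `σ` lies to the left of the chord directed from the return end to the exit
  end; table `chordSign_table`): the segment from that midpoint to an auxiliary lattice point of `∂r` across the
  chord meets `J` exactly once, transversally in the open chord (`ΩG.edge_disjoint_bc`: inside the closed face
  `r` the polygon consists of the chord and the two crossing stubs — `arcSeg_disjoint_faceBox`,
  `crossSeg_faceBox`, `ΩG.jOut_side_eq_side_root`), so the crossing lemma `wind_sub_wind_of_straight_cross`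
  (`WindingNumberCrossing.lean`) and `|wind| ≤ 1` on both sides leave only `0` and `ε`.

* (edition 2, § Rider J2) `ΩG.midPt_side_not_mem_edges`, `ΩG.AJ_midPt_side_eq_two_pi_mul_wind`,
  `ΩG.AJ_midPt_side_ne_zero_iff_mem_inside`, `ΩG.AJ_midPt_side_eq_chordSign_iff_mem_inside` — public wrappers
  at the midpoint of a free side of `r`: the midpoint is off every closed edge of `J`, `AJ` there is `2π·wind`,
  and **the excursion is wound at that midpoint (`AJ ≠ 0`, equivalently `AJ = 2π·chordSign`) iff the midpoint
  lies in the inside (`IsJordanLoop.inside`) of the polygon loop `J`** — the bridge from the winding defect to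
  the planar position of the root relative to the excursion (used by the lane's cycle criterion for hole roots).

* (edition 3, Part P) `ΩG.rayCount` and ★ `ΩG.AJ_midPt_side_ne_zero_iff_odd_rayCount` — **the winding
  parity law**: for a free side `σ` of `r`, `AJ (midPt (r.side σ)) ≠ 0` (wound) iff the excursion crosses the
  lattice half-line behind the side `σ` of `r` an odd number of times (`rayMid`, `rayCell`, `rayCorner`;
  transport of the winding number corner to corner along the ray with a jump `±1` exactly at the crossed unit
  edges, `ΩG.windRay_jump`, `ΩG.windRay_succ_of_not_crossed`, `ΩG.exists_far`); mod-2 and «inside» forms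
  `ΩG.wind_midPt_side_eq_rayCount_mod_two`, `ΩG.midPt_side_mem_inside_iff_odd_rayCount`.

* (edition 4, Part P′) `ΩG.rayCountAt` and ★ `ΩG.AJ_root_ne_zero_iff_odd_rayCountAt` — **the winding parity
  law behind an arbitrary mid-edge**: Part P's transport argument run from the midpoint of ANY lattice mid-edge
  `b.side τ` that the excursion polygon does not cross (`ΩG.AJ_midPt_ne_zero_iff_odd_rayCountAt`), in
  particular from the midpoint of the ROOT `a` for a walk of class `B2a` at an ARBITRARY rooted rhombus `r`
  (`ΩG.exit_ne_root`): the polygon is wound about the root — `AJ (midPt a) ≠ 0`, the summand quantity of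
  `UnwoundAt` in `YangBaxterSAWUnwoundPlaquette` — iff it crosses the lattice half-line behind `a` an odd
  number of times; mod-2 and «inside» forms `ΩG.wind_midPt_eq_rayCountAt_mod_two`,
  `ΩG.midPt_root_mem_inside_iff_odd_rayCountAt`; pay-off in the tree's vocabulary:
  `unwoundAt_iff_forall_even_rayCountAt` (`UnwoundAt D a r` ⇔ all ray counts behind the root even) and, in the
  `PlaquetteWalk` namespace, `vertexFunctional_printed_eq_zero_of_forall_even_rayCountAt` /
  `exists_odd_rayCountAt_of_vertexFunctional_printed_ne_zero` (a Yang–Baxter defect at ANY plaquette `f₀`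
  forces a class-`B2a` walk at `f₀` crossing the half-line behind the root an odd number of times).

With the parent file's winding laws this is the topological input («sign rule T») of the lane's root-plaquette
defect law for hole roots with thick walls: for a walk of class `B2a` at the root's own plaquette,
`WE - excursionWinding ∈ {0, 4π·ε(σ; exit, return)}` (venture lane «pcv-sawmu», seat b-step0; the data side —
0 violations on 77 602 enumerated walks — is HOME `code/step0/g14/part6/`, `code/bref-g52/q2t/`).

References: A. Glazman, I. Manolescu, arXiv:1708.00395v3, Lemma 2.1 (stated "in the form given in [Gl]", p. 6;
no proof is printed there) [GlazmanManolescu2019]; its proof: A. Glazman, Electron. Commun. Probab. 20 (2015) no. 86,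
Lemma 3.1, proof pp. 6–7 (the classes of walks through a rhombus) [Glazman2015WeightedSAW];
H. Duminil-Copin, S. Smirnov, Ann. of Math. 175 (2012), Lemma 1, proof («In order to evaluate the winding
of γ₁ between p and q above, we used the fact that a is on the boundary and Ω is simply connected»)
[DuminilCopinSmirnov2012]; for the planar topology J. McCleary, *A First Course in Topology* (2006), Ch. 9
[Mccleary2006] (the tree's `JordanCurveTheorem_holds`). The even–odd rule behind Part P: R. Courant, H. Robbins,
*What is Mathematics?* (1941/1958), Ch. V Appendix §2 «The Jordan Curve Theorem for Polygons» [CourantRobbins1958].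

Editions: edition 1 (b-step0 gen 15) = Parts A, G/J/S, W, T; edition 2 (b-step0 gen 16) = edition 1 with the
locator class of the `GlazmanManolescu2019, Lemma 2.1` tags corrected (statement in [GM19], proof in [Gl] =
Glazman 2015, Lemma 3.1; docstrings only, code byte-identical) ⊕ the appended § Rider J2; edition 3 (b-step0 gen 16)
= edition 2 verbatim ⊕ the appended Part P (winding parity law); edition 4 (b-step0 gen 16) = edition 3 with
one reference locator made verbatim (header only; code byte-identical) ⊕ the appended Part P′ (general base edge).
-/

noncomputable section

open Set Function Complex
open Literature.Topology.PlaneTopology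

/-! ## Part A. The winding number of a closed polygon as a sum of subtended angles (generic) -/

namespace Literature.Probability.RandomPlanarGeometry

section PolygonAngleSum

variable {l : List ℂ} {z : ℂ}

-- `edgeRatio l z hl k = (v_{(k+1) % N} - z)/(v_{k % N} - z)` is `PolygonLog.lean`'s.

/-- If the edge ratio is off the closed negative real axis, the vertex is not `z`. [folklore] -/
private theorem sub_ne_zero_of_edgeRatio_mem (hl : 0 < l.length) (h : ∀ k, edgeRatio l z hl k ∈ slitPlane)
    (k : ℕ) : l[k % l.length]'(Nat.mod_lt _ hl) - z ≠ 0 := by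
  intro h0
  have := h k
  rw [edgeRatio, h0, div_zero] at this
  exact Complex.slitPlane_ne_zero this rfl

/-- The accumulated logarithms `Λ₀ = Log (v₀ - z)`, `Λₖ₊₁ = Λₖ + Log wₖ`. [folklore] -/
def vertexLog' (l : List ℂ) (z : ℂ) (hl : 0 < l.length) : ℕ → ℂ
  | 0 => Complex.log (l[0] - z)
  | k + 1 => vertexLog' l z hl k + Complex.log (edgeRatio l z hl k)

/-- `exp Λₖ = v_{k % N} - z`. [folklore] -/
private theorem exp_vertexLog' (hl : 0 < l.length) (h : ∀ k, edgeRatio l z hl k ∈ slitPlane) :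
    ∀ k : ℕ, Complex.exp (vertexLog' l z hl k) = l[k % l.length]'(Nat.mod_lt _ hl) - z
  | 0 => by
    have e : l[0 % l.length]'(Nat.mod_lt _ hl) = l[0] := getElem_congr_idx (Nat.zero_mod _)
    have hne := sub_ne_zero_of_edgeRatio_mem hl h 0
    rw [e] at hne
    rw [e, vertexLog', Complex.exp_log hne]
  | k + 1 => by
    have hne := sub_ne_zero_of_edgeRatio_mem hl h k
    have hne' := sub_ne_zero_of_edgeRatio_mem hl h (k + 1)
    rw [vertexLog', Complex.exp_add, exp_vertexLog' hl h k, edgeRatio, Complex.exp_log (div_ne_zero hne' hne),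
      mul_div_cancel₀ _ hne]

/-- `im (Λ_k - Λ_0) = ∑_{j<k} arg wⱼ`. [folklore] -/
private theorem im_vertexLog'_sub (hl : 0 < l.length) :
    ∀ k : ℕ, (vertexLog' l z hl k - vertexLog' l z hl 0).im = ∑ j ∈ Finset.range k, (edgeRatio l z hl j).arg
  | 0 => by simp
  | k + 1 => by
    rw [Finset.sum_range_succ, ← im_vertexLog'_sub hl k]
    have hdef : vertexLog' l z hl (k + 1) = vertexLog' l z hl k + Complex.log (edgeRatio l z hl k) := rfl
    rw [hdef, add_sub_right_comm, Complex.add_im, Complex.log_im]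

/-- A convex combination of `1` and a point of the slit plane lies in the slit plane. [folklore] -/
private theorem one_sub_add_mul_mem_slitPlane {w : ℂ} (hw : w ∈ slitPlane) {s : ℝ} (hs : s ∈ Icc (0 : ℝ) 1) :
    (1 - s + s * w : ℂ) ∈ slitPlane := by
  rw [Complex.mem_slitPlane_iff] at hw ⊢
  rcases hs.1.eq_or_lt with rfl | hs0
  · left; simp
  · have him : (1 - (s : ℂ) + s * w).im = s * w.im := by simp
    have hre : (1 - (s : ℂ) + s * w).re = 1 - s + s * w.re := by simp
    by_cases hwi : w.im = 0
    · rcases hw with hwr | hwi'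
      · left; rw [hre]; nlinarith [hs.2]
      · exact absurd hwi hwi'
    · right; rw [him]; exact mul_ne_zero hs0.ne' hwi

/-- **The winding number of a closed polygon is the sum of the angles subtended by its edges**: if every
edge ratio `wₖ = (vₖ₊₁ - z)/(vₖ - z)` of the closed polygon through `l` lies off the closed negative real
axis (i.e. `z` lies on no closed edge), then `2π · wind (polygonLoop l - z) = ∑_{k<N} arg wₖ` (the index of a
point as the total increase of the argument along the polygon).
[cite: AhlforsCA1979, Ch. 4 §2.1 (index of a point with respect to a closed curve: Lemma 1 and the definition)] -/
theorem wind_polygonLoop_sub_mul_two_pi (hl : 0 < l.length) (h : ∀ k, edgeRatio l z hl k ∈ slitPlane) :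
    (wind (fun t ↦ polygonLoop l t - z) : ℝ) * (2 * Real.pi) =
      ∑ k ∈ Finset.range l.length, (edgeRatio l z hl k).arg := by
  have hl' : l ≠ [] := List.ne_nil_of_length_pos hl
  set N := l.length with hN
  have hNr : (0 : ℝ) < N := by exact_mod_cast hl
  set w : ℕ → ℂ := edgeRatio l z hl with hw
  set q : ℕ → ℝ → ℂ := fun k s ↦ 1 - s + s * w k with hq
  have hq_slit : ∀ k, ∀ s ∈ Icc (0 : ℝ) 1, q k s ∈ Complex.slitPlane := fun k s hs ↦
    one_sub_add_mul_mem_slitPlane (h k) hs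
  -- the logarithm along the polygon
  set Λ := vertexLog' l z hl with hΛ
  set piece : ℕ → ℝ → ℂ := fun k t ↦ Λ k + Complex.log (q k (N * t - k)) with hpiece
  set L : ℝ → ℂ := fun t ↦ piece ⌊(N : ℝ) * t⌋₊ t with hL
  have hknot : ∀ k : ℕ, piece k ((k + 1 : ℕ) / N) = Λ (k + 1) := fun k ↦ by
    have h1 : (N : ℝ) * (((k + 1 : ℕ) : ℝ) / N) - k = 1 := by
      rw [mul_div_cancel₀ _ hNr.ne']; push_cast; ring
    have h2 : q k 1 = w k := by simp [hq]
    simp only [hpiece, h1, h2]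
    rfl
  have hknot' : ∀ k : ℕ, piece k ((k : ℕ) / N) = Λ k := fun k ↦ by
    have h1 : (N : ℝ) * ((k : ℝ) / N) - k = 0 := by rw [mul_div_cancel₀ _ hNr.ne', sub_self]
    have h2 : q k 0 = 1 := by simp [hq]
    simp only [hpiece, h1, h2, Complex.log_one, add_zero]
  have hIcc : ∀ (k : ℕ) (t : ℝ), t ∈ Icc ((k : ℝ) / N) ((k + 1 : ℕ) / N) →
      (k : ℝ) ≤ N * t ∧ (N : ℝ) * t ≤ k + 1 := fun k t ht ↦ by
    constructor
    · have := ht.1; rw [div_le_iff₀ hNr] at this; linarith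
    · have := ht.2; rw [le_div_iff₀ hNr] at this; push_cast at this; linarith
  have hLeq : ∀ k : ℕ, EqOn L (piece k) (Icc ((k : ℝ) / N) ((k + 1 : ℕ) / N)) := by
    intro k t ht
    obtain ⟨h1, h2⟩ := hIcc k t ht
    simp only [hL]
    rcases h2.lt_or_eq with hlt | heq
    · rw [Nat.floor_eq_on_Ico k _ ⟨h1, hlt⟩]
    · have ht' : t = ((k + 1 : ℕ) : ℝ) / N := by
        rw [eq_div_iff hNr.ne']; push_cast; linarith
      have hfl : ⌊(N : ℝ) * t⌋₊ = k + 1 := by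
        rw [heq]; exact_mod_cast Nat.floor_natCast (R := ℝ) (k + 1)
      rw [hfl, ht', hknot' (k + 1), hknot k]
  have hpc : ∀ k : ℕ, ContinuousOn (piece k) (Icc ((k : ℝ) / N) ((k + 1 : ℕ) / N)) := by
    intro k
    have hcq : Continuous fun t : ℝ ↦ q k (N * t - k) := by simp only [hq]; fun_prop
    intro t ht
    obtain ⟨h1, h2⟩ := hIcc k t ht
    have hs : (N : ℝ) * t - k ∈ Icc (0 : ℝ) 1 := ⟨by linarith, by linarith⟩
    have hc : ContinuousAt (fun t : ℝ ↦ Complex.log (q k (N * t - k))) t :=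
      ContinuousAt.comp (g := Complex.log) (f := fun t : ℝ ↦ q k (N * t - k))
        (continuousAt_clog (hq_slit k _ hs)) hcq.continuousAt
    have : ContinuousAt (piece k) t := by
      simp only [hpiece]
      exact continuousAt_const.add hc
    exact this.continuousWithinAt
  have hLc : ContinuousOn L (Icc 0 1) := by
    have hcov : Icc (0 : ℝ) 1 = ⋃ k : Fin N, Icc ((k : ℕ) / (N : ℝ)) (((k : ℕ) + 1 : ℕ) / N) := by
      apply Subset.antisymm
      · intro t ht
        have ht0 : 0 ≤ (N : ℝ) * t := mul_nonneg hNr.le ht.1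
        rcases ht.2.lt_or_eq with hlt | rfl
        · have hk : ⌊(N : ℝ) * t⌋₊ < N := (Nat.floor_lt ht0).2 (by nlinarith)
          refine mem_iUnion.2 ⟨⟨_, hk⟩, ?_, ?_⟩
          · rw [div_le_iff₀ hNr]
            have := Nat.floor_le ht0
            linarith
          · rw [le_div_iff₀ hNr]; push_cast
            have := Nat.lt_floor_add_one ((N : ℝ) * t); linarith
        · obtain ⟨n, hn⟩ : ∃ n, N = n + 1 := ⟨N - 1, by omega⟩
          refine mem_iUnion.2 ⟨⟨n, by omega⟩, ?_, ?_⟩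
          · rw [div_le_iff₀ hNr, one_mul]; exact_mod_cast (by omega : n ≤ N)
          · rw [le_div_iff₀ hNr, one_mul]; exact_mod_cast (by omega : N ≤ n + 1)
      · intro t ht
        obtain ⟨k, hk⟩ := mem_iUnion.1 ht
        refine ⟨le_trans (by positivity) hk.1, hk.2.trans ?_⟩
        rw [div_le_one hNr]; exact_mod_cast k.2
    rw [hcov]
    exact LocallyFinite.continuousOn_iUnion (locallyFinite_of_finite _) (fun _ ↦ isClosed_Icc)
      fun k ↦ (hpc k).congr (hLeq k)
  have hL1 : L 1 = Λ N := by
    have : L 1 = piece N ((N : ℕ) / N) := by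
      simp only [hL, mul_one, Nat.floor_natCast, div_self hNr.ne']
    rw [this, hknot' N]
  have hL0 : L 0 = Λ 0 := by
    have : L 0 = piece 0 ((0 : ℕ) / N) := by
      simp only [hL, mul_zero, Nat.floor_zero, Nat.cast_zero, zero_div]
    rw [this, hknot' 0]
  have hLexp : ∀ t ∈ Icc (0 : ℝ) 1, Complex.exp (L t) = polygonLoop l t - z := by
    intro t ht
    have ht0 : 0 ≤ (N : ℝ) * t := mul_nonneg hNr.le ht.1
    rcases ht.2.lt_or_eq with hlt | rfl
    · set k := ⌊(N : ℝ) * t⌋₊ with hk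
      have hks : (k : ℝ) ≤ N * t := Nat.floor_le ht0
      have hsk : (N : ℝ) * t < k + 1 := Nat.lt_floor_add_one _
      have hkN : k < N := (Nat.floor_lt ht0).2 (by nlinarith)
      have hs : (N : ℝ) * t - k ∈ Icc (0 : ℝ) 1 := ⟨by linarith, by linarith⟩
      have ht' : t = (k + ((N : ℝ) * t - k)) / N := by field_simp; ring
      have e1 : l[k % N]'(Nat.mod_lt _ hl) = l[k] := getElem_congr_idx (Nat.mod_eq_of_lt hkN)
      have hne := sub_ne_zero_of_edgeRatio_mem hl h k
      rw [e1] at hne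
      have hval : L t = Λ k + Complex.log (q k (N * t - k)) := rfl
      have hwk : w k = (l[(k + 1) % N]'(Nat.mod_lt _ hl) - z) / (l[k] - z) := by
        simp only [hw, edgeRatio]; rw [e1]
      rw [hval, Complex.exp_add, hΛ, exp_vertexLog' hl h k,
        Complex.exp_log (Complex.slitPlane_ne_zero (hq_slit k _ hs)), e1]
      conv_rhs => rw [ht', polygonLoop_apply_div hkN hs]
      rw [AffineMap.lineMap_apply_module', Complex.real_smul]
      simp only [hq, hwk]
      field_simp
      ring
    · rw [hL1, hΛ, exp_vertexLog' hl h N]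
      have hp : polygonLoop l 1 = l[0] := by
        have h0 := polygonLoop_vertex (l := l) (k := 0) hl
        rw [Nat.cast_zero, zero_div] at h0
        rw [← h0]
        simpa using periodic_polygonLoop l 0
      have e0 : l[N % N]'(Nat.mod_lt _ hl) = l[0] := getElem_congr_idx (Nat.mod_self _)
      rw [e0, hp]
  have h01 : (fun t ↦ polygonLoop l t - z) 0 = (fun t ↦ polygonLoop l t - z) 1 := by
    have := periodic_polygonLoop l 0
    simp only [zero_add] at this
    simp only [this]
  have hspec := wind_spec hLc hLexp h01
  rw [hL1, hL0] at hspec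
  have him := congrArg Complex.im hspec
  simp only [Complex.mul_im, Complex.intCast_re, Complex.intCast_im, zero_mul, add_zero,
    Complex.mul_re, Complex.re_ofNat, Complex.im_ofNat, Complex.ofReal_re, Complex.ofReal_im,
    Complex.I_re, Complex.I_im, mul_zero, sub_zero, mul_one] at him
  rw [hΛ, im_vertexLog'_sub hl N] at him
  rw [← him]

/-- The edge ratio only depends on `k mod N`. [folklore] -/
private theorem edgeRatio_mod (hl : 0 < l.length) (k : ℕ) : edgeRatio l z hl (k % l.length) = edgeRatio l z hl k := by
  unfold edgeRatio
  have e1 : l[(k % l.length + 1) % l.length]'(Nat.mod_lt _ hl) = l[(k + 1) % l.length]'(Nat.mod_lt _ hl) :=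
    getElem_congr_idx (Nat.mod_add_mod _ _ _)
  have e2 : l[k % l.length % l.length]'(Nat.mod_lt _ hl) = l[k % l.length]'(Nat.mod_lt _ hl) :=
    getElem_congr_idx (Nat.mod_mod _ _)
  rw [e1, e2]

/-- `wind_polygonLoop_sub_mul_two_pi` with the hypothesis on one period only.
[cite: AhlforsCA1979, Ch. 4 §2.1 (index of a point with respect to a closed curve)] -/
theorem wind_polygonLoop_sub_mul_two_pi' (hl : 0 < l.length)
    (h : ∀ k < l.length, edgeRatio l z hl k ∈ slitPlane) :
    (wind (fun t ↦ polygonLoop l t - z) : ℝ) * (2 * Real.pi) =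
      ∑ k ∈ Finset.range l.length, (edgeRatio l z hl k).arg :=
  wind_polygonLoop_sub_mul_two_pi hl fun k => by
    rw [← edgeRatio_mod hl k]; exact h _ (Nat.mod_lt _ hl)

end PolygonAngleSum

end Literature.Probability.RandomPlanarGeometry

namespace Literature.Probability.RandomPlanarGeometry.SAW.YangBaxter

/-! ## Part G. Lattice geometry of the drawn edges (mesh `4`)

Two kinds of closed segments occur as edges of the drawn excursion polygon: the *arc segment*
`[innerPt F s, innerPt F u]` of an arc of the face `F` from side `s` to side `u ≠ s`, and the *crossing
segment* of a mid-edge `e`, of length `2`, centred at `midPt e` and normal to `e` (joining the two inner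
points next to `e` in its two faces). We show: two crossing segments meet only if their mid-edges are
equal; a crossing segment meets an arc segment only if its mid-edge is the side of entry or exit of the
arc; two arc segments meet only if they are in the same face and share a side or are the two straight
arcs; and a crossing segment meets an arc segment through its own side only at the inner point. -/

/-- The unit normal of a mid-edge in the drawing (`(1,0)` for vertical edges, `(0,1)` for horizontal
ones). [folklore] -/
def MidEdge.nrm : MidEdge → ℤ × ℤ
  | .vert _ _ => (1, 0)
  | .slant _ _ => (0, 1)

/-- The crossing segment of a mid-edge: the closed segment of length `2` through `midPt e`, normal to
`e`. [folklore] -/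
def crossSeg (e : MidEdge) : Set ℂ := segment ℝ (toC (midPt e + e.nrm)) (toC (midPt e - e.nrm))

/-- The arc segment of the face `F` from side `s` to side `u`. [folklore] -/
def arcSeg (F : Face) (s u : Side) : Set ℂ := segment ℝ (toC (innerPt F s)) (toC (innerPt F u))

/-- Real coordinates of a point of a segment between lattice points. [folklore] -/
private theorem mem_segment_toC {A B : ℤ × ℤ} {p : ℂ} (h : p ∈ segment ℝ (toC A) (toC B)) :
    ∃ t : ℝ, 0 ≤ t ∧ t ≤ 1 ∧ p.re = A.1 + t * (B.1 - A.1) ∧ p.im = A.2 + t * (B.2 - A.2) := by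
  rw [segment_eq_image'] at h
  obtain ⟨t, ⟨h0, h1⟩, rfl⟩ := h
  refine ⟨t, h0, h1, ?_, ?_⟩ <;> simp [toC]

/-- The inner normal of a side is `±` the normal of the mid-edge. [folklore] -/
private theorem nIn_eq_nrm_or (F : Face) (s : Side) :
    s.nIn = (F.side s).nrm ∨ s.nIn = -(F.side s).nrm := by
  cases s <;> simp [Side.nIn, Face.side, MidEdge.nrm]

/-- The crossing segment of the side `s` of `F` joins `innerPt F s` to the point opposite it across the
edge. [folklore] -/
private theorem crossSeg_side_eq (F : Face) (s : Side) :
    crossSeg (F.side s) = segment ℝ (toC (innerPt F s)) (toC (midPt (F.side s) - s.nIn)) := by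
  rw [crossSeg, innerPt_eq]
  rcases nIn_eq_nrm_or F s with h | h
  · rw [h]
  · rw [h, ← sub_eq_add_neg, sub_neg_eq_add, segment_symm]

/-- The crossing segment of a side, in offsets from the face's base corner. [folklore] -/
private theorem crossSeg_side_eq' (F : Face) (s : Side) :
    crossSeg (F.side s) = segment ℝ (toC (F.base + s.inOff)) (toC (F.base + (s.offset - s.nIn))) := by
  rw [crossSeg_side_eq, innerPt, midPt_side, add_sub_assoc]

/-- Coordinates on a vertical crossing segment. [folklore] -/
private theorem cross_vert {k j : ℤ} {p : ℂ} (h : p ∈ crossSeg (.vert k j)) :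
    p.im = 4 * j + 2 ∧ |p.re - 4 * k| ≤ 1 := by
  obtain ⟨t, h0, h1, hx, hy⟩ := mem_segment_toC h
  simp only [midPt, MidEdge.nrm, Prod.fst_add, Prod.snd_add, Prod.fst_sub, Prod.snd_sub, Int.cast_add,
    Int.cast_mul, Int.cast_sub, Int.cast_ofNat, Int.cast_one, Int.cast_zero] at hx hy
  refine ⟨by rw [hy]; ring, ?_⟩
  rw [hx, abs_le]; constructor <;> linarith

/-- Coordinates on a horizontal crossing segment. [folklore] -/
private theorem cross_slant {k j : ℤ} {p : ℂ} (h : p ∈ crossSeg (.slant k j)) :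
    p.re = 4 * k + 2 ∧ |p.im - 4 * j| ≤ 1 := by
  obtain ⟨t, h0, h1, hx, hy⟩ := mem_segment_toC h
  simp only [midPt, MidEdge.nrm, Prod.fst_add, Prod.snd_add, Prod.fst_sub, Prod.snd_sub, Int.cast_add,
    Int.cast_mul, Int.cast_sub, Int.cast_ofNat, Int.cast_one, Int.cast_zero] at hx hy
  refine ⟨by rw [hx]; ring, ?_⟩
  rw [hy, abs_le]; constructor <;> linarith

/-- Coordinates on an arc segment: within `1` of the centre in each coordinate, and on the far side of
every side the arc does not touch. [folklore] -/
private theorem arc_coords {F : Face} {s u : Side} {p : ℂ} (h : p ∈ arcSeg F s u) :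
    |p.re - (4 * F.1 + 2)| ≤ 1 ∧ |p.im - (4 * F.2 + 2)| ≤ 1 ∧
      (s ≠ .W → u ≠ .W → (4 * F.1 + 2 : ℝ) ≤ p.re) ∧ (s ≠ .E → u ≠ .E → p.re ≤ 4 * F.1 + 2) ∧
      (s ≠ .S → u ≠ .S → (4 * F.2 + 2 : ℝ) ≤ p.im) ∧ (s ≠ .N → u ≠ .N → p.im ≤ 4 * F.2 + 2) := by
  obtain ⟨t, h0, h1, hx, hy⟩ := mem_segment_toC h
  obtain ⟨a, b⟩ := F
  cases s <;> cases u <;>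
    simp only [innerPt, Face.base, Side.inOff, Side.offset, Side.nIn,
      Prod.mk_add_mk, Int.cast_add, Int.cast_mul, Int.cast_ofNat, Int.cast_one, Int.cast_zero,
      Int.cast_neg] at hx hy ⊢ <;>
    (refine ⟨?_, ?_, ?_, ?_, ?_, ?_⟩ <;>
      (first
        | (rw [abs_le]; constructor <;> nlinarith)
        | (intro h h'; first | exact absurd rfl h | exact absurd rfl h' | nlinarith)))

/-- The arc segment starts strictly inside from its entry side: on `arcSeg F s u` the coordinate along the
inner normal of `s` is at least that of `innerPt F s`, with equality only at `innerPt F s`. [folklore] -/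
private theorem arc_start {F : Face} {s u : Side} (hsu : s ≠ u) {p : ℂ} (h : p ∈ arcSeg F s u) :
    (s = .W → (4 * F.1 + 1 : ℝ) ≤ p.re ∧ (p.re = 4 * F.1 + 1 → p = toC (innerPt F .W))) ∧
    (s = .E → p.re ≤ (4 * F.1 + 3 : ℝ) ∧ (p.re = 4 * F.1 + 3 → p = toC (innerPt F .E))) ∧
    (s = .S → (4 * F.2 + 1 : ℝ) ≤ p.im ∧ (p.im = 4 * F.2 + 1 → p = toC (innerPt F .S))) ∧
    (s = .N → p.im ≤ (4 * F.2 + 3 : ℝ) ∧ (p.im = 4 * F.2 + 3 → p = toC (innerPt F .N))) := by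
  obtain ⟨t, h0, h1, hx, hy⟩ := mem_segment_toC h
  obtain ⟨a, b⟩ := F
  cases s <;> cases u <;> (try exact absurd rfl hsu) <;>
    simp only [innerPt, Face.base, Side.inOff, Side.offset, Side.nIn,
      Prod.mk_add_mk, Int.cast_add, Int.cast_mul, Int.cast_ofNat, Int.cast_one, Int.cast_zero,
      Int.cast_neg, reduceCtorEq, IsEmpty.forall_iff, true_and, and_true, forall_true_left] at hx hy ⊢ <;>
    (refine ⟨by nlinarith, fun he => ?_⟩;
      (have ht : t = 0 := by nlinarith);
      (apply Complex.ext <;> norm_num [toC, hx, hy, ht]))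

/-- **Two crossing segments meet only if their mid-edges coincide.** [folklore] -/
private theorem eq_of_mem_crossSeg {e e' : MidEdge} {p : ℂ} (h : p ∈ crossSeg e) (h' : p ∈ crossSeg e') : e = e' := by
  cases e with
  | vert k j =>
    obtain ⟨hy, hx⟩ := cross_vert h
    cases e' with
    | vert k' j' =>
      obtain ⟨hy', hx'⟩ := cross_vert h'
      rw [abs_le] at hx hx'
      have hj : j = j' := by
        have : (j : ℝ) = j' := by linarith
        exact_mod_cast this
      have hk : k = k' := by
        have h1 : (k : ℝ) < k' + 1 := by linarith
        have h2 : (k' : ℝ) < k + 1 := by linarith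
        have h1' : k < k' + 1 := by exact_mod_cast h1
        have h2' : k' < k + 1 := by exact_mod_cast h2
        omega
      rw [hj, hk]
    | slant k' j' =>
      obtain ⟨hx', hy'⟩ := cross_slant h'
      rw [abs_le] at hx
      rw [hx'] at hx
      have h1 : ((k' - k : ℤ) : ℝ) < 0 := by push_cast; linarith
      have h2 : (-1 : ℝ) < ((k' - k : ℤ) : ℝ) := by push_cast; linarith
      have h1' : k' - k < 0 := by exact_mod_cast h1
      have h2' : -1 < k' - k := by exact_mod_cast h2
      omega
  | slant k j =>
    obtain ⟨hx, hy⟩ := cross_slant h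
    cases e' with
    | vert k' j' =>
      obtain ⟨hy', hx'⟩ := cross_vert h'
      rw [abs_le] at hx'
      rw [hx] at hx'
      have h1 : ((k - k' : ℤ) : ℝ) < 0 := by push_cast; linarith
      have h2 : (-1 : ℝ) < ((k - k' : ℤ) : ℝ) := by push_cast; linarith
      have h1' : k - k' < 0 := by exact_mod_cast h1
      have h2' : -1 < k - k' := by exact_mod_cast h2
      omega
    | slant k' j' =>
      obtain ⟨hx', hy'⟩ := cross_slant h'
      rw [abs_le] at hy hy'
      have hk : k = k' := by
        have : (k : ℝ) = k' := by linarith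
        exact_mod_cast this
      have hj : j = j' := by
        have h1 : (j : ℝ) < j' + 1 := by linarith
        have h2 : (j' : ℝ) < j + 1 := by linarith
        have h1' : j < j' + 1 := by exact_mod_cast h1
        have h2' : j' < j + 1 := by exact_mod_cast h2
        omega
      rw [hj, hk]

/-- **A crossing segment meets an arc segment only through the entry or exit side of the arc.**
[folklore] -/
private theorem eq_side_of_mem_crossSeg_arcSeg {e : MidEdge} {F : Face} {s u : Side} {p : ℂ}
    (h : p ∈ crossSeg e) (h' : p ∈ arcSeg F s u) : e = F.side s ∨ e = F.side u := by
  obtain ⟨hre, him, hW, hE, hS, hN⟩ := arc_coords h'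
  obtain ⟨a, b⟩ := F
  simp only at hre him hW hE hS hN
  cases e with
  | vert k j =>
    obtain ⟨hy, hx⟩ := cross_vert h
    rw [abs_le] at hre him hx
    have hj : j = b := by
      have h1 : (j : ℝ) < b + 1 := by linarith
      have h2 : (b : ℝ) < j + 1 := by linarith
      have h1' : j < b + 1 := by exact_mod_cast h1
      have h2' : b < j + 1 := by exact_mod_cast h2
      omega
    subst hj
    have hk : k = a ∨ k = a + 1 := by
      have h1 : (k : ℝ) < a + 2 := by linarith
      have h2 : (a : ℝ) < k + 1 := by linarith
      have h1' : k < a + 2 := by exact_mod_cast h1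
      have h2' : a < k + 1 := by exact_mod_cast h2
      omega
    rcases hk with rfl | rfl
    · -- the `W` side
      by_cases hs : s = .W
      · left; subst hs; rfl
      by_cases hu : u = .W
      · right; subst hu; rfl
      have := hW hs hu
      linarith
    · by_cases hs : s = .E
      · left; subst hs; simp [Face.side]
      by_cases hu : u = .E
      · right; subst hu; simp [Face.side]
      have := hE hs hu
      push_cast at hx
      linarith
  | slant k j =>
    obtain ⟨hx, hy⟩ := cross_slant h
    rw [abs_le] at hre him hy
    have hk : k = a := by
      have h1 : (k : ℝ) < a + 1 := by linarith
      have h2 : (a : ℝ) < k + 1 := by linarith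
      have h1' : k < a + 1 := by exact_mod_cast h1
      have h2' : a < k + 1 := by exact_mod_cast h2
      omega
    subst hk
    have hj : j = b ∨ j = b + 1 := by
      have h1 : (j : ℝ) < b + 2 := by linarith
      have h2 : (b : ℝ) < j + 1 := by linarith
      have h1' : j < b + 2 := by exact_mod_cast h1
      have h2' : b < j + 1 := by exact_mod_cast h2
      omega
    rcases hj with rfl | rfl
    · by_cases hs : s = .S
      · left; subst hs; rfl
      by_cases hu : u = .S
      · right; subst hu; rfl
      have := hS hs hu
      linarith
    · by_cases hs : s = .N
      · left; subst hs; simp [Face.side]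
      by_cases hu : u = .N
      · right; subst hu; simp [Face.side]
      have := hN hs hu
      push_cast at hy
      linarith

/-- **Arc segments in different faces are disjoint.** [folklore] -/
private theorem eq_face_of_mem_arcSeg {F F' : Face} {s u s' u' : Side} {p : ℂ} (h : p ∈ arcSeg F s u)
    (h' : p ∈ arcSeg F' s' u') : F = F' := by
  obtain ⟨hre, him, -⟩ := arc_coords h
  obtain ⟨hre', him', -⟩ := arc_coords h'
  obtain ⟨a, b⟩ := F; obtain ⟨a', b'⟩ := F'
  simp only at hre him hre' him'
  rw [abs_le] at hre him hre' him'
  have ha : a = a' := by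
    have h1 : (a : ℝ) < a' + 1 := by linarith
    have h2 : (a' : ℝ) < a + 1 := by linarith
    have h1' : a < a' + 1 := by exact_mod_cast h1
    have h2' : a' < a + 1 := by exact_mod_cast h2
    omega
  have hb : b = b' := by
    have h1 : (b : ℝ) < b' + 1 := by linarith
    have h2 : (b' : ℝ) < b + 1 := by linarith
    have h1' : b < b' + 1 := by exact_mod_cast h1
    have h2' : b' < b + 1 := by exact_mod_cast h2
    omega
  rw [ha, hb]

/-- **Two arcs of one face with pairwise distinct sides meet only if both are straight.** [folklore] -/
private theorem straight_of_mem_arcSeg_arcSeg {F : Face} {s u s' u' : Side} {p : ℂ} (h : p ∈ arcSeg F s u)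
    (h' : p ∈ arcSeg F s' u') (h1 : s ≠ s') (h2 : s ≠ u') (h3 : u ≠ s') (h4 : u ≠ u') (hsu : s ≠ u)
    (hsu' : s' ≠ u') : u = s.opp := by
  obtain ⟨t, ht0, ht1, hx, hy⟩ := mem_segment_toC h
  obtain ⟨t', ht0', ht1', hx', hy'⟩ := mem_segment_toC h'
  obtain ⟨a, b⟩ := F
  cases s <;> cases u <;> cases s' <;> cases u' <;> (try exact absurd rfl hsu) <;> (try exact absurd rfl hsu') <;>
    (try exact absurd rfl h1) <;> (try exact absurd rfl h2) <;> (try exact absurd rfl h3) <;> (try exact absurd rfl h4) <;>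
    (try rfl) <;>
    simp only [innerPt, Face.base, Side.inOff, Side.offset, Side.nIn,
      Prod.mk_add_mk, Int.cast_add, Int.cast_mul, Int.cast_ofNat, Int.cast_one, Int.cast_zero,
      Int.cast_neg] at hx hy hx' hy' <;> linarith

/-- **The crossing segment of a side meets an arc from that side only at the inner point.** [folklore] -/
private theorem eq_innerPt_of_mem_crossSeg_arcSeg {F : Face} {s u : Side} (hsu : s ≠ u) {p : ℂ}
    (h : p ∈ crossSeg (F.side s)) (h' : p ∈ arcSeg F s u) : p = toC (innerPt F s) := by
  obtain ⟨hW, hE, hS, hN⟩ := arc_start hsu h'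
  obtain ⟨a, b⟩ := F
  cases s
  · obtain ⟨h1, h2⟩ := hW rfl
    obtain ⟨hy, hx⟩ := cross_vert h
    rw [abs_le] at hx
    exact h2 (by push_cast at hx h1 ⊢; linarith)
  · obtain ⟨h1, h2⟩ := hE rfl
    have h'' : p ∈ crossSeg (.vert (a + 1) b) := h
    obtain ⟨hy, hx⟩ := cross_vert h''
    rw [abs_le] at hx
    exact h2 (by push_cast at hx h1 ⊢; linarith)
  · obtain ⟨h1, h2⟩ := hS rfl
    obtain ⟨hx, hy⟩ := cross_slant h
    rw [abs_le] at hy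
    exact h2 (by push_cast at hy h1 ⊢; linarith)
  · obtain ⟨h1, h2⟩ := hN rfl
    have h'' : p ∈ crossSeg (.slant a (b + 1)) := h
    obtain ⟨hx, hy⟩ := cross_slant h''
    rw [abs_le] at hy
    exact h2 (by push_cast at hy h1 ⊢; linarith)


/-! ## Part J. The excursion polygon as a closed lattice polygon: vertices, edges, simplicity -/

namespace ΩG

open YBWalk

open private Qp_mid pJpt_lt pJpt_c₂ pJpt_top fc_fh fc_ne fh_add_Mv three_le
  from Literature.Probability.RandomPlanarGeometry.YangBaxterSAWGeneralDomain

variable {D : Set Face} {a : MidEdge} {r : Face} {ω : ΩG D a r} {hr : RootedFace D a r}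

/-! ### Slots: the chord of `r` (slot `0`) and the arcs of the excursion (slots `1, …, Mv - 1`) -/

variable (ω hr) in
/-- The face of slot `j`: `r` for the chord, the face of the `j`-th excursion arc otherwise. [folklore] -/
def jFace (_h : ω.IsB2a) (j : ℕ) : Face := if j = 0 then r else ω.2.fc (ω.2.firstHitG + j)

variable (ω hr) in
/-- The entry side of slot `j` (for the chord: the return side). [folklore] -/
def jIn (_h : ω.IsB2a) (j : ℕ) : Side := if j = 0 then ω.1 else ω.2.sIn (ω.2.firstHitG + j)

variable (ω hr) in
/-- The exit side of slot `j` (for the chord: the exit side of the excursion). [folklore] -/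
def jOut (h : ω.IsB2a) (j : ℕ) : Side := if j = 0 then ω.z1 hr h else ω.2.sOut (ω.2.firstHitG + j)

variable (ω hr) in
/-- The index in `mids` of the entry mid-edge of slot `j`. [folklore] -/
def inIdx (_h : ω.IsB2a) (j : ℕ) : ℕ := if j = 0 then ω.2.arcs.length else ω.2.firstHitG + j

/-- Slot `0` is the chord. [folklore] -/
private theorem jFace_zero (h : ω.IsB2a) : ω.jFace h 0 = r := if_pos rfl
/-- Slot `0` is the chord. [folklore] -/
private theorem jIn_zero (h : ω.IsB2a) : ω.jIn h 0 = ω.1 := if_pos rfl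
/-- Slot `0` is the chord. [folklore] -/
private theorem jOut_zero (h : ω.IsB2a) : ω.jOut hr h 0 = ω.z1 hr h := if_pos rfl
/-- Positive slots are excursion arcs. [folklore] -/
private theorem jFace_pos (h : ω.IsB2a) {j : ℕ} (hj : j ≠ 0) : ω.jFace h j = ω.2.fc (ω.2.firstHitG + j) := if_neg hj
/-- Positive slots are excursion arcs. [folklore] -/
private theorem jIn_pos (h : ω.IsB2a) {j : ℕ} (hj : j ≠ 0) : ω.jIn h j = ω.2.sIn (ω.2.firstHitG + j) := if_neg hj
/-- Positive slots are excursion arcs. [folklore] -/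
private theorem jOut_pos (h : ω.IsB2a) {j : ℕ} (hj : j ≠ 0) : ω.jOut hr h j = ω.2.sOut (ω.2.firstHitG + j) := if_neg hj

/-- Index bookkeeping. [folklore] -/
private theorem len_eq (h : ω.IsB2a) : ω.2.arcs.length = ω.2.firstHitG + ω.Mv := (fh_add_Mv h).symm

/-- The excursion faces are not `r`. [folklore] -/
private theorem jFace_ne_r (hr : RootedFace D a r) (h : ω.IsB2a) {j : ℕ} (hj : j ≠ 0) (hjM : j < ω.Mv) :
    ω.jFace h j ≠ r := by
  rw [jFace_pos h hj]
  exact fc_ne ω hr h (by omega) (by rw [len_eq h]; omega)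

/-- Distinct slots in one face are two distinct excursion arcs. [folklore] -/
private theorem jFace_eq_iff (hr : RootedFace D a r) (h : ω.IsB2a) {j j' : ℕ} (hj : j < ω.Mv) (hj' : j' < ω.Mv)
    (hne : j ≠ j') (he : ω.jFace h j = ω.jFace h j') : j ≠ 0 ∧ j' ≠ 0 := by
  constructor
  · rintro rfl
    rw [jFace_zero] at he
    exact jFace_ne_r hr h (Ne.symm hne) hj' he.symm
  · rintro rfl
    rw [jFace_zero] at he
    exact jFace_ne_r hr h hne hj he

/-- The entry and exit sides of a slot differ. [folklore] -/
private theorem jIn_ne_jOut (h : ω.IsB2a) {j : ℕ} (hj : j < ω.Mv) : ω.jIn h j ≠ ω.jOut hr h j := by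
  by_cases hj0 : j = 0
  · subst hj0
    rw [jIn_zero, jOut_zero]
    have hd := ω.2.sides_distinctG hr h.1
    rw [ω.returnSide_of_isB2a h] at hd
    exact hd.2.2
  · rw [jIn_pos h hj0, jOut_pos h hj0]
    exact (YBWalk.side_sIn (by rw [len_eq h]; omega)).2.2

/-- The exit mid-edge of slot `j` is `mids[fh + j + 1]`. [folklore] -/
private theorem side_jOut (h : ω.IsB2a) {j : ℕ} (hj : j < ω.Mv) :
    (ω.jFace h j).side (ω.jOut hr h j) = ω.2.nth (ω.2.firstHitG + j + 1) := by
  by_cases hj0 : j = 0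
  · subst hj0
    rw [jFace_zero, jOut_zero, z1, add_zero]
    exact (ω.2.exitSide_specG hr (ω.fh_lt h)).1.symm
  · rw [jFace_pos h hj0, jOut_pos h hj0]
    have hi : ω.2.firstHitG + j < ω.2.arcs.length := by rw [len_eq h]; omega
    rw [(YBWalk.side_sIn hi).2.1, ← ω.2.nth_eq_getElem]

/-- The entry mid-edge of slot `j` is `mids[inIdx j]`. [folklore] -/
private theorem side_jIn (h : ω.IsB2a) {j : ℕ} (hj : j < ω.Mv) :
    (ω.jFace h j).side (ω.jIn h j) = ω.2.nth (ω.inIdx h j) := by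
  by_cases hj0 : j = 0
  · subst hj0
    rw [jFace_zero, jIn_zero, inIdx, if_pos rfl]
    have hn : 0 < ω.2.arcs.length := by have := ω.fh_lt h; omega
    have e := YBWalk.side_sOut_lastG (γ := ω.2) hn
    rw [(YBWalk.side_sIn (show ω.2.arcs.length - 1 < ω.2.arcs.length by omega)).2.1, ← ω.2.nth_eq_getElem,
      show ω.2.arcs.length - 1 + 1 = ω.2.arcs.length by omega] at e
    exact e.symm
  · rw [jFace_pos h hj0, jIn_pos h hj0, inIdx, if_neg hj0]
    have hi : ω.2.firstHitG + j < ω.2.arcs.length := by rw [len_eq h]; omega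
    rw [(YBWalk.side_sIn hi).1, ← ω.2.nth_eq_getElem]

/-- The entry mid-edge of slot `j + 1 (mod Mv)` is the exit mid-edge of slot `j`. [folklore] -/
private theorem inIdx_succ (hr : RootedFace D a r) (h : ω.IsB2a) {j : ℕ} (hj : j < ω.Mv) :
    ω.inIdx h ((j + 1) % ω.Mv) = ω.2.firstHitG + j + 1 := by
  have hM := three_le_Mv hr h
  by_cases hl : j + 1 = ω.Mv
  · rw [hl, Nat.mod_self, inIdx, if_pos rfl, len_eq h]; omega
  · rw [Nat.mod_eq_of_lt (by omega), inIdx, if_neg (by omega)]; omega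

/-- `nth` is injective on the indices of the walk. [folklore] -/
private theorem nth_inj (h : ω.IsB2a) {i i' : ℕ} (hi : i ≤ ω.2.arcs.length) (hi' : i' ≤ ω.2.arcs.length)
    (e : ω.2.nth i = ω.2.nth i') : i = i' := by
  have hfh := ω.fh_lt h
  have hl : i < ω.2.mids.length := by have := ω.2.length_arcs; omega
  have hl' : i' < ω.2.mids.length := by have := ω.2.length_arcs; omega
  rw [ω.2.nth_eq_getElem hl, ω.2.nth_eq_getElem hl'] at e
  exact (List.Nodup.getElem_inj_iff ω.2.nodup).1 e

/-- The exit mid-edges of distinct slots differ. [folklore] -/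
private theorem jOut_side_inj (h : ω.IsB2a) {j j' : ℕ} (hj : j < ω.Mv) (hj' : j' < ω.Mv)
    (e : (ω.jFace h j).side (ω.jOut hr h j) = (ω.jFace h j').side (ω.jOut hr h j')) : j = j' := by
  rw [side_jOut h hj, side_jOut h hj'] at e
  have := nth_inj h (by rw [len_eq h]; omega) (by rw [len_eq h]; omega) e
  omega

/-- An exit mid-edge equals an entry mid-edge only for consecutive slots. [folklore] -/
private theorem jOut_side_eq_jIn_side (h : ω.IsB2a) {j j' : ℕ} (hj : j < ω.Mv) (hj' : j' < ω.Mv)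
    (e : (ω.jFace h j).side (ω.jOut hr h j) = (ω.jFace h j').side (ω.jIn h j')) : j' = (j + 1) % ω.Mv := by
  rw [side_jOut h hj, side_jIn h hj'] at e
  have hI : ω.inIdx h j' ≤ ω.2.arcs.length := by
    unfold inIdx; split_ifs <;> [exact le_rfl; (rw [len_eq h]; omega)]
  have := nth_inj h (by rw [len_eq h]; omega) hI e
  unfold inIdx at this
  split_ifs at this with hj0
  · subst hj0; rw [len_eq h] at this
    have : j + 1 = ω.Mv := by omega
    rw [this, Nat.mod_self]
  · have : j' = j + 1 := by omega
    rw [this, Nat.mod_eq_of_lt (by omega)]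

/-! ### The vertices of `J` -/

/-- Even vertices: `pJpt (2j) = innerPt (jFace j) (jOut j)`. [folklore] -/
private theorem pJpt_even (h : ω.IsB2a) {j : ℕ} (hj : j < ω.Mv) :
    ω.pJpt hr h (2 * j) = innerPt (ω.jFace h j) (ω.jOut hr h j) := by
  have hM := three_le_Mv hr h
  by_cases hj0 : j = 0
  · subst hj0
    rw [jFace_zero, jOut_zero, mul_zero, pJpt_lt h (by omega), zero_add, ω.Qp_two h, innerPt]
  · rw [jFace_pos h hj0, jOut_pos h hj0, pJpt_lt h (by omega), Qp_mid h (by omega) (by omega),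
      show 2 * ω.2.firstHitG + (2 * j + 2) = 2 * (ω.2.firstHitG + j) + 2 by ring,
      YBWalk.vtx_even (by rw [len_eq h]; omega), YBWalk.ptOut]

/-- Odd vertices: `pJpt (2j - 1) = innerPt (jFace j) (jIn j)` for `1 ≤ j`. [folklore] -/
private theorem pJpt_odd (h : ω.IsB2a) {j : ℕ} (hj1 : 1 ≤ j) (hj : j < ω.Mv) :
    ω.pJpt hr h (2 * j - 1) = innerPt (ω.jFace h j) (ω.jIn h j) := by
  have hM := three_le_Mv hr h
  rw [jFace_pos h (by omega), jIn_pos h (by omega), pJpt_lt h (by omega), Qp_mid h (by omega) (by omega),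
    show 2 * ω.2.firstHitG + (2 * j - 1 + 2) = 2 * (ω.2.firstHitG + j) + 1 by omega,
    YBWalk.vtx_odd (by rw [len_eq h]; omega), YBWalk.ptIn]

/-- The closing vertex: `pJpt (2Mv - 1) = innerPt r (ω.1) = innerPt (jFace 0) (jIn 0)`. [folklore] -/
private theorem pJpt_last (h : ω.IsB2a) : ω.pJpt hr h (2 * ω.Mv - 1) = innerPt (ω.jFace h 0) (ω.jIn h 0) := by
  rw [pJpt_c₂ h, jFace_zero, jIn_zero, innerPt]

/-- The first vertex: `pJpt 0 = innerPt r z₁`. [folklore] -/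
private theorem pJpt_zero (h : ω.IsB2a) : ω.pJpt hr h 0 = innerPt r (ω.z1 hr h) := by
  have e := pJpt_even (hr := hr) h (j := 0) (by have := three_le_Mv hr h; omega)
  rwa [mul_zero, jFace_zero, jOut_zero] at e

/-- The closing vertex: `pJpt (2Mv - 1) = innerPt r (ω.1)`. [folklore] -/
private theorem pJpt_last' (h : ω.IsB2a) : ω.pJpt hr h (2 * ω.Mv - 1) = innerPt r ω.1 := by
  rw [pJpt_last h, jFace_zero, jIn_zero]

/-- The entry vertex of slot `j` in general position: index `(2j + 2Mv - 1) % (2Mv)`. [folklore] -/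
private theorem pJpt_in (h : ω.IsB2a) {j : ℕ} (hj : j < ω.Mv) :
    ω.pJpt hr h ((2 * j + 2 * ω.Mv - 1) % (2 * ω.Mv)) = innerPt (ω.jFace h j) (ω.jIn h j) := by
  have hM := three_le_Mv hr h
  by_cases hj0 : j = 0
  · subst hj0
    rw [mul_zero, zero_add, Nat.mod_eq_of_lt (by omega), pJpt_last h]
  · rw [show 2 * j + 2 * ω.Mv - 1 = (2 * j - 1) + 2 * ω.Mv by omega, Nat.add_mod_right,
      Nat.mod_eq_of_lt (by omega), pJpt_odd h (by omega) hj]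

/-- `J` is closed, as lattice points. [folklore] -/
private theorem pJpt_closed (h : ω.IsB2a) : ω.pJpt hr h (2 * ω.Mv) = ω.pJpt hr h 0 := by
  have hM := three_le_Mv hr h
  rw [pJpt_top h, pJpt_lt h (by omega)]

/-- **The vertices of `J` are pairwise distinct.** [folklore] -/
private theorem pJpt_injective (h : ω.IsB2a) {k k' : ℕ} (hk : k < 2 * ω.Mv) (hk' : k' < 2 * ω.Mv)
    (e : ω.pJpt hr h k = ω.pJpt hr h k') : k = k' := by
  have hM := three_le_Mv hr h
  have hlen := len_eq h
  have hfh := ω.fh_lt h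
  -- the special vertex
  have special : ∀ k, k ≤ 2 * ω.Mv - 2 → ω.pJpt hr h k ≠ ω.pJpt hr h (2 * ω.Mv - 1) := by
    intro k hk2 he
    rw [pJpt_c₂ h, pJpt_lt h hk2, Qp_mid h (by omega) (by omega)] at he
    change ω.2.vtx (2 * ω.2.firstHitG + (k + 2)) = innerPt r ω.1 at he
    obtain ⟨i, rfl | rfl⟩ := Nat.even_or_odd' k
    · rw [show 2 * ω.2.firstHitG + (2 * i + 2) = 2 * (ω.2.firstHitG + i) + 2 by ring,
        YBWalk.vtx_even (by omega), YBWalk.ptOut] at he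
      obtain ⟨hf, hs⟩ := innerPt_inj he
      rcases Nat.eq_zero_or_pos i with rfl | hi
      · rw [add_zero, (fc_fh ω hr h).2.2] at hs
        have hd := ω.2.sides_distinctG hr h.1
        rw [ω.returnSide_of_isB2a h] at hd
        exact hd.2.2 hs.symm
      · exact fc_ne ω hr h (by omega) (by omega) hf
    · rw [show 2 * ω.2.firstHitG + (2 * i + 1 + 2) = 2 * (ω.2.firstHitG + i + 1) + 1 by ring,
        YBWalk.vtx_odd (by omega), YBWalk.ptIn] at he
      obtain ⟨hf, -⟩ := innerPt_inj he
      exact fc_ne ω hr h (by omega) (by omega) hf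
  rcases Nat.lt_or_ge k (2 * ω.Mv - 1) with h1 | h1 <;> rcases Nat.lt_or_ge k' (2 * ω.Mv - 1) with h2 | h2
  · rw [pJpt_lt h (by omega), pJpt_lt h (by omega), Qp_mid h (by omega) (by omega),
      Qp_mid h (by omega) (by omega)] at e
    have := YBWalk.vtx_injective (γ := ω.2) (by omega) (by omega) (by omega) e
    omega
  · have hk'e : k' = 2 * ω.Mv - 1 := by omega
    subst hk'e
    exact absurd e (special k (by omega))
  · have hke : k = 2 * ω.Mv - 1 := by omega
    subst hke
    exact absurd e.symm (special k' (by omega))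
  · omega

/-! ### The vertex list and the edges of `J` -/

variable (ω hr) in
/-- The vertex list of the excursion polygon `J` (`2 Mv` complex points). [folklore] -/
def pJlist (h : ω.IsB2a) : List ℂ := (List.range (2 * ω.Mv)).map (ω.pJ hr h)

/-- `J` has `2 Mv` vertices. [folklore] -/
@[simp] private theorem length_pJlist (h : ω.IsB2a) : (ω.pJlist hr h).length = 2 * ω.Mv := by simp [pJlist]

/-- The `k`-th vertex of the list is `pJ k`. [folklore] -/
private theorem pJlist_getElem (h : ω.IsB2a) {k : ℕ} (hk : k < (ω.pJlist hr h).length) :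
    (ω.pJlist hr h)[k] = ω.pJ hr h k := by
  simp [pJlist]

/-- The vertex list is nonempty. [folklore] -/
private theorem pJlist_pos (h : ω.IsB2a) : 0 < (ω.pJlist hr h).length := by
  rw [length_pJlist]; have := three_le_Mv hr h; omega

/-- The vertex after `k` (cyclically) is `pJ (k + 1)`. [folklore] -/
private theorem pJlist_getElem_succ (h : ω.IsB2a) {k : ℕ} (hk : k < 2 * ω.Mv) :
    (ω.pJlist hr h)[(k + 1) % (ω.pJlist hr h).length]'(Nat.mod_lt _ (pJlist_pos h)) = ω.pJ hr h (k + 1) := by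
  rw [pJlist_getElem]
  simp only [length_pJlist]
  by_cases hl : k + 1 = 2 * ω.Mv
  · rw [hl, Nat.mod_self, ω.pJ_closed h]
  · rw [Nat.mod_eq_of_lt (by omega)]

/-- The closed edge `k` of `J`. [folklore] -/
private theorem segment_pJ_even (h : ω.IsB2a) {j : ℕ} (hj : j < ω.Mv) :
    segment ℝ (ω.pJ hr h (2 * j)) (ω.pJ hr h (2 * j + 1)) = crossSeg ((ω.jFace h j).side (ω.jOut hr h j)) := by
  have hM := three_le_Mv hr h
  rw [ω.pJ_eq_toC h, ω.pJ_eq_toC h, pJpt_even h hj, crossSeg_side_eq]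
  -- the next vertex is the entry inner point of slot `(j+1) % Mv`, across the exit mid-edge of slot `j`
  have e1 : ω.pJpt hr h (2 * j + 1) = innerPt (ω.jFace h ((j + 1) % ω.Mv)) (ω.jIn h ((j + 1) % ω.Mv)) := by
    rw [← pJpt_in (hr := hr) h (Nat.mod_lt _ (by omega))]
    congr 1
    by_cases hl : j + 1 = ω.Mv
    · rw [hl, Nat.mod_self, mul_zero, zero_add, Nat.mod_eq_of_lt (by omega)]; omega
    · rw [Nat.mod_eq_of_lt (show j + 1 < ω.Mv by omega),
        show 2 * (j + 1) + 2 * ω.Mv - 1 = (2 * j + 1) + 2 * ω.Mv by omega, Nat.add_mod_right,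
        Nat.mod_eq_of_lt (by omega)]
  have hside : (ω.jFace h ((j + 1) % ω.Mv)).side (ω.jIn h ((j + 1) % ω.Mv)) =
      (ω.jFace h j).side (ω.jOut hr h j) := by
    rw [side_jIn h (Nat.mod_lt _ (by omega)), inIdx_succ hr h hj, side_jOut h hj]
  have hface : ω.jFace h ((j + 1) % ω.Mv) ≠ ω.jFace h j := by
    intro hf
    have hjj : (j + 1) % ω.Mv ≠ j := by
      intro hh
      by_cases hl : j + 1 = ω.Mv
      · rw [hl, Nat.mod_self] at hh; omega
      · rw [Nat.mod_eq_of_lt (by omega)] at hh; omega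
    obtain ⟨h1, h2⟩ := jFace_eq_iff hr h (Nat.mod_lt _ (by omega)) hj hjj hf
    rw [jFace_pos h h1, jFace_pos h h2] at hf
    -- consecutive arcs lie in different faces
    by_cases hl : j + 1 = ω.Mv
    · rw [hl, Nat.mod_self] at h1; exact h1 rfl
    · rw [Nat.mod_eq_of_lt (show j + 1 < ω.Mv by omega)] at hf
      exact YBWalk.fc_succ_ne (γ := ω.2) (i := ω.2.firstHitG + j) (by rw [len_eq h]; omega)
        (by rw [show ω.2.firstHitG + j + 1 = ω.2.firstHitG + (j + 1) by ring]; exact hf.symm)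
  rw [e1, innerPt_eq (ω.jFace h ((j + 1) % ω.Mv)), hside, nIn_eq_neg_of_side_eq hside.symm hface.symm,
    ← sub_eq_add_neg]

/-- The closed arc edge of slot `j` of `J`. [folklore] -/
private theorem segment_pJ_odd (h : ω.IsB2a) {j : ℕ} (hj : j < ω.Mv) :
    segment ℝ (ω.pJ hr h ((2 * j + 2 * ω.Mv - 1) % (2 * ω.Mv))) (ω.pJ hr h ((2 * j + 2 * ω.Mv - 1) % (2 * ω.Mv) + 1)) =
      arcSeg (ω.jFace h j) (ω.jIn h j) (ω.jOut hr h j) := by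
  have hM := three_le_Mv hr h
  rw [ω.pJ_eq_toC h, ω.pJ_eq_toC h, pJpt_in h hj, arcSeg]
  congr 2
  by_cases hj0 : j = 0
  · subst hj0
    rw [mul_zero, zero_add, Nat.mod_eq_of_lt (by omega), show 2 * ω.Mv - 1 + 1 = 2 * ω.Mv by omega,
      pJpt_closed h, ← pJpt_even h hj, mul_zero]
  · rw [show 2 * j + 2 * ω.Mv - 1 = (2 * j - 1) + 2 * ω.Mv by omega, Nat.add_mod_right,
      Nat.mod_eq_of_lt (by omega), show 2 * j - 1 + 1 = 2 * j by omega, pJpt_even h hj]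


/-! ### Simplicity of `J` -/

/-- Odd edge indices are arc edges: `k = (2j + 2Mv - 1) % (2Mv)` for a slot `j`. [folklore] -/
private theorem odd_index (hr : RootedFace D a r) (h : ω.IsB2a) {k : ℕ} (hk : k < 2 * ω.Mv)
    (hodd : k % 2 = 1) : ∃ j, j < ω.Mv ∧ k = (2 * j + 2 * ω.Mv - 1) % (2 * ω.Mv) := by
  have hM := three_le_Mv hr h
  by_cases hl : k = 2 * ω.Mv - 1
  · exact ⟨0, by omega, by rw [mul_zero, zero_add, Nat.mod_eq_of_lt (by omega)]; exact hl⟩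
  · refine ⟨(k + 1) / 2, by omega, ?_⟩
    rw [show 2 * ((k + 1) / 2) + 2 * ω.Mv - 1 = k + 2 * ω.Mv by omega, Nat.add_mod_right,
      Nat.mod_eq_of_lt hk]

/-- The right end of a half-open segment is not on it. [folklore] -/
private theorem not_mem_icoSegment_right {x y : ℂ} (hxy : x ≠ y) : y ∉ icoSegment x y := by
  rintro ⟨θ, hθ, he⟩
  rw [AffineMap.lineMap_apply_module', Complex.real_smul] at he
  have : ((1 - θ : ℝ) : ℂ) * (y - x) = 0 := by
    push_cast
    linear_combination -he
  rcases mul_eq_zero.1 this with h1 | h1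
  · have : (1 - θ : ℝ) = 0 := by exact_mod_cast h1
    exact absurd (show θ = 1 by linarith) hθ.2.ne
  · exact hxy (sub_eq_zero.1 h1).symm

/-- The closed edge `k` of `J` contains the half-open edge of the vertex list. [folklore] -/
private theorem icoSegment_subset_edge (h : ω.IsB2a) {k : ℕ} (hk : k < (ω.pJlist hr h).length) :
    icoSegment (ω.pJlist hr h)[k] ((ω.pJlist hr h)[(k + 1) % (ω.pJlist hr h).length]'(Nat.mod_lt _ (pJlist_pos h)))
      ⊆ segment ℝ (ω.pJ hr h k) (ω.pJ hr h (k + 1)) := by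
  rw [pJlist_getElem, pJlist_getElem_succ h (by simpa using hk)]
  exact icoSegment_subset_segment _ _

/-- Consecutive vertices of `J` differ. [folklore] -/
private theorem pJ_ne_succ (h : ω.IsB2a) {k : ℕ} (hk : k < 2 * ω.Mv) : ω.pJ hr h k ≠ ω.pJ hr h (k + 1) := by
  have hM := three_le_Mv hr h
  rw [ω.pJ_eq_toC h, ω.pJ_eq_toC h]
  intro he
  have he' := toC_injective he
  by_cases hl : k + 1 = 2 * ω.Mv
  · rw [hl, pJpt_closed h] at he'
    have := pJpt_injective h hk (by omega) he'
    omega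
  · have := pJpt_injective h hk (by omega) he'
    omega

/-- A cross edge `2j` and an arc edge of slot `j'` of `J` meet only as consecutive edges, in the shared
vertex; in particular their half-open versions are disjoint. [folklore] -/
private theorem cross_arc_disjoint (h : ω.IsB2a) {j j' : ℕ} (hj : j < ω.Mv) (hj' : j' < ω.Mv) {p : ℂ}
    (hp : p ∈ icoSegment (ω.pJ hr h (2 * j)) (ω.pJ hr h (2 * j + 1)))
    (hp' : p ∈ icoSegment (ω.pJ hr h ((2 * j' + 2 * ω.Mv - 1) % (2 * ω.Mv)))
      (ω.pJ hr h ((2 * j' + 2 * ω.Mv - 1) % (2 * ω.Mv) + 1))) : False := by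
  have hM := three_le_Mv hr h
  have hc : p ∈ crossSeg ((ω.jFace h j).side (ω.jOut hr h j)) := by
    rw [← segment_pJ_even h hj]; exact icoSegment_subset_segment _ _ hp
  have ha : p ∈ arcSeg (ω.jFace h j') (ω.jIn h j') (ω.jOut hr h j') := by
    rw [← segment_pJ_odd h hj']; exact icoSegment_subset_segment _ _ hp'
  rcases eq_side_of_mem_crossSeg_arcSeg hc ha with e | e
  · -- the cross edge enters slot `j'`: it ends at the entry vertex of slot `j'`
    have hjj := jOut_side_eq_jIn_side h hj hj' e
    rw [e] at hc
    have hpe := eq_innerPt_of_mem_crossSeg_arcSeg (jIn_ne_jOut h hj') hc ha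
    -- that vertex is the right end of the cross edge
    have hv : ω.pJ hr h (2 * j + 1) = toC (innerPt (ω.jFace h j') (ω.jIn h j')) := by
      rw [ω.pJ_eq_toC h, ← pJpt_in (hr := hr) h hj', hjj]
      congr 2
      by_cases hl : j + 1 = ω.Mv
      · rw [hl, Nat.mod_self, mul_zero, zero_add, Nat.mod_eq_of_lt (by omega)]; omega
      · rw [Nat.mod_eq_of_lt (show j + 1 < ω.Mv by omega),
          show 2 * (j + 1) + 2 * ω.Mv - 1 = (2 * j + 1) + 2 * ω.Mv by omega, Nat.add_mod_right,
          Nat.mod_eq_of_lt (by omega)]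
    rw [hpe, ← hv] at hp
    exact not_mem_icoSegment_right (pJ_ne_succ h (by omega)) hp
  · -- the cross edge leaves slot `j'`: `j = j'`, it starts at the exit vertex of slot `j'`
    have hjj : j = j' := jOut_side_inj h hj hj' e
    subst hjj
    have ha' : p ∈ arcSeg (ω.jFace h j) (ω.jOut hr h j) (ω.jIn h j) := by
      rw [arcSeg, segment_symm]; exact ha
    have hpe := eq_innerPt_of_mem_crossSeg_arcSeg (jIn_ne_jOut h hj).symm hc ha'
    have hv : ω.pJ hr h ((2 * j + 2 * ω.Mv - 1) % (2 * ω.Mv) + 1) = toC (innerPt (ω.jFace h j) (ω.jOut hr h j)) := by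
      rw [ω.pJ_eq_toC h, ← pJpt_even h hj]
      by_cases hj0 : j = 0
      · subst hj0
        rw [mul_zero, zero_add, Nat.mod_eq_of_lt (by omega), show 2 * ω.Mv - 1 + 1 = 2 * ω.Mv by omega,
          pJpt_closed h]
      · congr 2
        rw [show 2 * j + 2 * ω.Mv - 1 = (2 * j - 1) + 2 * ω.Mv by omega, Nat.add_mod_right,
          Nat.mod_eq_of_lt (by omega)]
        omega
    rw [hpe, ← hv] at hp'
    exact not_mem_icoSegment_right (pJ_ne_succ h (Nat.mod_lt _ (by omega))) hp'

/-- ★ **The excursion polygon of a class-`B2a` walk is a simple closed polygon** (pairwise disjoint half-open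
edges in the mesh-`4` drawing): the planar input behind "the arc … together with the segment of the rhombus
forms a closed curve" in the proof of the vertex relation.
[cite: GlazmanManolescu2019, Lemma 2.1 (statement, "in the form given in [Gl]")] [cite: Glazman2015WeightedSAW, Lemma 3.1 (proof, pp. 6–7: the classes of walks through a rhombus)]
[cite: DuminilCopinSmirnov2012, proof of Lemma 1] -/
theorem isSimpleClosedPolygon_pJlist (h : ω.IsB2a) : IsSimpleClosedPolygon (ω.pJlist hr h) := by
  have hM := three_le_Mv hr h
  refine ⟨pJlist_pos h, fun k hk => ?_, fun i i' hi hi' hne => ?_⟩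
  · rw [pJlist_getElem, pJlist_getElem_succ h (by simpa using hk)]
    exact pJ_ne_succ h (by simpa using hk)
  · rw [length_pJlist] at hi hi'
    refine Set.disjoint_left.2 fun p hp hp' => ?_
    replace hp : p ∈ icoSegment (ω.pJ hr h i) (ω.pJ hr h (i + 1)) := by
      rw [← pJlist_getElem h (by simpa using hi), ← pJlist_getElem_succ h hi]; exact hp
    replace hp' : p ∈ icoSegment (ω.pJ hr h i') (ω.pJ hr h (i' + 1)) := by
      rw [← pJlist_getElem h (by simpa using hi'), ← pJlist_getElem_succ h hi']; exact hp'
    obtain ⟨j, rfl | rfl⟩ := Nat.even_or_odd' i <;> obtain ⟨j', rfl | rfl⟩ := Nat.even_or_odd' i'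
    · -- cross / cross
      have hj : j < ω.Mv := by omega
      have hj' : j' < ω.Mv := by omega
      have hc := icoSegment_subset_segment _ _ hp
      have hc' := icoSegment_subset_segment _ _ hp'
      rw [segment_pJ_even h hj] at hc
      rw [segment_pJ_even h hj'] at hc'
      have := jOut_side_inj h hj hj' (eq_of_mem_crossSeg hc hc')
      omega
    · -- cross / arc
      obtain ⟨j₁, hj₁, e₁⟩ := odd_index hr h hi' (by omega)
      rw [e₁] at hp'
      exact cross_arc_disjoint h (by omega) hj₁ hp hp'
    · -- arc / cross
      obtain ⟨j₁, hj₁, e₁⟩ := odd_index hr h hi (by omega)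
      rw [e₁] at hp
      exact cross_arc_disjoint h (by omega) hj₁ hp' hp
    · -- arc / arc
      obtain ⟨j₁, hj₁, e₁⟩ := odd_index hr h hi (by omega)
      obtain ⟨j₂, hj₂, e₂⟩ := odd_index hr h hi' (by omega)
      have hne' : j₁ ≠ j₂ := by rintro rfl; exact hne (e₁.trans e₂.symm)
      rw [e₁] at hp; rw [e₂] at hp'
      have ha := icoSegment_subset_segment _ _ hp
      have ha' := icoSegment_subset_segment _ _ hp'
      rw [segment_pJ_odd h hj₁] at ha
      rw [segment_pJ_odd h hj₂] at ha'
      have hF := eq_face_of_mem_arcSeg ha ha'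
      obtain ⟨h1, h2⟩ := jFace_eq_iff hr h hj₁ hj₂ hne' hF
      rw [jFace_pos h h1, jIn_pos h h1, jOut_pos h h1] at ha
      rw [jFace_pos h h2, jIn_pos h h2, jOut_pos h h2, ← show ω.2.fc (ω.2.firstHitG + j₁) =
        ω.2.fc (ω.2.firstHitG + j₂) by rw [← jFace_pos h h1, ← jFace_pos h h2]; exact hF] at ha'
      have hlen := len_eq (ω := ω) h
      obtain ⟨hns, h12, h13, h14, h15⟩ := YBWalk.not_straight_of_two_arcs (γ := ω.2)
        (i := ω.2.firstHitG + j₁) (i' := ω.2.firstHitG + j₂) (by omega) (by omega) (by omega)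
        (by rw [← jFace_pos h h1, ← jFace_pos h h2]; exact hF.symm)
      have hsu := (YBWalk.side_sIn (γ := ω.2) (i := ω.2.firstHitG + j₁) (by omega)).2.2
      have hsu' := (YBWalk.side_sIn (γ := ω.2) (i := ω.2.firstHitG + j₂) (by omega)).2.2
      exact hns (straight_of_mem_arcSeg_arcSeg ha ha' (Ne.symm h12) (Ne.symm h14) (Ne.symm h13) (Ne.symm h15)
        hsu hsu')

/-- **The excursion polygon is a Jordan loop.** [cite: GlazmanManolescu2019, Lemma 2.1 (statement, "in the form given in [Gl]")]
[cite: Glazman2015WeightedSAW, Lemma 3.1 (proof, pp. 6–7: the classes of walks through a rhombus)] -/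
theorem isJordanLoop_pJ (h : ω.IsB2a) : IsJordanLoop (polygonLoop (ω.pJlist hr h)) :=
  ⟨continuous_polygonLoop _, periodic_polygonLoop _, injOn_polygonLoop (isSimpleClosedPolygon_pJlist h)⟩

/-! ### The winding angle of `J` is `2π` times the winding number; it is `0` or `±2π` -/

/-- A point off the closed edges of `J` is off the loop. [folklore] -/
private theorem not_mem_range_of_forall (h : ω.IsB2a) {b : ℂ}
    (hb : ∀ k < 2 * ω.Mv, b ∉ segment ℝ (ω.pJ hr h k) (ω.pJ hr h (k + 1))) :
    b ∉ range (polygonLoop (ω.pJlist hr h)) := by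
  have hl : ω.pJlist hr h ≠ [] := List.ne_nil_of_length_pos (pJlist_pos h)
  rw [range_polygonLoop hl, mem_iUnion]
  rintro ⟨k, hk⟩
  have hk2 : (k : ℕ) < 2 * ω.Mv := by simpa using k.2
  rw [pJlist_getElem, pJlist_getElem_succ h hk2] at hk
  exact hb k hk2 hk

/-- **The winding angle of the excursion polygon is `2π` times the winding number of the polygon
loop**, for every base point off the closed edges. [cite: GlazmanManolescu2019, Lemma 2.1 (statement, "in the form given in [Gl]")]
[cite: Glazman2015WeightedSAW, Lemma 3.1 (proof, pp. 6–7: the classes of walks through a rhombus)] -/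
theorem AJ_eq_two_pi_mul_wind (h : ω.IsB2a) {b : ℂ}
    (hb : ∀ k < 2 * ω.Mv, b ∉ segment ℝ (ω.pJ hr h k) (ω.pJ hr h (k + 1))) :
    ω.AJ hr h b = 2 * Real.pi * wind (fun t ↦ polygonLoop (ω.pJlist hr h) t - b) := by
  have hM := three_le_Mv hr h
  have hl := pJlist_pos (hr := hr) h
  -- the edge ratios are off the closed negative real axis
  have hrat : ∀ k < (ω.pJlist hr h).length,
      edgeRatio (ω.pJlist hr h) b hl k = (ω.pJ hr h (k + 1) - b) / (ω.pJ hr h k - b) := by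
    intro k hk
    have hk2 : k < 2 * ω.Mv := by simpa using hk
    unfold edgeRatio
    have e2 : (ω.pJlist hr h)[k % (ω.pJlist hr h).length]'(Nat.mod_lt _ hl) = (ω.pJlist hr h)[k] :=
      getElem_congr_idx (Nat.mod_eq_of_lt hk)
    rw [pJlist_getElem_succ h hk2, e2, pJlist_getElem]
  have hslit : ∀ k < (ω.pJlist hr h).length, edgeRatio (ω.pJlist hr h) b hl k ∈ slitPlane := by
    intro k hk
    have hk2 : k < 2 * ω.Mv := by simpa using hk
    rw [hrat k hk, show (ω.pJ hr h (k + 1) - b) / (ω.pJ hr h k - b) = crossRatioFn (ω.pJ hr h (k + 1)) (ω.pJ hr h k) b by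
      unfold crossRatioFn; rw [← neg_sub b, ← neg_sub b (ω.pJ hr h k), neg_div_neg_eq]]
    apply crossRatioFn_mem_slitPlane
    rw [segment_symm]; exact hb k hk2
  have key := wind_polygonLoop_sub_mul_two_pi' hl hslit
  -- the swept angle is the same sum
  have hsum : ω.AJ hr h b = ∑ k ∈ Finset.range (ω.pJlist hr h).length, (edgeRatio (ω.pJlist hr h) b hl k).arg := by
    rw [AJ, sweep, length_pJlist]
    refine Finset.sum_congr rfl fun k hk => ?_
    rw [Finset.mem_range] at hk
    rw [hrat k (by simpa using hk), angAt]
    have h0 : ω.pJ hr h k - b ≠ 0 := by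
      intro h0; exact hb k hk (by rw [sub_eq_zero.1 h0]; exact left_mem_segment _ _ _)
    have h1 : ω.pJ hr h (k + 1) - b ≠ 0 := by
      intro h1; exact hb k hk (by rw [sub_eq_zero.1 h1]; exact right_mem_segment _ _ _)
    rw [← Complex.arg_div_coe_angle h1 h0, Real.Angle.toReal_coe_eq_self_iff]
    exact ⟨Complex.neg_pi_lt_arg _, Complex.arg_le_pi _⟩
  rw [hsum, ← key, mul_comm]

/-- ★ **An excursion polygon winds at most once**: for every base point off its closed edges, the winding
angle of `J` is `0`, `2π` or `-2π` (Jordan curve theorem for the simple closed polygon `J`).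
[cite: GlazmanManolescu2019, Lemma 2.1 (statement, "in the form given in [Gl]")] [cite: Glazman2015WeightedSAW, Lemma 3.1 (proof, pp. 6–7: the classes of walks through a rhombus)]
[cite: Mccleary2006, Ch. 9, p. 129 (The Jordan Curve Theorem)] -/
theorem AJ_trichotomy (h : ω.IsB2a) {b : ℂ}
    (hb : ∀ k < 2 * ω.Mv, b ∉ segment ℝ (ω.pJ hr h k) (ω.pJ hr h (k + 1))) :
    ω.AJ hr h b = 0 ∨ ω.AJ hr h b = 2 * Real.pi ∨ ω.AJ hr h b = -(2 * Real.pi) := by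
  have hJ := isJordanLoop_pJ (hr := hr) h
  have hb' := not_mem_range_of_forall h hb
  rw [AJ_eq_two_pi_mul_wind h hb]
  rcases IsJordanLoop.mem_inside_or_mem_outside hb' with hi | ho
  · rcases hJ.wind_eq_one_or_neg_one_of_mem_inside hi with e | e
    · right; left; rw [e]; simp
    · right; right; rw [e]; simp
  · left; rw [(hJ.mem_outside_iff_wind_eq_zero hb').1 ho]; simp


end ΩG

/-! ## Part T. The sign rule: the winding angle of `J` at the midpoint of a free side of `r`

For a side `σ` of `r` other than the exit and return sides, the base point `midPt (r.side σ)` is joined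
to an auxiliary lattice point `c` on the far side of the chord by a segment inside the closed face `r`
crossing the chord transversally and meeting no other edge of `J`; the crossing lemma
(`wind_sub_wind_of_straight_cross`) and `|wind| ≤ 1` on both sides give `AJ ∈ {0, 2π ε}` with the
explicit chord sign `ε = chordSign σ z₁ z₂`. -/

/-- The side functional on lattice points (integer arithmetic): `segSide` of `ArgumentIncrement.lean` at
lattice points. [folklore] -/
def segSideZ (L R Z : ℤ × ℤ) : ℤ := (Z - L).2 * (Z - R).1 - (Z - L).1 * (Z - R).2

/-- `segSide` at lattice points. [folklore] -/
private theorem segSide_toC (L R Z : ℤ × ℤ) : segSide (toC L) (toC R) (toC Z) = segSideZ L R Z := by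
  rw [segSide_eq]
  simp [toC, segSideZ]

/-- Translation invariance. [folklore] -/
private theorem segSideZ_add (v L R Z : ℤ × ℤ) : segSideZ (v + L) (v + R) (v + Z) = segSideZ L R Z := by
  unfold segSideZ; simp only [Prod.fst_sub, Prod.snd_sub, Prod.fst_add, Prod.snd_add]; ring

/-- The auxiliary base point across the chord (offset from `r.base`): the midpoint of the side opposite
`σ`, moved one unit towards the chord's side other than `σ.opp` when the chord has an end there.
[folklore] -/
def cOff (σ z₁ z₂ : Side) : ℤ × ℤ :=
  if z₁ ≠ σ.opp ∧ z₂ ≠ σ.opp then σ.opp.offset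
  else σ.opp.offset - (if z₁ = σ.opp then z₂ else z₁).nIn

/-- **The chord sign** `ε(σ; z₁, z₂) ∈ {1, -1}`: `+1` iff the midpoint of side `σ` lies to the left of the
chord of `r` directed from the inner point of `z₂` (return) to that of `z₁` (exit). Table
(`chordSign_table`): `σ = W`: `ε(E,S) = 1, ε(E,N) = -1, ε(S,N) = -1`; `σ = E`: `ε(W,S) = -1, ε(W,N) = 1,
ε(S,N) = 1`; `σ = S`: `ε(W,E) = 1, ε(W,N) = 1, ε(E,N) = -1`; `σ = N`: `ε(W,E) = -1, ε(W,S) = -1,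
ε(E,S) = 1`; and `ε(σ; z₂, z₁) = -ε(σ; z₁, z₂)`. [folklore] -/
def chordSign (σ z₁ z₂ : Side) : ℤ :=
  if 0 < segSideZ σ.offset (cOff σ z₁ z₂) z₂.inOff then 1 else -1

/-- The sign conditions of the crossing configuration, positive orientation. [folklore] -/
private def CondPos (σ z₁ z₂ : Side) : Prop :=
  0 < segSideZ σ.offset (cOff σ z₁ z₂) z₂.inOff ∧ segSideZ σ.offset (cOff σ z₁ z₂) z₁.inOff < 0 ∧
  segSideZ z₂.inOff z₁.inOff σ.offset < 0 ∧ 0 < segSideZ z₂.inOff z₁.inOff (cOff σ z₁ z₂) ∧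
  0 < segSideZ σ.offset (cOff σ z₁ z₂) (z₂.offset - z₂.nIn) ∧ segSideZ σ.offset (cOff σ z₁ z₂) (z₁.offset - z₁.nIn) < 0

/-- The sign conditions of the crossing configuration, negative orientation. [folklore] -/
private def CondNeg (σ z₁ z₂ : Side) : Prop :=
  segSideZ σ.offset (cOff σ z₁ z₂) z₂.inOff < 0 ∧ 0 < segSideZ σ.offset (cOff σ z₁ z₂) z₁.inOff ∧
  0 < segSideZ z₂.inOff z₁.inOff σ.offset ∧ segSideZ z₂.inOff z₁.inOff (cOff σ z₁ z₂) < 0 ∧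
  segSideZ σ.offset (cOff σ z₁ z₂) (z₂.offset - z₂.nIn) < 0 ∧ 0 < segSideZ σ.offset (cOff σ z₁ z₂) (z₁.offset - z₁.nIn)

/-- `CondPos` is decidable. [folklore] -/
private instance (σ z₁ z₂ : Side) : Decidable (CondPos σ z₁ z₂) := by unfold CondPos; infer_instance
/-- `CondNeg` is decidable. [folklore] -/
private instance (σ z₁ z₂ : Side) : Decidable (CondNeg σ z₁ z₂) := by unfold CondNeg; infer_instance

/-- The decided table of crossing configurations. [folklore] -/
private theorem chord_table : ∀ σ z₁ z₂ : Side, σ ≠ z₁ → σ ≠ z₂ → z₁ ≠ z₂ →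
    (chordSign σ z₁ z₂ = 1 ∧ CondPos σ z₁ z₂) ∨ (chordSign σ z₁ z₂ = -1 ∧ CondNeg σ z₁ z₂) := by decide

/-- The explicit table of chord signs (the lane's chord rule for the orientation of a wound excursion at the
root's own plaquette). [cite: GlazmanManolescu2019, Lemma 2.1 (statement, "in the form given in [Gl]")]
[cite: Glazman2015WeightedSAW, Lemma 3.1 (proof, pp. 6–7: the classes of walks through a rhombus)] [cite: DuminilCopinSmirnov2012, proof of Lemma 1] -/
theorem chordSign_table :
    chordSign .W .E .S = 1 ∧ chordSign .W .E .N = -1 ∧ chordSign .W .S .N = -1 ∧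
    chordSign .E .W .S = -1 ∧ chordSign .E .W .N = 1 ∧ chordSign .E .S .N = 1 ∧
    chordSign .S .W .E = 1 ∧ chordSign .S .W .N = 1 ∧ chordSign .S .E .N = -1 ∧
    chordSign .N .W .E = -1 ∧ chordSign .N .W .S = -1 ∧ chordSign .N .E .S = 1 := by decide

/-- Reversing the chord reverses its sign. [cite: GlazmanManolescu2019, Lemma 2.1 (statement, "in the form given in [Gl]")]
[cite: Glazman2015WeightedSAW, Lemma 3.1 (proof, pp. 6–7: the classes of walks through a rhombus)] -/
theorem chordSign_swap : ∀ σ z₁ z₂ : Side, σ ≠ z₁ → σ ≠ z₂ → z₁ ≠ z₂ →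
    chordSign σ z₂ z₁ = -chordSign σ z₁ z₂ := by decide

/-- The chord sign is `±1`. [cite: GlazmanManolescu2019, Lemma 2.1 (statement, "in the form given in [Gl]")]
[cite: Glazman2015WeightedSAW, Lemma 3.1 (proof, pp. 6–7: the classes of walks through a rhombus)] -/
theorem chordSign_eq_or (σ z₁ z₂ : Side) : chordSign σ z₁ z₂ = 1 ∨ chordSign σ z₁ z₂ = -1 := by
  unfold chordSign; split_ifs <;> simp

/-- The auxiliary point lies in the closed face. [folklore] -/
private theorem cOff_mem : ∀ σ z₁ z₂ : Side, σ ≠ z₁ → σ ≠ z₂ → z₁ ≠ z₂ →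
    0 ≤ (cOff σ z₁ z₂).1 ∧ (cOff σ z₁ z₂).1 ≤ 4 ∧ 0 ≤ (cOff σ z₁ z₂).2 ∧ (cOff σ z₁ z₂).2 ≤ 4 := by
  decide

/-- Midpoint offsets lie in the closed face. [folklore] -/
private theorem offset_mem : ∀ σ : Side, 0 ≤ σ.offset.1 ∧ σ.offset.1 ≤ 4 ∧ 0 ≤ σ.offset.2 ∧ σ.offset.2 ≤ 4 := by
  decide

/-! ### What of `J` lies in the closed face `r` -/

/-- The closed face `r` at mesh `4`. [folklore] -/
def faceBox (r : Face) : Set ℂ :=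
  {p | (4 * r.1 : ℝ) ≤ p.re ∧ p.re ≤ 4 * r.1 + 4 ∧ (4 * r.2 : ℝ) ≤ p.im ∧ p.im ≤ 4 * r.2 + 4}

/-- A segment between two boundary-or-interior lattice points of `r` lies in the closed face. [folklore] -/
private theorem segment_subset_faceBox (r : Face) {B C : ℤ × ℤ} (hB : 0 ≤ B.1 ∧ B.1 ≤ 4 ∧ 0 ≤ B.2 ∧ B.2 ≤ 4)
    (hC : 0 ≤ C.1 ∧ C.1 ≤ 4 ∧ 0 ≤ C.2 ∧ C.2 ≤ 4) :
    segment ℝ (toC (r.base + B)) (toC (r.base + C)) ⊆ faceBox r := by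
  intro p hp
  obtain ⟨t, h0, h1, hx, hy⟩ := mem_segment_toC hp
  obtain ⟨hB1, hB2, hB3, hB4⟩ := hB
  obtain ⟨hC1, hC2, hC3, hC4⟩ := hC
  have hB1' : (0 : ℝ) ≤ B.1 := by exact_mod_cast hB1
  have hB2' : (B.1 : ℝ) ≤ 4 := by exact_mod_cast hB2
  have hB3' : (0 : ℝ) ≤ B.2 := by exact_mod_cast hB3
  have hB4' : (B.2 : ℝ) ≤ 4 := by exact_mod_cast hB4
  have hC1' : (0 : ℝ) ≤ C.1 := by exact_mod_cast hC1
  have hC2' : (C.1 : ℝ) ≤ 4 := by exact_mod_cast hC2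
  have hC3' : (0 : ℝ) ≤ C.2 := by exact_mod_cast hC3
  have hC4' : (C.2 : ℝ) ≤ 4 := by exact_mod_cast hC4
  simp only [Face.base, Prod.fst_add, Prod.snd_add, Int.cast_add, Int.cast_mul, Int.cast_ofNat] at hx hy
  refine ⟨?_, ?_, ?_, ?_⟩ <;> nlinarith

/-- Arc segments of other faces avoid the closed face `r`. [folklore] -/
private theorem arcSeg_disjoint_faceBox {F r : Face} (hF : F ≠ r) {s u : Side} {p : ℂ} (hp : p ∈ arcSeg F s u)
    (hb : p ∈ faceBox r) : False := by
  obtain ⟨hre, him, -⟩ := arc_coords hp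
  obtain ⟨h1, h2, h3, h4⟩ := hb
  obtain ⟨a, b⟩ := F; obtain ⟨a', b'⟩ := r
  simp only at hre him h1 h2 h3 h4
  rw [abs_le] at hre him
  apply hF
  have ha : a = a' := by
    have e1 : (a : ℝ) < a' + 1 := by linarith
    have e2 : (a' : ℝ) < a + 1 := by linarith
    have e1' : a < a' + 1 := by exact_mod_cast e1
    have e2' : a' < a + 1 := by exact_mod_cast e2
    omega
  have hb' : b = b' := by
    have e1 : (b : ℝ) < b' + 1 := by linarith
    have e2 : (b' : ℝ) < b + 1 := by linarith
    have e1' : b < b' + 1 := by exact_mod_cast e1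
    have e2' : b' < b + 1 := by exact_mod_cast e2
    omega
  rw [ha, hb']

/-- A crossing segment meeting the closed face `r` crosses a side of `r`. [folklore] -/
private theorem crossSeg_faceBox {e : MidEdge} {r : Face} {p : ℂ} (hp : p ∈ crossSeg e) (hb : p ∈ faceBox r) :
    ∃ s : Side, e = r.side s := by
  obtain ⟨h1, h2, h3, h4⟩ := hb
  obtain ⟨a', b'⟩ := r
  simp only at h1 h2 h3 h4
  cases e with
  | vert k j =>
    obtain ⟨hy, hx⟩ := cross_vert hp
    rw [abs_le] at hx
    have hj : j = b' := by
      have e1 : (j : ℝ) < b' + 1 := by linarith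
      have e2 : (b' : ℝ) < j + 1 := by linarith
      have e1' : j < b' + 1 := by exact_mod_cast e1
      have e2' : b' < j + 1 := by exact_mod_cast e2
      omega
    have hk : k = a' ∨ k = a' + 1 := by
      have e1 : (k : ℝ) < a' + 2 := by linarith
      have e2 : (a' : ℝ) < k + 1 := by linarith
      have e1' : k < a' + 2 := by exact_mod_cast e1
      have e2' : a' < k + 1 := by exact_mod_cast e2
      omega
    rcases hk with rfl | rfl
    · exact ⟨.W, by rw [hj]; rfl⟩
    · exact ⟨.E, by rw [hj]; rfl⟩
  | slant k j =>
    obtain ⟨hx, hy⟩ := cross_slant hp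
    rw [abs_le] at hy
    have hk : k = a' := by
      have e1 : (k : ℝ) < a' + 1 := by linarith
      have e2 : (a' : ℝ) < k + 1 := by linarith
      have e1' : k < a' + 1 := by exact_mod_cast e1
      have e2' : a' < k + 1 := by exact_mod_cast e2
      omega
    have hj : j = b' ∨ j = b' + 1 := by
      have e1 : (j : ℝ) < b' + 2 := by linarith
      have e2 : (b' : ℝ) < j + 1 := by linarith
      have e1' : j < b' + 2 := by exact_mod_cast e1
      have e2' : b' < j + 1 := by exact_mod_cast e2
      omega
    rcases hj with rfl | rfl
    · exact ⟨.S, by rw [hk]; rfl⟩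
    · exact ⟨.N, by rw [hk]; rfl⟩

/-- The two faces of a mid-edge. [folklore] -/
private theorem eq_faces_of_side_eq {F : Face} {s : Side} {e : MidEdge} (h : F.side s = e) :
    F = e.faces.1 ∨ F = e.faces.2 := by
  subst h
  obtain ⟨a, b⟩ := F
  cases s <;> simp [Face.side, MidEdge.faces]

/-- A mid-edge has at most two faces. [folklore] -/
private theorem faces_le_two {F G H : Face} {s t u : Side} (h1 : F.side s = H.side u) (h2 : G.side t = H.side u)
    (hFG : F ≠ G) (hFH : F ≠ H) (hGH : G ≠ H) : False := by
  have hne : (H.side u).faces.1 ≠ (H.side u).faces.2 := by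
    obtain ⟨a, b⟩ := H
    cases u <;> simp [Face.side, MidEdge.faces]
  rcases eq_faces_of_side_eq h1 with e1 | e1 <;> rcases eq_faces_of_side_eq h2 with e2 | e2 <;>
    rcases eq_faces_of_side_eq (rfl : H.side u = H.side u) with e3 | e3
  all_goals first | exact hFG (e1.trans e2.symm) | exact hFH (e1.trans e3.symm) | exact hGH (e2.trans e3.symm)

namespace ΩG

open private three_le from Literature.Probability.RandomPlanarGeometry.YangBaxterSAWGeneralDomain

variable {D : Set Face} {a : MidEdge} {r : Face} {ω : ΩG D a r} {hr : RootedFace D a r}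

/-- The exit mid-edge of slot `j` is the entry mid-edge of slot `j + 1 (mod Mv)`, and the two slots are in
different faces. [folklore] -/
private theorem side_jOut_eq_side_jIn_succ (h : ω.IsB2a) {j : ℕ} (hj : j < ω.Mv) :
    (ω.jFace h ((j + 1) % ω.Mv)).side (ω.jIn h ((j + 1) % ω.Mv)) = (ω.jFace h j).side (ω.jOut hr h j) ∧
      ω.jFace h ((j + 1) % ω.Mv) ≠ ω.jFace h j := by
  have hM := three_le_Mv hr h
  have hside : (ω.jFace h ((j + 1) % ω.Mv)).side (ω.jIn h ((j + 1) % ω.Mv)) =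
      (ω.jFace h j).side (ω.jOut hr h j) := by
    rw [side_jIn h (Nat.mod_lt _ (by omega)), inIdx_succ hr h hj, side_jOut h hj]
  refine ⟨hside, fun hf => ?_⟩
  have hjj : (j + 1) % ω.Mv ≠ j := by
    intro hh
    by_cases hl : j + 1 = ω.Mv
    · rw [hl, Nat.mod_self] at hh; omega
    · rw [Nat.mod_eq_of_lt (by omega)] at hh; omega
  obtain ⟨h1, h2⟩ := jFace_eq_iff hr h (Nat.mod_lt _ (by omega)) hj hjj hf
  rw [jFace_pos h h1, jFace_pos h h2] at hf
  by_cases hl : j + 1 = ω.Mv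
  · rw [hl, Nat.mod_self] at h1; exact h1 rfl
  · rw [Nat.mod_eq_of_lt (show j + 1 < ω.Mv by omega)] at hf
    exact YBWalk.fc_succ_ne (γ := ω.2) (i := ω.2.firstHitG + j) (by rw [len_eq h]; omega)
      (by rw [show ω.2.firstHitG + j + 1 = ω.2.firstHitG + (j + 1) by ring]; exact hf.symm)

/-- **The only crossing edges of `J` through sides of `r` are those through the exit and the return
sides.** [folklore] -/
private theorem jOut_side_eq_side_root (h : ω.IsB2a) {j : ℕ} (hj : j < ω.Mv) {s : Side}
    (e : (ω.jFace h j).side (ω.jOut hr h j) = r.side s) :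
    (j = 0 ∧ s = ω.z1 hr h) ∨ (j = ω.Mv - 1 ∧ s = ω.1) := by
  have hM := three_le_Mv hr h
  obtain ⟨hside, hface⟩ := side_jOut_eq_side_jIn_succ (hr := hr) h hj
  by_cases hj0 : j = 0
  · subst hj0
    left; refine ⟨rfl, ?_⟩
    rw [jFace_zero, jOut_zero] at e
    exact (r.side_injective e).symm
  by_cases hjl : j = ω.Mv - 1
  · right; refine ⟨hjl, ?_⟩
    subst hjl
    rw [show ω.Mv - 1 + 1 = ω.Mv by omega, Nat.mod_self, jFace_zero, jIn_zero] at hside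
    exact (r.side_injective (hside.trans e)).symm
  · exfalso
    have hF1 : ω.jFace h j ≠ r := jFace_ne_r hr h hj0 hj
    have hF2 : ω.jFace h ((j + 1) % ω.Mv) ≠ r := by
      rw [Nat.mod_eq_of_lt (show j + 1 < ω.Mv by omega)]
      exact jFace_ne_r hr h (by omega) (by omega)
    exact faces_le_two e (hside.trans e) hface.symm hF1 hF2

variable (ω hr) in
/-- The base point: the midpoint of the side `σ` of `r`. [folklore] -/
def bPt (σ : Side) : ℂ := toC (r.base + σ.offset)

variable (ω hr) in
/-- The auxiliary point across the chord. [folklore] -/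
def cPt (h : ω.IsB2a) (σ : Side) : ℂ := toC (r.base + cOff σ (ω.z1 hr h) ω.1)

/-- The base point is the midpoint of the side. [folklore] -/
private theorem bPt_eq (σ : Side) : bPt (r := r) σ = toC (midPt (r.side σ)) := by rw [bPt, midPt_side]

/-- A convex combination of two numbers of the same strict sign is nonzero. [folklore] -/
private theorem convex_comb_ne_zero {A B t : ℝ} (ht0 : 0 ≤ t) (ht1 : t ≤ 1)
    (h : (0 < A ∧ 0 < B) ∨ (A < 0 ∧ B < 0)) : (1 - t) * A + t * B ≠ 0 := by
  rcases eq_or_lt_of_le ht1 with rfl | ht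
  · simp only [sub_self, zero_mul, one_mul, zero_add]
    rcases h with ⟨-, hB⟩ | ⟨-, hB⟩
    · exact hB.ne'
    · exact hB.ne
  · rcases h with ⟨hA, hB⟩ | ⟨hA, hB⟩
    · exact (by nlinarith [mul_pos (sub_pos.2 ht) hA, mul_nonneg ht0 hB.le] : 0 < (1 - t) * A + t * B).ne'
    · exact (by nlinarith [mul_pos (sub_pos.2 ht) (neg_pos.2 hA), mul_nonneg ht0 (neg_pos.2 hB).le] :
        (1 - t) * A + t * B < 0).ne

/-- **No edge of `J` other than the chord meets the segment from the base point to the auxiliary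
point.** [folklore] -/
private theorem edge_disjoint_bc (h : ω.IsB2a) {σ : Side} (hσ1 : σ ≠ ω.z1 hr h) (hσ2 : σ ≠ ω.1) {k : ℕ}
    (hk : k < 2 * ω.Mv - 1) {p : ℂ} (hp : p ∈ segment ℝ (ω.pJ hr h k) (ω.pJ hr h (k + 1)))
    (hp' : p ∈ segment ℝ (bPt (r := r) σ) (ω.cPt hr h σ)) : False := by
  have hM := three_le_Mv hr h
  have hd := ω.2.sides_distinctG hr h.1
  rw [ω.returnSide_of_isB2a h] at hd
  have h12 : ω.z1 hr h ≠ ω.1 := fun hh => hd.2.2 hh.symm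
  have hbox : p ∈ faceBox r :=
    segment_subset_faceBox r (offset_mem σ) (cOff_mem σ _ _ hσ1 hσ2 h12) hp'
  -- the table
  have hsides : ∀ Z : ℤ × ℤ, segSide (bPt (r := r) σ) (ω.cPt hr h σ) (toC (r.base + Z)) =
      segSideZ σ.offset (cOff σ (ω.z1 hr h) ω.1) Z := by
    intro Z; rw [bPt, cPt, segSide_toC, segSideZ_add]
  have hzero := segSide_eq_zero_of_mem_segment hp'
  obtain ⟨j, rfl | rfl⟩ := Nat.even_or_odd' k
  · -- a crossing edge: through a side of `r`, hence a stub
    have hj : j < ω.Mv := by omega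
    rw [segment_pJ_even h hj] at hp
    obtain ⟨s, hs⟩ := crossSeg_faceBox hp hbox
    rw [hs, crossSeg_side_eq'] at hp
    -- `p` on the stub has the sign of the stub's ends, which is nonzero
    rw [segment_eq_image_lineMap] at hp
    obtain ⟨t, ht, rfl⟩ := hp
    rw [segSide_lineMap, hsides, hsides] at hzero
    rcases jOut_side_eq_side_root h hj hs with ⟨-, rfl⟩ | ⟨-, rfl⟩
    · rcases chord_table σ _ _ hσ1 hσ2 h12 with ⟨-, -, c2, -, -, -, c6⟩ | ⟨-, -, c2, -, -, -, c6⟩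
      · exact convex_comb_ne_zero ht.1 ht.2 (Or.inr ⟨by exact_mod_cast c2, by exact_mod_cast c6⟩) hzero
      · exact convex_comb_ne_zero ht.1 ht.2 (Or.inl ⟨by exact_mod_cast c2, by exact_mod_cast c6⟩) hzero
    · rcases chord_table σ _ _ hσ1 hσ2 h12 with ⟨-, c1, -, -, -, c5, -⟩ | ⟨-, c1, -, -, -, c5, -⟩
      · exact convex_comb_ne_zero ht.1 ht.2 (Or.inl ⟨by exact_mod_cast c1, by exact_mod_cast c5⟩) hzero
      · exact convex_comb_ne_zero ht.1 ht.2 (Or.inr ⟨by exact_mod_cast c1, by exact_mod_cast c5⟩) hzero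
  · -- an arc edge of an excursion face (not the chord)
    obtain ⟨j', hj', e'⟩ := odd_index hr h (k := 2 * j + 1) (by omega) (by omega)
    have hj'0 : j' ≠ 0 := by
      rintro rfl
      rw [mul_zero, zero_add, Nat.mod_eq_of_lt (by omega)] at e'
      omega
    rw [e', segment_pJ_odd h hj'] at hp
    exact arcSeg_disjoint_faceBox (jFace_ne_r hr h hj'0 hj') hp hbox

/-- The base point and the auxiliary point are off the closed edges of `J`. [folklore] -/
private theorem bPt_cPt_not_mem (h : ω.IsB2a) {σ : Side} (hσ1 : σ ≠ ω.z1 hr h) (hσ2 : σ ≠ ω.1) :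
    (∀ k < 2 * ω.Mv, bPt (r := r) σ ∉ segment ℝ (ω.pJ hr h k) (ω.pJ hr h (k + 1))) ∧
    (∀ k < 2 * ω.Mv, ω.cPt hr h σ ∉ segment ℝ (ω.pJ hr h k) (ω.pJ hr h (k + 1))) := by
  have hM := three_le_Mv hr h
  have hd := ω.2.sides_distinctG hr h.1
  rw [ω.returnSide_of_isB2a h] at hd
  have h12 : ω.z1 hr h ≠ ω.1 := fun hh => hd.2.2 hh.symm
  -- the chord
  have hchord : segment ℝ (ω.pJ hr h (2 * ω.Mv - 1)) (ω.pJ hr h (2 * ω.Mv - 1 + 1)) =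
      segment ℝ (toC (r.base + (ω.1).inOff)) (toC (r.base + (ω.z1 hr h).inOff)) := by
    rw [show 2 * ω.Mv - 1 + 1 = 2 * ω.Mv by omega, ω.pJ_eq_toC h, ω.pJ_eq_toC h, pJpt_last' h, pJpt_closed h,
      pJpt_zero h, innerPt, innerPt]
  have hsides : ∀ Z : ℤ × ℤ, segSide (toC (r.base + (ω.1).inOff)) (toC (r.base + (ω.z1 hr h).inOff)) (toC (r.base + Z)) =
      segSideZ (ω.1).inOff (ω.z1 hr h).inOff Z := by
    intro Z; rw [segSide_toC, segSideZ_add]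
  constructor
  · intro k hk hb
    by_cases hkl : k < 2 * ω.Mv - 1
    · exact edge_disjoint_bc h hσ1 hσ2 hkl hb (left_mem_segment _ _ _)
    · have hk' : k = 2 * ω.Mv - 1 := by omega
      subst hk'
      rw [hchord] at hb
      have hz := segSide_eq_zero_of_mem_segment hb
      rw [bPt, hsides] at hz
      rcases chord_table σ _ _ hσ1 hσ2 h12 with ⟨-, -, -, c3, -⟩ | ⟨-, -, -, c3, -⟩
      · have : (segSideZ (ω.1).inOff (ω.z1 hr h).inOff σ.offset : ℝ) < 0 := by exact_mod_cast c3
        linarith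
      · have : (0 : ℝ) < segSideZ (ω.1).inOff (ω.z1 hr h).inOff σ.offset := by exact_mod_cast c3
        linarith
  · intro k hk hc
    by_cases hkl : k < 2 * ω.Mv - 1
    · exact edge_disjoint_bc h hσ1 hσ2 hkl hc (right_mem_segment _ _ _)
    · have hk' : k = 2 * ω.Mv - 1 := by omega
      subst hk'
      rw [hchord] at hc
      have hz := segSide_eq_zero_of_mem_segment hc
      rw [cPt, hsides] at hz
      rcases chord_table σ _ _ hσ1 hσ2 h12 with ⟨-, -, -, -, c4, -⟩ | ⟨-, -, -, -, c4, -⟩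
      · have : (0 : ℝ) < segSideZ (ω.1).inOff (ω.z1 hr h).inOff (cOff σ (ω.z1 hr h) ω.1) := by exact_mod_cast c4
        linarith
      · have : (segSideZ (ω.1).inOff (ω.z1 hr h).inOff (cOff σ (ω.z1 hr h) ω.1) : ℝ) < 0 := by exact_mod_cast c4
        linarith

set_option maxHeartbeats 400000 in
/-- **The jump of the winding number across the chord** between the base point and the auxiliary point:
`wind(ℓ) - wind(r') = 1` with `(ℓ, r') = (b, c)` if the chord sign is `+1`, `(c, b)` if it is `-1`.
[folklore] -/
private theorem wind_jump (h : ω.IsB2a) {σ : Side} (hσ1 : σ ≠ ω.z1 hr h) (hσ2 : σ ≠ ω.1) :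
    (chordSign σ (ω.z1 hr h) ω.1 = 1 ∧
      wind (fun t ↦ polygonLoop (ω.pJlist hr h) t - bPt (r := r) σ) -
        wind (fun t ↦ polygonLoop (ω.pJlist hr h) t - ω.cPt hr h σ) = 1) ∨
    (chordSign σ (ω.z1 hr h) ω.1 = -1 ∧
      wind (fun t ↦ polygonLoop (ω.pJlist hr h) t - ω.cPt hr h σ) -
        wind (fun t ↦ polygonLoop (ω.pJlist hr h) t - bPt (r := r) σ) = 1) := by
  have hM := three_le_Mv hr h
  have hd := ω.2.sides_distinctG hr h.1
  rw [ω.returnSide_of_isB2a h] at hd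
  have h12 : ω.z1 hr h ≠ ω.1 := fun hh => hd.2.2 hh.symm
  set l := ω.pJlist hr h with hl
  set N := 2 * ω.Mv with hN
  have hlen : l.length = N := length_pJlist h
  have hl0 : l ≠ [] := List.ne_nil_of_length_pos (pJlist_pos h)
  have hNr : (0 : ℝ) < N := by rw [hN]; exact_mod_cast (show 0 < 2 * ω.Mv by omega)
  set u : ℝ := (N - 1 : ℝ) / N with hu
  have hMr : (3 : ℝ) ≤ ω.Mv := by exact_mod_cast hM
  have hN1 : ((N - 1 : ℕ) : ℝ) = (N : ℝ) - 1 := by rw [Nat.cast_sub (by omega), Nat.cast_one]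
  have hNr' : (N : ℝ) = 2 * ω.Mv := by rw [hN]; push_cast; ring
  have hlenR : ((l.length : ℕ) : ℝ) = N := by rw [hlen]
  have hu0 : 0 ≤ u := div_nonneg (by rw [hNr']; linarith) hNr.le
  have hu1 : u < 1 := by rw [hu, div_lt_one hNr]; linarith
  set L : ℝ → ℂ := polygonLoop l with hL
  -- values at the ends of the chord
  have hLu : L u = toC (r.base + (ω.1).inOff) := by
    have e := polygonLoop_vertex (l := l) (k := N - 1) (by rw [hlen]; omega)
    rw [hlenR, hN1] at e
    rw [hL, hu, e, pJlist_getElem, ω.pJ_eq_toC h, hN, pJpt_last' h, innerPt]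
  have hL1 : L 1 = toC (r.base + (ω.z1 hr h).inOff) := by
    have e := polygonLoop_vertex (l := l) (k := 0) (pJlist_pos h)
    rw [Nat.cast_zero, zero_div] at e
    have e1 : L 1 = L 0 := by rw [hL]; simpa using periodic_polygonLoop l 0
    rw [e1, hL, e, pJlist_getElem, ω.pJ_eq_toC h, pJpt_zero h, innerPt]
  -- the chord piece is straight
  have hmid : ∀ s ∈ Icc u 1, L s = AffineMap.lineMap (L u) (L 1) ((s - u) / (1 - u)) := by
    intro s hs
    have hθ : (s - u) / (1 - u) ∈ Icc (0 : ℝ) 1 :=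
      ⟨div_nonneg (by linarith [hs.1]) (by linarith), (div_le_one (by linarith)).2 (by linarith [hs.2])⟩
    have hsu : s = ((N - 1 : ℕ) + (s - u) / (1 - u)) / (l.length : ℝ) := by
      rw [hlenR, hN1]
      have h1u : 1 - u = 1 / N := by rw [hu]; field_simp; ring
      rw [h1u]; field_simp; rw [hu]; field_simp; ring
    have eA : l[N - 1]'(by rw [hlen]; omega) = L u := by
      rw [hLu, pJlist_getElem, ω.pJ_eq_toC h, hN, pJpt_last' h, innerPt]
    have hl0' : 0 < l.length := by rw [hlen]; omega
    have eB : l[(N - 1 + 1) % l.length]'(Nat.mod_lt _ hl0') = L 1 := by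
      have e0 : l[(N - 1 + 1) % l.length]'(Nat.mod_lt _ hl0') = l[0]'hl0' :=
        getElem_congr_idx (by rw [hlen, show N - 1 + 1 = N by omega, Nat.mod_self])
      rw [e0, hL1, pJlist_getElem, ω.pJ_eq_toC h, pJpt_zero h, innerPt]
    have e := polygonLoop_apply_div (l := l) (k := N - 1) (by rw [hlen]; omega) hθ
    rw [← hsu, eA, eB] at e
    exact e
  -- off the chord piece, the loop runs through the other closed edges
  have hout_aux : ∀ s ∈ Icc 0 u ∪ Icc 1 1, ∃ k, k < 2 * ω.Mv - 1 ∧ L s ∈ segment ℝ (ω.pJ hr h k) (ω.pJ hr h (k + 1)) := by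
    intro s hs
    rcases hs with hs | hs
    · obtain ⟨k, hk, θ, hθ, hks, hv⟩ := polygonLoop_eq_of_floor hl0 s
      have hfr : Int.fract s = s := Int.fract_eq_self.2 ⟨hs.1, lt_of_le_of_lt hs.2 hu1⟩
      rw [hfr, hlen] at hks
      rw [hlen] at hk
      have hkθ : (k : ℝ) + θ ≤ N - 1 := by
        have := hs.2; rw [hu, ← hks, div_le_div_iff_of_pos_right hNr] at this; exact this
      by_cases hkl : k < N - 1
      · refine ⟨k, by omega, ?_⟩
        rw [hL, hv, pJlist_getElem, pJlist_getElem_succ h hk, segment_eq_image_lineMap]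
        exact ⟨θ, ⟨hθ.1, hθ.2.le⟩, rfl⟩
      · -- `k = N - 1`, `θ = 0`: the vertex `v_{N-1}`, right end of edge `N - 2`
        have hkN : k = N - 1 := by omega
        have hθ0 : θ = 0 := by
          have : (k : ℝ) = N - 1 := by rw [hkN, hN1]
          linarith [hθ.1]
        refine ⟨N - 2, by omega, ?_⟩
        rw [hL, hv, hθ0, AffineMap.lineMap_apply_zero, pJlist_getElem, hkN, show N - 2 + 1 = N - 1 by omega]
        exact right_mem_segment _ _ _
    · have hs1 : s = 1 := le_antisymm hs.2 hs.1
      refine ⟨0, by omega, ?_⟩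
      rw [hs1, hL1, ← innerPt, ← pJpt_zero h, ← ω.pJ_eq_toC h]
      exact left_mem_segment _ _ _
  -- the crossing lemma, in the orientation given by the table
  rcases chord_table σ _ _ hσ1 hσ2 h12 with ⟨hsgn, c1, c2, c3, c4, -, -⟩ | ⟨hsgn, c1, c2, c3, c4, -, -⟩
  · left; refine ⟨hsgn, ?_⟩
    have key := wind_sub_wind_of_straight_cross (L := L) (a := 0) (u := u) (u' := 1) (b := 1)
      (ℓ := bPt (r := r) σ) (r := ω.cPt hr h σ) hu0 hu1 le_rfl
      ((continuous_polygonLoop l).continuousOn) (by rw [hL]; simpa using (periodic_polygonLoop l 0).symm)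
      hmid
      (fun s hs hmem => by
        obtain ⟨k, hk, hLs⟩ := hout_aux s hs
        exact edge_disjoint_bc h hσ1 hσ2 hk hLs hmem)
      (by rw [hLu, bPt, cPt, segSide_toC, segSideZ_add]; exact_mod_cast c1)
      (by rw [hL1, bPt, cPt, segSide_toC, segSideZ_add]; exact_mod_cast c2)
      (by
        rw [hLu, hL1]
        refine exists_mem_segment_mem_openSegment (by rw [bPt, cPt, segSide_toC, segSideZ_add]; exact_mod_cast c1)
          (by rw [bPt, cPt, segSide_toC, segSideZ_add]; exact_mod_cast c2) ?_ ?_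
        · rw [bPt, segSide_toC, segSideZ_add]; exact_mod_cast c3
        · rw [cPt, segSide_toC, segSideZ_add]; exact_mod_cast c4)
    simpa using key
  · right; refine ⟨hsgn, ?_⟩
    have hswap : ∀ Z : ℂ, segSide (ω.cPt hr h σ) (bPt (r := r) σ) Z = -segSide (bPt (r := r) σ) (ω.cPt hr h σ) Z := by
      intro Z; rw [segSide_eq, segSide_eq]; ring
    have key := wind_sub_wind_of_straight_cross (L := L) (a := 0) (u := u) (u' := 1) (b := 1)
      (ℓ := ω.cPt hr h σ) (r := bPt (r := r) σ) hu0 hu1 le_rfl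
      ((continuous_polygonLoop l).continuousOn) (by rw [hL]; simpa using (periodic_polygonLoop l 0).symm)
      hmid
      (fun s hs hmem => by
        obtain ⟨k, hk, hLs⟩ := hout_aux s hs
        rw [segment_symm] at hmem
        exact edge_disjoint_bc h hσ1 hσ2 hk hLs hmem)
      (by rw [hswap, hLu, bPt, cPt, segSide_toC, segSideZ_add]; have : (segSideZ σ.offset (cOff σ (ω.z1 hr h) ω.1) (ω.1).inOff : ℝ) < 0 := by exact_mod_cast c1
          linarith)
      (by rw [hswap, hL1, bPt, cPt, segSide_toC, segSideZ_add]; have : (0 : ℝ) < segSideZ σ.offset (cOff σ (ω.z1 hr h) ω.1) (ω.z1 hr h).inOff := by exact_mod_cast c2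
          linarith)
      (by
        rw [hLu, hL1]
        refine exists_mem_segment_mem_openSegment ?_ ?_ ?_ ?_
        · rw [hswap, bPt, cPt, segSide_toC, segSideZ_add]
          have : (segSideZ σ.offset (cOff σ (ω.z1 hr h) ω.1) (ω.1).inOff : ℝ) < 0 := by exact_mod_cast c1
          linarith
        · rw [hswap, bPt, cPt, segSide_toC, segSideZ_add]
          have : (0 : ℝ) < segSideZ σ.offset (cOff σ (ω.z1 hr h) ω.1) (ω.z1 hr h).inOff := by exact_mod_cast c2
          linarith
        · rw [cPt, segSide_toC, segSideZ_add]; exact_mod_cast c4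
        · rw [bPt, segSide_toC, segSideZ_add]; exact_mod_cast c3)
    simpa using key

/-- ★ **THE SIGN RULE (T).** For a walk of class `B2a` at `r` and a side `σ` of `r` other than its exit
side `z₁` and return side `z₂`, the winding angle of the excursion polygon `J` at the midpoint of
`r.side σ` is `0` or `2π · ε(σ; z₁, z₂)` with the explicit chord sign `chordSign` (`+1` iff the midpoint
lies to the left of the chord directed from the return end to the exit end): a simple closed polygon winds
`0` or `±1` times around every point off it, and the winding numbers on the two sides of the chord differ
by one. [cite: GlazmanManolescu2019, Lemma 2.1 (statement, "in the form given in [Gl]")] [cite: Glazman2015WeightedSAW, Lemma 3.1 (proof, pp. 6–7: the classes of walks through a rhombus)]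
[cite: DuminilCopinSmirnov2012, proof of Lemma 1]
[cite: Mccleary2006, Ch. 9, p. 129 (The Jordan Curve Theorem)] -/
theorem AJ_midPt_side_eq (h : ω.IsB2a) {σ : Side} (hσ1 : σ ≠ ω.z1 hr h) (hσ2 : σ ≠ ω.1) :
    ω.AJ hr h (toC (midPt (r.side σ))) = 0 ∨
      ω.AJ hr h (toC (midPt (r.side σ))) = 2 * Real.pi * chordSign σ (ω.z1 hr h) ω.1 := by
  have hJ := isJordanLoop_pJ (hr := hr) h
  obtain ⟨hb, hc⟩ := bPt_cPt_not_mem h hσ1 hσ2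
  rw [← bPt_eq]
  rw [AJ_eq_two_pi_mul_wind h hb]
  have hb' := not_mem_range_of_forall h hb
  have hc' := not_mem_range_of_forall h hc
  -- both winding numbers are in `{0, 1, -1}`
  have tri : ∀ {z : ℂ}, z ∉ range (polygonLoop (ω.pJlist hr h)) →
      wind (fun t ↦ polygonLoop (ω.pJlist hr h) t - z) = 0 ∨ wind (fun t ↦ polygonLoop (ω.pJlist hr h) t - z) = 1 ∨
        wind (fun t ↦ polygonLoop (ω.pJlist hr h) t - z) = -1 := by
    intro z hz
    rcases IsJordanLoop.mem_inside_or_mem_outside hz with hi | ho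
    · right; exact hJ.wind_eq_one_or_neg_one_of_mem_inside hi
    · left; exact (hJ.mem_outside_iff_wind_eq_zero hz).1 ho
  have tb := tri hb'
  have tc := tri hc'
  rcases wind_jump h hσ1 hσ2 with ⟨hs, hj⟩ | ⟨hs, hj⟩
  · rw [hs]
    rcases tb with e | e | e
    · left; simp [e]
    · right; rw [e]
    · exfalso; rcases tc with e' | e' | e' <;> rw [e, e'] at hj <;> norm_num at hj
  · rw [hs]
    rcases tb with e | e | e
    · left; simp [e]
    · exfalso; rcases tc with e' | e' | e' <;> rw [e, e'] at hj <;> norm_num at hj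
    · right; rw [e]

end ΩG

end Literature.Probability.RandomPlanarGeometry.SAW.YangBaxter


/-! ## § Rider J2 (edition 2, b-step0 gen 16): wound ⇔ the root's midpoint lies inside the excursion polygon

Public wrappers for the lane's cycle criterion. For a walk `ω` of class `B2a` and a side `σ` of `r` other than
the exit side `z₁` and the return side `z₂`: the midpoint of `r.side σ` is off every closed edge of `J` (so the
swept angle `AJ` there is `2π·wind`), and the excursion is WOUND at that midpoint (`AJ ≠ 0`, equivalently
`AJ = 2π·chordSign σ z₁ z₂` by `AJ_midPt_side_eq`) iff the midpoint lies in the INSIDE of the Jordan loop `J`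
(`IsJordanLoop.inside`, the bounded complementary component). -/

namespace Literature.Probability.RandomPlanarGeometry.SAW.YangBaxter

namespace ΩG

open Literature.Topology.PlaneTopology

variable {D : Set Face} {a : MidEdge} {r : Face} {ω : ΩG D a r} {hr : RootedFace D a r}

/-- The midpoint of a side of `r` other than the exit and return sides lies on no closed edge of `J`.
[cite: GlazmanManolescu2019, Lemma 2.1 (statement, "in the form given in [Gl]")]
[cite: Glazman2015WeightedSAW, Lemma 3.1 (proof, pp. 6–7: the classes of walks through a rhombus)] -/
theorem midPt_side_not_mem_edges (h : ω.IsB2a) {σ : Side} (hσ1 : σ ≠ ω.z1 hr h) (hσ2 : σ ≠ ω.1) :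
    ∀ k < 2 * ω.Mv, toC (midPt (r.side σ)) ∉ segment ℝ (ω.pJ hr h k) (ω.pJ hr h (k + 1)) := by
  rw [← bPt_eq]; exact (bPt_cPt_not_mem h hσ1 hσ2).1

/-- At such a midpoint the swept angle is `2π` times the winding number of the loop.
[cite: GlazmanManolescu2019, Lemma 2.1 (statement, "in the form given in [Gl]")]
[cite: Glazman2015WeightedSAW, Lemma 3.1 (proof, pp. 6–7: the classes of walks through a rhombus)] -/
theorem AJ_midPt_side_eq_two_pi_mul_wind (h : ω.IsB2a) {σ : Side} (hσ1 : σ ≠ ω.z1 hr h) (hσ2 : σ ≠ ω.1) :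
    ω.AJ hr h (toC (midPt (r.side σ))) =
      2 * Real.pi * wind (fun t ↦ polygonLoop (ω.pJlist hr h) t - toC (midPt (r.side σ))) :=
  AJ_eq_two_pi_mul_wind h (midPt_side_not_mem_edges h hσ1 hσ2)

/-- ★ **Wound ⇔ inside**: the excursion polygon winds around the midpoint of a free side of `r` (`AJ ≠ 0`) iff
that midpoint lies in the INSIDE of the Jordan loop `J`. [cite: GlazmanManolescu2019, Lemma 2.1 (statement, "in the form given in [Gl]")]
[cite: Glazman2015WeightedSAW, Lemma 3.1 (proof, pp. 6–7: the classes of walks through a rhombus)]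
[cite: DuminilCopinSmirnov2012, proof of Lemma 1] [cite: Mccleary2006, Ch. 9, p. 129 (The Jordan Curve Theorem)] -/
theorem AJ_midPt_side_ne_zero_iff_mem_inside (h : ω.IsB2a) {σ : Side} (hσ1 : σ ≠ ω.z1 hr h) (hσ2 : σ ≠ ω.1) :
    ω.AJ hr h (toC (midPt (r.side σ))) ≠ 0 ↔
      toC (midPt (r.side σ)) ∈ IsJordanLoop.inside (polygonLoop (ω.pJlist hr h)) := by
  have hb := not_mem_range_of_forall h (midPt_side_not_mem_edges h hσ1 hσ2)
  rw [AJ_midPt_side_eq_two_pi_mul_wind h hσ1 hσ2, (isJordanLoop_pJ h).mem_inside_iff_wind_ne_zero hb]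
  constructor
  · intro hne hw; exact hne (by rw [hw]; simp)
  · intro hw hne
    have : (wind (fun t ↦ polygonLoop (ω.pJlist hr h) t - toC (midPt (r.side σ))) : ℝ) = 0 := by
      have h2 : (2 : ℝ) * Real.pi ≠ 0 := by positivity
      exact (mul_eq_zero.1 hne).resolve_left h2
    exact hw (by exact_mod_cast this)

/-- **Wound ⇔ inside, signed form**: at the midpoint of a free side `σ` the swept angle equals
`2π·chordSign σ z₁ z₂` iff the midpoint lies inside `J` (combine `AJ_midPt_side_eq` with the previous
statement). [cite: GlazmanManolescu2019, Lemma 2.1 (statement, "in the form given in [Gl]")]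
[cite: Glazman2015WeightedSAW, Lemma 3.1 (proof, pp. 6–7: the classes of walks through a rhombus)] -/
theorem AJ_midPt_side_eq_chordSign_iff_mem_inside (h : ω.IsB2a) {σ : Side} (hσ1 : σ ≠ ω.z1 hr h)
    (hσ2 : σ ≠ ω.1) :
    ω.AJ hr h (toC (midPt (r.side σ))) = 2 * Real.pi * chordSign σ (ω.z1 hr h) ω.1 ↔
      toC (midPt (r.side σ)) ∈ IsJordanLoop.inside (polygonLoop (ω.pJlist hr h)) := by
  rw [← AJ_midPt_side_ne_zero_iff_mem_inside h hσ1 hσ2]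
  constructor
  · intro he h0
    rw [h0] at he
    have h2 : (2 : ℝ) * Real.pi ≠ 0 := by positivity
    have hc : ((chordSign σ (ω.z1 hr h) ω.1 : ℤ) : ℝ) ≠ 0 := by
      rcases chordSign_eq_or σ (ω.z1 hr h) ω.1 with hc | hc <;> simp [hc]
    exact (mul_ne_zero h2 hc) he.symm
  · intro hne
    rcases AJ_midPt_side_eq h hσ1 hσ2 with h0 | h1
    · exact absurd h0 hne
    · exact h1

end ΩG

end Literature.Probability.RandomPlanarGeometry.SAW.YangBaxter

namespace Literature.Probability.RandomPlanarGeometry.SAW.YangBaxter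

/-! ## Part P (edition 3, b-step0 gen 16). The winding parity law: wound ⇔ an odd number of ray crossings

For a walk `ω` of class `B2a` at `r` and a free side `σ` of `r` (`σ ≠ z₁, z₂`), consider the lattice half-line
behind the side `σ`: it starts at a corner of `r` on that side (`rayCorner r σ 0`) and runs away from `r` along
the W sides (vertical ray, `σ = N, S`) or the S sides (horizontal ray, `σ = E, W`) of the cells
`rayCell r σ 0, rayCell r σ 1, …` beyond `r`; its unit edges are the mid-edges `rayMid r σ k`. The **ray count**
`ΩG.rayCount` of `ω` is the number of slots of the excursion polygon `J` whose exit mid-edge lies on this ray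
(the chord's two crossing mid-edges are sides of `r` and never count). THE LAW (`ΩG.AJ_midPt_side_ne_zero_iff_
odd_rayCount`): `AJ (midPt (r.side σ)) ≠ 0 ↔ Odd rayCount` — equivalently (Part W, § J2) the midpoint lies
inside `J` iff the count is odd. Proof: the winding number of `J` is transported from the midpoint of `r.side σ`
to the start of the ray (the half-side is off `J`), then corner to corner along the ray: in the mesh-`4` drawing
an edge of `J` meets a closed unit edge of the lattice only if it is the crossing segment of that very mid-edge,
and then at its midpoint, transversally (`eq_side_of_mem_crossSeg_sideSeg`; arc segments and lattice corners are
off every lattice line through corners), so the winding number is constant across an uncrossed ray edge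
(`wind_affine_sub_eq_of_segment`) and jumps by `±1` across a crossed one (`wind_sub_wind_of_straight_cross`);
far along the ray it vanishes (`IsJordanLoop.norm_lt_of_mem_inside`); since `J` winds at most once, parity
decides. This is the even–odd rule of the Jordan curve theorem for polygons (Courant–Robbins, Ch. V App. §2) run on
the winding number; tangencies cannot occur because the ray is a lattice line through cell corners, which arc
segments (within `1` of a cell centre in both coordinates) and cell corners never meet, and which crossing
segments meet only at the midpoint of their own mid-edge. The count is over the crossing mid-edges of the
EXCURSION POLYGON (the excursion's mid-edges and the two sides of `r` closing the chord — the latter never on the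
ray), not over the mid-edges of the whole walk before its first hit of `∂r`. The lane's use: with the parent files' winding laws and the root-plaquette defect law, «some class-`B2a`
walk at the hole root's own plaquette is wound» — the exact condition for the failure of the Yang–Baxter vertex
identity there on the open range of `θ` — becomes a decidable combinatorial property (venture lane «pcv-sawmu»;
author-side face: 31 248 enumerated class-`B2a` walks, 0 exceptions, HOME `code/step0/g16/cyc/`).

### Closed sides of faces in the drawing, and which drawn edges meet them -/

/-- Offset of the first corner of a side from the base corner of its face (mesh `4`). [folklore] -/
def Side.endA : Side → ℤ × ℤ
  | .W => (0, 0)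
  | .E => (4, 0)
  | .S => (0, 0)
  | .N => (0, 4)

/-- Offset of the second corner of a side from the base corner of its face (mesh `4`). [folklore] -/
def Side.endB : Side → ℤ × ℤ
  | .W => (0, 4)
  | .E => (4, 4)
  | .S => (4, 0)
  | .N => (4, 4)

/-- The closed side `s` of the face `c` in the drawing: the segment between its two corners. [folklore] -/
def sideSeg (c : Face) (s : Side) : Set ℂ := segment ℝ (toC (c.base + s.endA)) (toC (c.base + s.endB))

/-- The midpoint offset of a side is the midpoint of its corner offsets. [folklore] -/
private theorem offset_eq_half (s : Side) :
    (s.offset.1 : ℝ) = s.endA.1 + (1 / 2 : ℝ) * (s.endB.1 - s.endA.1) ∧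
      (s.offset.2 : ℝ) = s.endA.2 + (1 / 2 : ℝ) * (s.endB.2 - s.endA.2) := by
  cases s <;> simp [Side.offset, Side.endA, Side.endB] <;> norm_num

/-- The midpoint of a side is the affine midpoint of the side's corners. [folklore] -/
private theorem toC_midPt_side_eq_lineMap (c : Face) (s : Side) :
    toC (midPt (c.side s)) = AffineMap.lineMap (toC (c.base + s.endA)) (toC (c.base + s.endB)) (1 / 2 : ℝ) := by
  rw [midPt_side, AffineMap.lineMap_apply_module']
  obtain ⟨h1, h2⟩ := offset_eq_half s
  apply Complex.ext <;> simp [toC] <;> linarith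

/-- The midpoint of a side lies on the closed side. [folklore] -/
private theorem toC_midPt_side_mem_sideSeg (c : Face) (s : Side) : toC (midPt (c.side s)) ∈ sideSeg c s := by
  rw [sideSeg, segment_eq_image_lineMap, toC_midPt_side_eq_lineMap]
  exact ⟨1 / 2, ⟨by norm_num, by norm_num⟩, rfl⟩

/-- The midpoint of a side lies on the open side. [folklore] -/
private theorem toC_midPt_side_mem_openSegment (c : Face) (s : Side) :
    toC (midPt (c.side s)) ∈ openSegment ℝ (toC (c.base + s.endA)) (toC (c.base + s.endB)) := by
  rw [openSegment_eq_image_lineMap, toC_midPt_side_eq_lineMap]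
  exact ⟨1 / 2, ⟨by norm_num, by norm_num⟩, rfl⟩

/-- Integer helper: `|4m - 4n| ≤ 1` forces `m = n`. [folklore] -/
private theorem eq_of_abs_four_sub_le {m n : ℤ} (h : |(4 : ℝ) * m - 4 * n| ≤ 1) : m = n := by
  rw [abs_le] at h
  have h1 : (4 * m - 4 * n : ℤ) ≤ 1 := by exact_mod_cast h.2
  have h2 : (-1 : ℤ) ≤ 4 * m - 4 * n := by exact_mod_cast h.1
  omega

/-- Integer helper: `4c ≤ 4j + 2 ≤ 4c + 4` forces `j = c`. [folklore] -/
private theorem eq_of_two_mem {j c : ℤ} (h1 : (4 : ℝ) * c ≤ 4 * j + 2) (h2 : (4 : ℝ) * j + 2 ≤ 4 * c + 4) : j = c := by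
  have h1' : (4 * c : ℤ) ≤ 4 * j + 2 := by exact_mod_cast h1
  have h2' : (4 * j + 2 : ℤ) ≤ 4 * c + 4 := by exact_mod_cast h2
  omega

/-- Integer helper: `4j + 2 ≠ 4c`. [folklore] -/
private theorem false_of_two_eq_four {j c : ℤ} (h : (4 : ℝ) * j + 2 = 4 * c) : False := by
  have : (4 * j + 2 : ℤ) = 4 * c := by exact_mod_cast h
  omega

/-- Integer helper: `|4m - (4n + 2)| ≤ 1` is impossible. [folklore] -/
private theorem false_of_abs_four_sub_two {m n : ℤ} (h : |(4 : ℝ) * m - (4 * n + 2)| ≤ 1) : False := by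
  rw [abs_le] at h
  have h1 : (4 * m - (4 * n + 2) : ℤ) ≤ 1 := by exact_mod_cast h.2
  have h2 : (-1 : ℤ) ≤ 4 * m - (4 * n + 2) := by exact_mod_cast h.1
  omega

/-- Coordinates on a closed side: vertical sides. [folklore] -/
private theorem sideSeg_coords_W {c : Face} {p : ℂ} (hp : p ∈ sideSeg c .W) :
    p.re = 4 * c.1 ∧ (4 : ℝ) * c.2 ≤ p.im ∧ p.im ≤ 4 * c.2 + 4 := by
  obtain ⟨t, h0, h1, hx, hy⟩ := mem_segment_toC hp
  simp only [Face.base, Side.endA, Side.endB, Prod.mk_add_mk, Int.cast_add, Int.cast_mul, Int.cast_ofNat,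
    add_zero] at hx hy
  refine ⟨by rw [hx]; ring, by rw [hy]; nlinarith, by rw [hy]; nlinarith⟩

/-- Coordinates on a closed side: vertical sides. [folklore] -/
private theorem sideSeg_coords_E {c : Face} {p : ℂ} (hp : p ∈ sideSeg c .E) :
    p.re = 4 * (c.1 + 1) ∧ (4 : ℝ) * c.2 ≤ p.im ∧ p.im ≤ 4 * c.2 + 4 := by
  obtain ⟨t, h0, h1, hx, hy⟩ := mem_segment_toC hp
  simp only [Face.base, Side.endA, Side.endB, Prod.mk_add_mk, Int.cast_add, Int.cast_mul, Int.cast_ofNat,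
    add_zero] at hx hy
  refine ⟨by rw [hx]; ring, by rw [hy]; nlinarith, by rw [hy]; nlinarith⟩

/-- Coordinates on a closed side: horizontal sides. [folklore] -/
private theorem sideSeg_coords_S {c : Face} {p : ℂ} (hp : p ∈ sideSeg c .S) :
    p.im = 4 * c.2 ∧ (4 : ℝ) * c.1 ≤ p.re ∧ p.re ≤ 4 * c.1 + 4 := by
  obtain ⟨t, h0, h1, hx, hy⟩ := mem_segment_toC hp
  simp only [Face.base, Side.endA, Side.endB, Prod.mk_add_mk, Int.cast_add, Int.cast_mul, Int.cast_ofNat,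
    add_zero] at hx hy
  refine ⟨by rw [hy]; ring, by rw [hx]; nlinarith, by rw [hx]; nlinarith⟩

/-- Coordinates on a closed side: horizontal sides. [folklore] -/
private theorem sideSeg_coords_N {c : Face} {p : ℂ} (hp : p ∈ sideSeg c .N) :
    p.im = 4 * (c.2 + 1) ∧ (4 : ℝ) * c.1 ≤ p.re ∧ p.re ≤ 4 * c.1 + 4 := by
  obtain ⟨t, h0, h1, hx, hy⟩ := mem_segment_toC hp
  simp only [Face.base, Side.endA, Side.endB, Prod.mk_add_mk, Int.cast_add, Int.cast_mul, Int.cast_ofNat,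
    add_zero] at hx hy
  refine ⟨by rw [hy]; ring, by rw [hx]; nlinarith, by rw [hx]; nlinarith⟩

/-- **A crossing segment meets a closed side only if it is the crossing segment of that side, and then only
at the midpoint.** [folklore] -/
private theorem eq_side_of_mem_crossSeg_sideSeg {c : Face} {s : Side} {e : MidEdge} {p : ℂ} (hp : p ∈ crossSeg e)
    (hq : p ∈ sideSeg c s) : e = c.side s ∧ p = toC (midPt (c.side s)) := by
  obtain ⟨a, b⟩ := c
  cases e with
  | vert k j =>
    obtain ⟨hy', hx'⟩ := cross_vert hp
    cases s with
    | W =>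
      obtain ⟨hx, hy1, hy2⟩ := sideSeg_coords_W hq
      rw [hx] at hx'
      have hk : a = k := eq_of_abs_four_sub_le hx'
      rw [hy'] at hy1 hy2
      have hj : j = b := eq_of_two_mem hy1 hy2
      subst hk; subst hj
      exact ⟨rfl, Complex.ext (by rw [hx]; simp [midPt, Face.side, toC]) (by rw [hy']; simp [midPt, Face.side, toC])⟩
    | E =>
      obtain ⟨hx, hy1, hy2⟩ := sideSeg_coords_E hq
      rw [hx] at hx'
      have hk : a + 1 = k := eq_of_abs_four_sub_le (by push_cast at hx' ⊢; exact hx')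
      rw [hy'] at hy1 hy2
      have hj : j = b := eq_of_two_mem hy1 hy2
      subst hk; subst hj
      exact ⟨rfl, Complex.ext (by rw [hx]; simp [midPt, Face.side, toC]) (by rw [hy']; simp [midPt, Face.side, toC])⟩
    | S =>
      obtain ⟨hy, -, -⟩ := sideSeg_coords_S hq
      rw [hy'] at hy
      exact (false_of_two_eq_four hy).elim
    | N =>
      obtain ⟨hy, -, -⟩ := sideSeg_coords_N hq
      rw [hy'] at hy
      exact (false_of_two_eq_four (j := j) (c := b + 1) (by rw [hy]; push_cast; ring)).elim
  | slant k j =>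
    obtain ⟨hx', hy'⟩ := cross_slant hp
    cases s with
    | W =>
      obtain ⟨hx, -, -⟩ := sideSeg_coords_W hq
      rw [hx'] at hx
      exact (false_of_two_eq_four hx).elim
    | E =>
      obtain ⟨hx, -, -⟩ := sideSeg_coords_E hq
      rw [hx'] at hx
      exact (false_of_two_eq_four (j := k) (c := a + 1) (by rw [hx]; push_cast; ring)).elim
    | S =>
      obtain ⟨hy, hx1, hx2⟩ := sideSeg_coords_S hq
      rw [hy] at hy'
      have hj : b = j := eq_of_abs_four_sub_le hy'
      rw [hx'] at hx1 hx2
      have hk : k = a := eq_of_two_mem hx1 hx2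
      subst hk; subst hj
      exact ⟨rfl, Complex.ext (by rw [hx']; simp [midPt, Face.side, toC]) (by rw [hy]; simp [midPt, Face.side, toC])⟩
    | N =>
      obtain ⟨hy, hx1, hx2⟩ := sideSeg_coords_N hq
      rw [hy] at hy'
      have hj : b + 1 = j := eq_of_abs_four_sub_le (by push_cast at hy' ⊢; exact hy')
      rw [hx'] at hx1 hx2
      have hk : k = a := eq_of_two_mem hx1 hx2
      subst hk; subst hj
      exact ⟨rfl, Complex.ext (by rw [hx']; simp [midPt, Face.side, toC]) (by rw [hy]; simp [midPt, Face.side, toC])⟩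

/-- **Arc segments meet no closed side.** [folklore] -/
private theorem not_mem_sideSeg_of_mem_arcSeg {F c : Face} {s u : Side} {s' : Side} {p : ℂ} (hp : p ∈ arcSeg F s u) :
    p ∉ sideSeg c s' := by
  intro hq
  obtain ⟨hre, him, -⟩ := arc_coords hp
  obtain ⟨a, b⟩ := c
  cases s' with
  | W =>
    obtain ⟨hx, -, -⟩ := sideSeg_coords_W hq
    rw [hx] at hre
    exact false_of_abs_four_sub_two hre
  | E =>
    obtain ⟨hx, -, -⟩ := sideSeg_coords_E hq
    rw [hx] at hre
    exact false_of_abs_four_sub_two (m := a + 1) (by push_cast at hre ⊢; exact hre)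
  | S =>
    obtain ⟨hy, -, -⟩ := sideSeg_coords_S hq
    rw [hy] at him
    exact false_of_abs_four_sub_two him
  | N =>
    obtain ⟨hy, -, -⟩ := sideSeg_coords_N hq
    rw [hy] at him
    exact false_of_abs_four_sub_two (m := b + 1) (by push_cast at him ⊢; exact him)

/-- **Lattice corners are off every crossing segment.** [folklore] -/
private theorem toC_cornerPt_not_mem_crossSeg (q : ℤ × ℤ) (e : MidEdge) : toC (cornerPt q) ∉ crossSeg e := by
  intro hp
  cases e with
  | vert k j =>
    obtain ⟨hy, -⟩ := cross_vert hp
    simp only [toC, cornerPt] at hy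
    norm_num at hy
    exact false_of_two_eq_four (j := j) (c := q.2) (by linarith)
  | slant k j =>
    obtain ⟨hx, -⟩ := cross_slant hp
    simp only [toC, cornerPt] at hx
    norm_num at hx
    exact false_of_two_eq_four (j := k) (c := q.1) (by linarith)

/-- **Lattice corners are off every arc segment.** [folklore] -/
private theorem toC_cornerPt_not_mem_arcSeg (q : ℤ × ℤ) (F : Face) (s u : Side) : toC (cornerPt q) ∉ arcSeg F s u := by
  intro hp
  obtain ⟨hre, -, -⟩ := arc_coords hp
  simp only [toC, cornerPt] at hre
  norm_num at hre
  exact false_of_abs_four_sub_two (m := q.1) (n := F.1) (by simpa using hre)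


/-! ### The ray behind a side of a face -/

/-- The `k`-th cell beyond the face `r` in the direction of its side `σ`. [folklore] -/
def rayCell (r : Face) (σ : Side) (k : ℕ) : Face :=
  match σ with
  | .N => (r.1, r.2 + 1 + k)
  | .S => (r.1, r.2 - 1 - k)
  | .E => (r.1 + 1 + k, r.2)
  | .W => (r.1 - 1 - k, r.2)

/-- The side of the ray cells along which the ray runs: the W side for a vertical ray, the S side for a
horizontal one. [folklore] -/
def raySide : Side → Side
  | .N => .W
  | .S => .W
  | .E => .S
  | .W => .S

/-- **The ray behind the side `σ` of `r`**: its `k`-th unit edge is the mid-edge `rayMid r σ k` — the W side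
of the `k`-th cell beyond `r` in direction `σ` (vertical ray, `σ = N, S`), resp. its S side (horizontal ray,
`σ = E, W`). The ray is the lattice half-line from the corner `rayCorner r σ 0` of `r` (an end of the side `σ`)
pointing away from `r`. [folklore] -/
def rayMid (r : Face) (σ : Side) (k : ℕ) : MidEdge := (rayCell r σ k).side (raySide σ)

/-- The `k`-th lattice corner on the ray (in cell units; the drawn point is `cornerPt`): the `k`-th ray edge
joins corners `k` and `k + 1`. [folklore] -/
def rayCorner (r : Face) (σ : Side) (k : ℕ) : ℤ × ℤ :=
  match σ with
  | .N => (r.1, r.2 + 1 + k)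
  | .S => (r.1, r.2 - k)
  | .E => (r.1 + 1 + k, r.2)
  | .W => (r.1 - k, r.2)

/-- The two corners of the `k`-th ray edge are the two corners of the `raySide` side of the `k`-th ray cell
(in one order or the other). [folklore] -/
private theorem rayCorner_pair (r : Face) (σ : Side) (k : ℕ) :
    (cornerPt (rayCorner r σ k) = (rayCell r σ k).base + (raySide σ).endA ∧
        cornerPt (rayCorner r σ (k + 1)) = (rayCell r σ k).base + (raySide σ).endB) ∨
      (cornerPt (rayCorner r σ k) = (rayCell r σ k).base + (raySide σ).endB ∧
        cornerPt (rayCorner r σ (k + 1)) = (rayCell r σ k).base + (raySide σ).endA) := by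
  obtain ⟨a, b⟩ := r
  cases σ <;> simp only [rayCorner, rayCell, raySide, cornerPt, Face.base, Side.endA, Side.endB, Prod.mk_add_mk,
    Prod.mk.injEq, Nat.cast_add, Nat.cast_one] <;> omega

/-- The `k`-th ray edge is the closed `raySide` side of the `k`-th ray cell. [folklore] -/
private theorem segment_rayCorner_eq (r : Face) (σ : Side) (k : ℕ) :
    segment ℝ (toC (cornerPt (rayCorner r σ k))) (toC (cornerPt (rayCorner r σ (k + 1)))) =
      sideSeg (rayCell r σ k) (raySide σ) := by
  rcases rayCorner_pair r σ k with ⟨e1, e2⟩ | ⟨e1, e2⟩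
  · rw [e1, e2]; rfl
  · rw [e1, e2, segment_symm]; rfl

/-- The ray starts at a corner of the side `σ` of `r`. [folklore] -/
private theorem cornerPt_rayCorner_zero (r : Face) (σ : Side) : cornerPt (rayCorner r σ 0) = r.base + σ.endA := by
  obtain ⟨a, b⟩ := r
  cases σ <;> simp only [rayCorner, cornerPt, Face.base, Side.endA, Prod.mk_add_mk, Prod.mk.injEq, Nat.cast_zero] <;> omega

/-- The ray mid-edges are not sides of `r`. [cite: GlazmanManolescu2019, §1 (the lattice of rhombi and its mid-edges)] -/
theorem rayMid_ne_side (r : Face) (σ : Side) (k : ℕ) (s : Side) : rayMid r σ k ≠ r.side s := by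
  obtain ⟨a, b⟩ := r
  cases σ <;> cases s <;> simp [rayMid, rayCell, raySide, Face.side] <;> omega

/-- `rayMid` is injective in the index. [cite: GlazmanManolescu2019, §1 (the lattice of rhombi and its mid-edges)] -/
theorem rayMid_injective (r : Face) (σ : Side) : Function.Injective (rayMid r σ) := by
  intro k k' h
  obtain ⟨a, b⟩ := r
  cases σ <;> simp [rayMid, rayCell, raySide, Face.side] at h <;> omega

/-- A coordinate of the midpoint of the `k`-th ray mid-edge grows like `4k`: lower bounds used to push the ray
beyond the drawing. [folklore] -/
private theorem norm_toC_midPt_rayMid_ge (r : Face) (σ : Side) (k : ℕ) :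
    (4 : ℝ) * k - 4 * (|(r.1 : ℝ)| + |(r.2 : ℝ)| + 1) ≤ ‖toC (midPt (rayMid r σ k))‖ := by
  obtain ⟨a, b⟩ := r
  have hre : ∀ z : ℂ, |z.re| ≤ ‖z‖ := fun z => Complex.abs_re_le_norm z
  have him : ∀ z : ℂ, |z.im| ≤ ‖z‖ := fun z => Complex.abs_im_le_norm z
  cases σ <;> simp only [rayMid, rayCell, raySide, Face.side, midPt, toC]
  case N =>
    refine le_trans ?_ (him _)
    simp only [Complex.add_im, Complex.intCast_im, Complex.mul_im, Complex.intCast_re, Complex.I_re,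
      Complex.I_im, mul_zero, mul_one, zero_add, add_zero]
    push_cast
    have ha := abs_nonneg (a : ℝ); have hb := neg_abs_le (b : ℝ)
    rw [le_abs]; left; nlinarith
  case S =>
    refine le_trans ?_ (him _)
    simp only [Complex.add_im, Complex.intCast_im, Complex.mul_im, Complex.intCast_re, Complex.I_re,
      Complex.I_im, mul_zero, mul_one, zero_add, add_zero]
    push_cast
    have ha := abs_nonneg (a : ℝ); have hb := le_abs_self (b : ℝ)
    rw [le_abs]; right; nlinarith
  case E =>
    refine le_trans ?_ (hre _)
    simp only [Complex.add_re, Complex.intCast_re, Complex.mul_re, Complex.intCast_im, Complex.I_re,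
      Complex.I_im, mul_zero, mul_one, sub_zero, add_zero]
    push_cast
    have hb := abs_nonneg (b : ℝ); have ha := neg_abs_le (a : ℝ)
    rw [le_abs]; left; nlinarith
  case W =>
    refine le_trans ?_ (hre _)
    simp only [Complex.add_re, Complex.intCast_re, Complex.mul_re, Complex.intCast_im, Complex.I_re,
      Complex.I_im, mul_zero, mul_one, sub_zero, add_zero]
    push_cast
    have hb := abs_nonneg (b : ℝ); have ha := le_abs_self (a : ℝ)
    rw [le_abs]; right; nlinarith

/-- Same for the ray corners. [folklore] -/
private theorem norm_toC_cornerPt_rayCorner_ge (r : Face) (σ : Side) (k : ℕ) :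
    (4 : ℝ) * k - 4 * (|(r.1 : ℝ)| + |(r.2 : ℝ)| + 1) ≤ ‖toC (cornerPt (rayCorner r σ k))‖ := by
  obtain ⟨a, b⟩ := r
  have hre : ∀ z : ℂ, |z.re| ≤ ‖z‖ := fun z => Complex.abs_re_le_norm z
  have him : ∀ z : ℂ, |z.im| ≤ ‖z‖ := fun z => Complex.abs_im_le_norm z
  cases σ <;> simp only [rayCorner, cornerPt, toC]
  case N =>
    refine le_trans ?_ (him _)
    simp only [Complex.add_im, Complex.intCast_im, Complex.mul_im, Complex.intCast_re, Complex.I_re,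
      Complex.I_im, mul_zero, mul_one, zero_add, add_zero]
    push_cast
    have ha := abs_nonneg (a : ℝ); have hb := neg_abs_le (b : ℝ)
    rw [le_abs]; left; nlinarith
  case S =>
    refine le_trans ?_ (him _)
    simp only [Complex.add_im, Complex.intCast_im, Complex.mul_im, Complex.intCast_re, Complex.I_re,
      Complex.I_im, mul_zero, mul_one, zero_add, add_zero]
    push_cast
    have ha := abs_nonneg (a : ℝ); have hb := le_abs_self (b : ℝ)
    rw [le_abs]; right; nlinarith
  case E =>
    refine le_trans ?_ (hre _)
    simp only [Complex.add_re, Complex.intCast_re, Complex.mul_re, Complex.intCast_im, Complex.I_re,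
      Complex.I_im, mul_zero, mul_one, sub_zero, add_zero]
    push_cast
    have hb := abs_nonneg (b : ℝ); have ha := neg_abs_le (a : ℝ)
    rw [le_abs]; left; nlinarith
  case W =>
    refine le_trans ?_ (hre _)
    simp only [Complex.add_re, Complex.intCast_re, Complex.mul_re, Complex.intCast_im, Complex.I_re,
      Complex.I_im, mul_zero, mul_one, sub_zero, add_zero]
    push_cast
    have hb := abs_nonneg (b : ℝ); have ha := le_abs_self (a : ℝ)
    rw [le_abs]; right; nlinarith


/-! ### Which edges of `J` meet the ray -/

namespace ΩG

variable {D : Set Face} {a : MidEdge} {r : Face} {ω : ΩG D a r} {hr : RootedFace D a r}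

/-- **An edge of `J` meets a closed side of a face `c` only if it is the crossing edge through that side, at
the midpoint.** [folklore] -/
private theorem exit_eq_of_mem_edge_sideSeg (h : ω.IsB2a) {k : ℕ} (hk : k < 2 * ω.Mv) {c : Face} {s : Side}
    {p : ℂ} (hp : p ∈ segment ℝ (ω.pJ hr h k) (ω.pJ hr h (k + 1))) (hq : p ∈ sideSeg c s) :
    ∃ j, j < ω.Mv ∧ k = 2 * j ∧ (ω.jFace h j).side (ω.jOut hr h j) = c.side s ∧ p = toC (midPt (c.side s)) := by
  have hM := three_le_Mv hr h
  obtain ⟨j, rfl | rfl⟩ := Nat.even_or_odd' k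
  · have hj : j < ω.Mv := by omega
    rw [segment_pJ_even h hj] at hp
    obtain ⟨he, hpe⟩ := eq_side_of_mem_crossSeg_sideSeg hp hq
    exact ⟨j, hj, rfl, he, hpe⟩
  · obtain ⟨j', hj', e'⟩ := odd_index hr h (k := 2 * j + 1) hk (by omega)
    rw [e', segment_pJ_odd h hj'] at hp
    exact absurd hq (not_mem_sideSeg_of_mem_arcSeg hp)

/-- **Lattice corners are off the closed edges of `J`.** [folklore] -/
private theorem toC_cornerPt_not_mem_edge (h : ω.IsB2a) (q : ℤ × ℤ) {k : ℕ} (hk : k < 2 * ω.Mv) :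
    toC (cornerPt q) ∉ segment ℝ (ω.pJ hr h k) (ω.pJ hr h (k + 1)) := by
  have hM := three_le_Mv hr h
  intro hp
  obtain ⟨j, rfl | rfl⟩ := Nat.even_or_odd' k
  · rw [segment_pJ_even h (show j < ω.Mv by omega)] at hp
    exact toC_cornerPt_not_mem_crossSeg q _ hp
  · obtain ⟨j', hj', e'⟩ := odd_index hr h (k := 2 * j + 1) hk (by omega)
    rw [e', segment_pJ_odd h hj'] at hp
    exact toC_cornerPt_not_mem_arcSeg q _ _ _ hp

/-- **An edge of `J` meets the `m`-th ray edge only if it is the crossing edge of the `m`-th ray mid-edge, at its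
midpoint.** [folklore] -/
private theorem exit_eq_rayMid_of_mem_edge (h : ω.IsB2a) {σ : Side} {m k : ℕ} (hk : k < 2 * ω.Mv) {p : ℂ}
    (hp : p ∈ segment ℝ (ω.pJ hr h k) (ω.pJ hr h (k + 1)))
    (hq : p ∈ segment ℝ (toC (cornerPt (rayCorner r σ m))) (toC (cornerPt (rayCorner r σ (m + 1))))) :
    ∃ j, j < ω.Mv ∧ k = 2 * j ∧ (ω.jFace h j).side (ω.jOut hr h j) = rayMid r σ m ∧
      p = toC (midPt (rayMid r σ m)) := by
  rw [segment_rayCorner_eq] at hq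
  exact exit_eq_of_mem_edge_sideSeg h hk hp hq

/-- **The half-side from the midpoint of a free side `σ` of `r` to the start of the ray is off `J`.** [folklore] -/
private theorem halfSide_disjoint_edges (h : ω.IsB2a) {σ : Side} (hσ1 : σ ≠ ω.z1 hr h) (hσ2 : σ ≠ ω.1) {k : ℕ}
    (hk : k < 2 * ω.Mv) {p : ℂ} (hp : p ∈ segment ℝ (ω.pJ hr h k) (ω.pJ hr h (k + 1)))
    (hq : p ∈ segment ℝ (toC (midPt (r.side σ))) (toC (cornerPt (rayCorner r σ 0)))) : False := by
  have hM := three_le_Mv hr h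
  -- the half-side lies in the closed side `σ` of `r`
  have hsub : segment ℝ (toC (midPt (r.side σ))) (toC (cornerPt (rayCorner r σ 0))) ⊆ sideSeg r σ := by
    rw [cornerPt_rayCorner_zero]
    exact (convex_segment _ _).segment_subset (toC_midPt_side_mem_sideSeg r σ) (left_mem_segment _ _ _)
  obtain ⟨j, hj, -, he, -⟩ := exit_eq_of_mem_edge_sideSeg h hk hp (hsub hq)
  rcases jOut_side_eq_side_root h hj he with ⟨-, hs⟩ | ⟨-, hs⟩
  · exact hσ1 hs
  · exact hσ2 hs

/-! ### The winding number of `J` along the ray: transport and jumps -/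

/-- **Transport**: if a segment misses the closed edges of `J`, the polygon loop has the same winding number
about its two ends. [folklore] -/
private theorem wind_eq_of_segment_disjoint (h : ω.IsB2a) {p q : ℂ}
    (hpq : ∀ z ∈ segment ℝ p q, ∀ k < 2 * ω.Mv, z ∉ segment ℝ (ω.pJ hr h k) (ω.pJ hr h (k + 1))) :
    wind (fun t ↦ polygonLoop (ω.pJlist hr h) t - p) = wind (fun t ↦ polygonLoop (ω.pJlist hr h) t - q) := by
  have key := wind_affine_sub_eq_of_segment (L := polygonLoop (ω.pJlist hr h)) (a := 0) (b := 1) zero_le_one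
    (continuous_polygonLoop _).continuousOn (by simpa using (periodic_polygonLoop (ω.pJlist hr h) 0).symm)
    (p := p) (q := q) (fun z hz hzL => not_mem_range_of_forall h (hpq z hz) (image_subset_range _ _ hzL))
  simpa using key

variable (ω hr) in
/-- The winding number of `J` about the `m`-th ray corner (the quantity transported along the ray).
[cite: AhlforsCA1979, Ch. 4 §2.1 (index of a point with respect to a closed curve)] -/
def windRay (h : ω.IsB2a) (σ : Side) (m : ℕ) : ℤ :=
  wind (fun t ↦ polygonLoop (ω.pJlist hr h) t - toC (cornerPt (rayCorner r σ m)))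

variable (ω hr) in
/-- The `m`-th ray edge is **crossed** by the excursion: its mid-edge is the exit mid-edge of some slot (the
crossings counted by the even–odd rule). [cite: CourantRobbins1958, Ch. V Appendix §2 (The Jordan Curve Theorem for Polygons: the even–odd rule)] -/
def RayCrossed (h : ω.IsB2a) (σ : Side) (m : ℕ) : Prop := ∃ j, j < ω.Mv ∧ (ω.jFace h j).side (ω.jOut hr h j) = rayMid r σ m

/-- **No jump across an uncrossed ray edge.** [cite: AhlforsCA1979, Ch. 4 §2.1 (index of a point with respect to a closed curve)]
[cite: CourantRobbins1958, Ch. V Appendix §2 (The Jordan Curve Theorem for Polygons: the even–odd rule)] -/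
theorem windRay_succ_of_not_crossed (h : ω.IsB2a) {σ : Side} {m : ℕ} (hm : ¬ω.RayCrossed hr h σ m) :
    ω.windRay hr h σ m = ω.windRay hr h σ (m + 1) := by
  refine wind_eq_of_segment_disjoint h fun z hz k hk hzk => hm ?_
  obtain ⟨j, hj, -, he, -⟩ := exit_eq_rayMid_of_mem_edge h hk hzk hz
  exact ⟨j, hj, he⟩


/-- The midpoint of the `m`-th ray mid-edge lies on the open `m`-th ray edge. [folklore] -/
private theorem toC_midPt_rayMid_mem_openSegment (r : Face) (σ : Side) (m : ℕ) :
    toC (midPt (rayMid r σ m)) ∈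
      openSegment ℝ (toC (cornerPt (rayCorner r σ m))) (toC (cornerPt (rayCorner r σ (m + 1)))) := by
  rcases rayCorner_pair r σ m with ⟨e1, e2⟩ | ⟨e1, e2⟩
  · rw [e1, e2]; exact toC_midPt_side_mem_openSegment _ _
  · rw [e1, e2, openSegment_symm]; exact toC_midPt_side_mem_openSegment _ _

/-- The side functional of the `m`-th ray edge at the two ends of the crossing segment of its mid-edge: `±4`,
with opposite signs. [folklore] -/
private theorem segSideZ_ray (r : Face) (σ : Side) (m : ℕ) :
    (segSideZ (cornerPt (rayCorner r σ m)) (cornerPt (rayCorner r σ (m + 1)))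
          (midPt (rayMid r σ m) + (rayMid r σ m).nrm) = 4 ∧
        segSideZ (cornerPt (rayCorner r σ m)) (cornerPt (rayCorner r σ (m + 1)))
          (midPt (rayMid r σ m) - (rayMid r σ m).nrm) = -4) ∨
      (segSideZ (cornerPt (rayCorner r σ m)) (cornerPt (rayCorner r σ (m + 1)))
          (midPt (rayMid r σ m) + (rayMid r σ m).nrm) = -4 ∧
        segSideZ (cornerPt (rayCorner r σ m)) (cornerPt (rayCorner r σ (m + 1)))
          (midPt (rayMid r σ m) - (rayMid r σ m).nrm) = 4) := by
  obtain ⟨a, b⟩ := r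
  cases σ <;> simp only [segSideZ, rayCorner, rayMid, rayCell, raySide, Face.side, cornerPt, midPt, MidEdge.nrm,
    Prod.mk_add_mk, Prod.mk_sub_mk, Nat.cast_add, Nat.cast_one]
  all_goals (ring_nf; norm_num)

/-- The vertex `2j + 1` of `J` is the inner point ACROSS the exit mid-edge of slot `j`. [folklore] -/
private theorem pJpt_two_mul_add_one (h : ω.IsB2a) {j : ℕ} (hj : j < ω.Mv) :
    ω.pJpt hr h (2 * j + 1) = midPt ((ω.jFace h j).side (ω.jOut hr h j)) - (ω.jOut hr h j).nIn := by
  have hM := three_le_Mv hr h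
  obtain ⟨hside, hface⟩ := side_jOut_eq_side_jIn_succ (hr := hr) h hj
  have e1 : ω.pJpt hr h (2 * j + 1) = innerPt (ω.jFace h ((j + 1) % ω.Mv)) (ω.jIn h ((j + 1) % ω.Mv)) := by
    rw [← pJpt_in (hr := hr) h (Nat.mod_lt _ (by omega))]
    congr 1
    by_cases hl : j + 1 = ω.Mv
    · rw [hl, Nat.mod_self, mul_zero, zero_add, Nat.mod_eq_of_lt (by omega)]; omega
    · rw [Nat.mod_eq_of_lt (show j + 1 < ω.Mv by omega),
        show 2 * (j + 1) + 2 * ω.Mv - 1 = (2 * j + 1) + 2 * ω.Mv by omega, Nat.add_mod_right,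
        Nat.mod_eq_of_lt (by omega)]
  rw [e1, innerPt_eq, hside, nIn_eq_neg_of_side_eq hside.symm hface.symm, sub_eq_add_neg]

/-- The vertex `2j` of `J` is the inner point BEFORE the exit mid-edge of slot `j`. [folklore] -/
private theorem pJpt_two_mul (h : ω.IsB2a) {j : ℕ} (hj : j < ω.Mv) :
    ω.pJpt hr h (2 * j) = midPt ((ω.jFace h j).side (ω.jOut hr h j)) + (ω.jOut hr h j).nIn := by
  rw [pJpt_even h hj, innerPt_eq]

/-- The affine midpoint of `m + v` and `m - v` is `m`. [folklore] -/
private theorem lineMap_toC_add_sub_half (m v : ℤ × ℤ) :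
    AffineMap.lineMap (toC (m + v)) (toC (m - v)) (1 / 2 : ℝ) = toC m := by
  rw [AffineMap.lineMap_apply_module']
  apply Complex.ext <;> simp [toC] <;> ring

/-- **The jump across a crossed ray edge**: if the `m`-th ray mid-edge is the exit mid-edge of a slot, the
winding numbers of `J` about the two ends of the `m`-th ray edge differ by one. [cite: AhlforsCA1979, Ch. 4 §2.1 (index of a point with respect to a closed curve)]
[cite: CourantRobbins1958, Ch. V Appendix §2 (The Jordan Curve Theorem for Polygons: the even–odd rule)] -/
theorem windRay_jump (h : ω.IsB2a) {σ : Side} {m j : ℕ} (hj : j < ω.Mv)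
    (he : (ω.jFace h j).side (ω.jOut hr h j) = rayMid r σ m) :
    ω.windRay hr h σ m - ω.windRay hr h σ (m + 1) = 1 ∨ ω.windRay hr h σ (m + 1) - ω.windRay hr h σ m = 1 := by
  have hM := three_le_Mv hr h
  have hJ := isJordanLoop_pJ (hr := hr) h
  set l := ω.pJlist hr h with hl
  set N := 2 * ω.Mv with hN
  have hlen : l.length = N := length_pJlist h
  have hl0 : l ≠ [] := List.ne_nil_of_length_pos (pJlist_pos h)
  have hNr : (0 : ℝ) < (l.length : ℝ) := by rw [hlen]; exact_mod_cast (show 0 < N by omega)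
  have h2j : 2 * j < l.length := by rw [hlen]; omega
  have h2j1 : 2 * j + 1 < l.length := by rw [hlen]; omega
  set L : ℝ → ℂ := polygonLoop l with hL
  set u : ℝ := ((2 * j : ℕ) : ℝ) / (l.length : ℝ) with hu
  set u' : ℝ := ((2 * j + 1 : ℕ) : ℝ) / (l.length : ℝ) with hu'
  have hu0 : 0 ≤ u := div_nonneg (Nat.cast_nonneg _) hNr.le
  have huu' : u < u' := by
    rw [hu, hu']; exact div_lt_div_of_pos_right (by push_cast; linarith) hNr
  have hu'1 : u' ≤ 1 := by
    rw [hu', div_le_one hNr]; exact_mod_cast h2j1.le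
  have hd : u' - u = 1 / (l.length : ℝ) := by rw [hu, hu']; push_cast; field_simp; ring
  -- the ends of the crossing edge
  set e := rayMid r σ m with he'
  set v := (ω.jOut hr h j).nIn with hv
  have hLu : L u = toC (midPt e + v) := by
    rw [hL, hu, polygonLoop_vertex h2j, pJlist_getElem, ω.pJ_eq_toC h, pJpt_two_mul h hj, he]
  have hLu' : L u' = toC (midPt e - v) := by
    rw [hL, hu', polygonLoop_vertex h2j1, pJlist_getElem, ω.pJ_eq_toC h, pJpt_two_mul_add_one h hj, he]
  -- the crossing edge is straight
  have hmid : ∀ s ∈ Icc u u', L s = AffineMap.lineMap (L u) (L u') ((s - u) / (u' - u)) := by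
    intro s hs
    have hθ : (s - u) / (u' - u) ∈ Icc (0 : ℝ) 1 :=
      ⟨div_nonneg (by linarith [hs.1]) (by linarith), (div_le_one (by linarith)).2 (by linarith [hs.2])⟩
    have hsu : s = (((2 * j : ℕ) : ℝ) + (s - u) / (u' - u)) / (l.length : ℝ) := by
      rw [hd, hu]; field_simp; ring
    have e := polygonLoop_apply_div (l := l) (k := 2 * j) h2j hθ
    rw [← hsu] at e
    have eB : l[(2 * j + 1) % l.length]'(Nat.mod_lt _ (by omega)) = l[2 * j + 1] :=
      getElem_congr_idx (Nat.mod_eq_of_lt h2j1)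
    rw [eB] at e
    rw [hL, e, hu, hu', polygonLoop_vertex h2j, polygonLoop_vertex h2j1]
  -- the midpoint of the ray edge is on the crossing edge, at time `s⋆ ∈ (u, u')`
  set c : ℂ := toC (midPt e) with hc
  set sStar : ℝ := (((2 * j : ℕ) : ℝ) + 1 / 2) / (l.length : ℝ) with hsStar
  have hsStar_mem : sStar ∈ Icc u u' := by
    rw [hsStar, hu, hu']; constructor
    · exact div_le_div_of_nonneg_right (by linarith) hNr.le
    · exact div_le_div_of_nonneg_right (by push_cast; linarith) hNr.le
  have hsStar_lt : u < sStar ∧ sStar < u' := by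
    rw [hsStar, hu, hu']; constructor
    · exact div_lt_div_of_pos_right (by linarith) hNr
    · exact div_lt_div_of_pos_right (by push_cast; linarith) hNr
  have hLsStar : L sStar = c := by
    rw [hmid sStar hsStar_mem, hLu, hLu', hc]
    have : (sStar - u) / (u' - u) = 1 / 2 := by rw [hd, hsStar, hu]; field_simp; ring
    rw [this, lineMap_toC_add_sub_half]
  have hsStar01 : sStar ∈ Ico (0 : ℝ) 1 := ⟨by linarith [hsStar_lt.1], by linarith [hsStar_lt.2]⟩
  -- off the straight piece, the loop misses the closed ray edge
  have hout_gen : ∀ s ∈ Icc 0 u ∪ Icc u' 1,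
      L s ∉ segment ℝ (toC (cornerPt (rayCorner r σ m))) (toC (cornerPt (rayCorner r σ (m + 1)))) := by
    intro s hs hmem
    -- `L s` is on some closed edge of `J`
    have hex : ∃ k, k < 2 * ω.Mv ∧ L s ∈ segment ℝ (ω.pJ hr h k) (ω.pJ hr h (k + 1)) := by
      by_contra hh
      push Not at hh
      exact not_mem_range_of_forall h (fun k hk => hh k hk) ⟨s, rfl⟩
    obtain ⟨k, hk, hLk⟩ := hex
    obtain ⟨j', hj', -, hej', hp⟩ := exit_eq_rayMid_of_mem_edge h hk hLk hmem
    -- so `L s = c = L s⋆`, and by injectivity `s = s⋆ ∈ (u, u')`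
    rw [← he', ← hc] at hp
    rcases hs with hs | hs
    · have hs01 : s ∈ Ico (0 : ℝ) 1 := ⟨hs.1, lt_of_le_of_lt hs.2 (lt_of_lt_of_le huu' hu'1)⟩
      have := hJ.injOn hs01 hsStar01 (hp.trans hLsStar.symm)
      rw [this] at hs; linarith [hs.2, hsStar_lt.1]
    · rcases hs.2.lt_or_eq with hs1 | hs1
      · have hs01 : s ∈ Ico (0 : ℝ) 1 := ⟨le_trans hu0 (le_trans huu'.le hs.1), hs1⟩
        have := hJ.injOn hs01 hsStar01 (hp.trans hLsStar.symm)
        rw [this] at hs; linarith [hs.1, hsStar_lt.2]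
      · -- `s = 1`: `L 1 = L 0`
        have h10 : L 0 = c := by
          rw [← hp, hs1, hL]; simpa using (periodic_polygonLoop l 0).symm
        have h0mem : (0 : ℝ) ∈ Ico (0 : ℝ) 1 := ⟨le_rfl, one_pos⟩
        have := hJ.injOn h0mem hsStar01 (h10.trans hLsStar.symm)
        linarith [hsStar_lt.1]
  -- a point of the crossing edge in the open ray edge
  have hx_gen : c ∈ segment ℝ (L u) (L u') := by
    rw [hLu, hLu', segment_eq_image_lineMap]
    exact ⟨1 / 2, ⟨by norm_num, by norm_num⟩, lineMap_toC_add_sub_half _ _⟩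
  have hc_open := toC_midPt_rayMid_mem_openSegment r σ m
  rw [← he', ← hc] at hc_open
  -- the signs of the side functional at the two ends: `v = ± nrm e`
  have hsides : ∀ Z : ℤ × ℤ, segSide (toC (cornerPt (rayCorner r σ m))) (toC (cornerPt (rayCorner r σ (m + 1)))) (toC Z) =
      segSideZ (cornerPt (rayCorner r σ m)) (cornerPt (rayCorner r σ (m + 1))) Z := fun Z => segSide_toC _ _ _
  have hswap : ∀ Z : ℂ, segSide (toC (cornerPt (rayCorner r σ (m + 1)))) (toC (cornerPt (rayCorner r σ m))) Z =
      -segSide (toC (cornerPt (rayCorner r σ m))) (toC (cornerPt (rayCorner r σ (m + 1)))) Z := by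
    intro Z; rw [segSide_eq, segSide_eq]; ring
  have hvn : v = e.nrm ∨ v = -e.nrm := by
    rw [hv, ← he]; exact nIn_eq_nrm_or _ _
  -- signs at the ends: `S(L u) = ±4`, `S(L u') = ∓4`
  have hsign : (0 < segSide (toC (cornerPt (rayCorner r σ m))) (toC (cornerPt (rayCorner r σ (m + 1)))) (L u) ∧
        segSide (toC (cornerPt (rayCorner r σ m))) (toC (cornerPt (rayCorner r σ (m + 1)))) (L u') < 0) ∨
      (segSide (toC (cornerPt (rayCorner r σ m))) (toC (cornerPt (rayCorner r σ (m + 1)))) (L u) < 0 ∧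
        0 < segSide (toC (cornerPt (rayCorner r σ m))) (toC (cornerPt (rayCorner r σ (m + 1)))) (L u')) := by
    rw [hLu, hLu', hsides, hsides]
    obtain ⟨h1, h2⟩ | ⟨h1, h2⟩ := segSideZ_ray r σ m <;> rw [← he'] at h1 h2 <;> rcases hvn with hvn | hvn
    · left; rw [hvn, h1, h2]; norm_num
    · right; rw [hvn, ← sub_eq_add_neg, sub_neg_eq_add, h2, h1]; norm_num
    · right; rw [hvn, h1, h2]; norm_num
    · left; rw [hvn, ← sub_eq_add_neg, sub_neg_eq_add, h2, h1]; norm_num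
  have hcont : ContinuousOn L (Icc 0 1) := (continuous_polygonLoop l).continuousOn
  have h01 : L 0 = L 1 := by rw [hL]; simpa using (periodic_polygonLoop l 0).symm
  rcases hsign with ⟨hA, hB⟩ | ⟨hA, hB⟩
  · left
    have key := wind_sub_wind_of_straight_cross (L := L) (a := 0) (u := u) (u' := u') (b := 1)
      (ℓ := toC (cornerPt (rayCorner r σ m))) (r := toC (cornerPt (rayCorner r σ (m + 1)))) hu0 huu' hu'1
      hcont h01 hmid hout_gen hA hB ⟨c, hx_gen, hc_open⟩
    simpa [windRay] using key
  · right
    rw [openSegment_symm] at hc_open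
    have key := wind_sub_wind_of_straight_cross (L := L) (a := 0) (u := u) (u' := u') (b := 1)
      (ℓ := toC (cornerPt (rayCorner r σ (m + 1)))) (r := toC (cornerPt (rayCorner r σ m))) hu0 huu' hu'1
      hcont h01 hmid (fun s hs hmem => hout_gen s hs (by rwa [segment_symm] at hmem))
      (by rw [hswap]; linarith) (by rw [hswap]; linarith) ⟨c, hx_gen, hc_open⟩
    simpa [windRay] using key


/-! ### Parity bookkeeping along the ray -/

/-- **One step along the ray, mod 2**: the winding number about corner `m` equals the one about corner `m + 1`
plus one if the `m`-th ray edge is crossed, plus zero if not. [cite: AhlforsCA1979, Ch. 4 §2.1 (index of a point with respect to a closed curve)] -/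
theorem windRay_step_mod_two (h : ω.IsB2a) (σ : Side) (m : ℕ) [Decidable (ω.RayCrossed hr h σ m)] :
    ((ω.windRay hr h σ m : ℤ) : ZMod 2) =
      (ω.windRay hr h σ (m + 1) : ZMod 2) + (if ω.RayCrossed hr h σ m then 1 else 0) := by
  split_ifs with hc
  · obtain ⟨j, hj, he⟩ := hc
    rcases windRay_jump h hj he with e | e
    · have : ω.windRay hr h σ m = ω.windRay hr h σ (m + 1) + 1 := by omega
      rw [this]; push_cast; ring
    · have : ω.windRay hr h σ m = ω.windRay hr h σ (m + 1) - 1 := by omega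
      rw [this]; push_cast
      have h2 : (2 : ZMod 2) = 0 := by decide
      linear_combination -h2
  · rw [windRay_succ_of_not_crossed h hc, add_zero]

open scoped Classical in
/-- **Parity along the ray**: for every `M`, the winding number about the start of the ray is, mod 2, the one
about corner `M` plus the number of crossed ray edges below `M`. [cite: AhlforsCA1979, Ch. 4 §2.1 (index of a point with respect to a closed curve)]
[cite: CourantRobbins1958, Ch. V Appendix §2 (The Jordan Curve Theorem for Polygons: the even–odd rule)] -/
theorem windRay_zero_mod_two (h : ω.IsB2a) (σ : Side) (M : ℕ) :
    ((ω.windRay hr h σ 0 : ℤ) : ZMod 2) =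
      (ω.windRay hr h σ M : ZMod 2) + (((Finset.range M).filter (ω.RayCrossed hr h σ)).card : ZMod 2) := by
  induction M with
  | zero => simp
  | succ M ih =>
    rw [ih, windRay_step_mod_two h σ M, Finset.range_add_one, Finset.filter_insert]
    split_ifs with hc
    · rw [Finset.card_insert_of_notMem (fun hm => Finset.notMem_range_self (Finset.mem_filter.1 hm).1)]
      push_cast; ring
    · rw [add_zero]

/-- A bound for the drawing of `J`. [folklore] -/
private theorem exists_norm_le (h : ω.IsB2a) :
    ∃ R : ℝ, (∀ k ≤ 2 * ω.Mv, ‖ω.pJ hr h k‖ ≤ R) ∧ ∀ t, ‖polygonLoop (ω.pJlist hr h) t‖ ≤ R := by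
  have hM := three_le_Mv hr h
  set l := ω.pJlist hr h with hl
  have hlen : l.length = 2 * ω.Mv := length_pJlist h
  have hl0 : l ≠ [] := List.ne_nil_of_length_pos (pJlist_pos h)
  set R : ℝ := ∑ k ∈ Finset.range (2 * ω.Mv), ‖ω.pJ hr h k‖ with hR
  have hv : ∀ k ≤ 2 * ω.Mv, ‖ω.pJ hr h k‖ ≤ R := by
    intro k hk
    rcases hk.lt_or_eq with hk | rfl
    · exact Finset.single_le_sum (f := fun k => ‖ω.pJ hr h k‖) (fun _ _ => norm_nonneg _) (Finset.mem_range.2 hk)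
    · rw [ω.pJ_closed h]
      exact Finset.single_le_sum (f := fun k => ‖ω.pJ hr h k‖) (fun _ _ => norm_nonneg _)
        (Finset.mem_range.2 (by omega))
  refine ⟨R, hv, fun t => ?_⟩
  obtain ⟨k, hk, θ, hθ, -, hvtx⟩ := polygonLoop_eq_of_floor hl0 t
  have hk2 : k < 2 * ω.Mv := by rw [← hlen]; exact hk
  have hmem : polygonLoop l t ∈ segment ℝ (ω.pJ hr h k) (ω.pJ hr h (k + 1)) := by
    rw [hvtx, pJlist_getElem, pJlist_getElem_succ h hk2, segment_eq_image_lineMap]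
    exact ⟨θ, ⟨hθ.1, hθ.2.le⟩, rfl⟩
  have := norm_sub_le_of_mem_segment (c := 0) (ρ := R) (by rw [sub_zero]; exact hv k hk2.le)
    (by rw [sub_zero]; exact hv (k + 1) (by omega)) hmem
  rwa [sub_zero] at this

/-- **Far along the ray**: beyond some index no ray edge is crossed, and the winding number of `J` about the
ray corners vanishes. [cite: AhlforsCA1979, Ch. 4 §2.1 (index of a point with respect to a closed curve)]
[cite: Mccleary2006, Ch. 9, p. 129 (The Jordan Curve Theorem)] -/
theorem exists_far (h : ω.IsB2a) (σ : Side) :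
    ∃ M : ℕ, (∀ m, ω.RayCrossed hr h σ m → m < M) ∧ ω.windRay hr h σ M = 0 := by
  have hM := three_le_Mv hr h
  have hJ := isJordanLoop_pJ (hr := hr) h
  obtain ⟨R, hv, hR⟩ := exists_norm_le (hr := hr) h
  set C : ℝ := 4 * (|(r.1 : ℝ)| + |(r.2 : ℝ)| + 1) with hC
  obtain ⟨M, hMge⟩ := exists_nat_ge ((R + C + 2) / 4)
  have hM4 : R + C + 2 ≤ 4 * (M : ℝ) := by
    have := (div_le_iff₀ (show (0 : ℝ) < 4 by norm_num)).1 hMge; linarith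
  refine ⟨M, fun m ⟨j, hj, hej⟩ => ?_, ?_⟩
  · -- the midpoint of a crossed ray mid-edge is on `J`, hence within `R` of the origin
    by_contra hmM
    push Not at hmM
    have hmid : toC (midPt (rayMid r σ m)) ∈ segment ℝ (ω.pJ hr h (2 * j)) (ω.pJ hr h (2 * j + 1)) := by
      rw [ω.pJ_eq_toC h, ω.pJ_eq_toC h, pJpt_two_mul h hj, pJpt_two_mul_add_one h hj, hej, segment_eq_image_lineMap]
      exact ⟨1 / 2, ⟨by norm_num, by norm_num⟩, lineMap_toC_add_sub_half _ _⟩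
    have h1 := norm_sub_le_of_mem_segment (c := 0) (ρ := R) (by rw [sub_zero]; exact hv (2 * j) (by omega))
      (by rw [sub_zero]; exact hv (2 * j + 1) (by omega)) hmid
    rw [sub_zero] at h1
    have h2 := norm_toC_midPt_rayMid_ge r σ m
    have h3 : (M : ℝ) ≤ m := by exact_mod_cast hmM
    linarith
  · -- the far corner is off `J` and not inside: outside, winding number `0`
    have hq : toC (cornerPt (rayCorner r σ M)) ∉ range (polygonLoop (ω.pJlist hr h)) :=
      not_mem_range_of_forall h fun k hk => toC_cornerPt_not_mem_edge h _ hk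
    rcases IsJordanLoop.mem_inside_or_mem_outside hq with hin | hout
    · exfalso
      have h1 := hJ.norm_lt_of_mem_inside hR hin
      have h2 := norm_toC_cornerPt_rayCorner_ge r σ M
      linarith
    · exact (hJ.mem_outside_iff_wind_eq_zero hq).1 hout

/-! ### The ray count and the parity law -/

variable (ω hr) in
open scoped Classical in
/-- ★ **The ray count** of a walk of class `B2a` at `r` behind the side `σ`: the number of slots of the excursion
polygon (the chord through `r` and the excursion arcs) whose exit mid-edge lies on the ray behind the side `σ` of
`r` — i.e. the number of times the excursion crosses the lattice half-line `rayMid r σ 0, rayMid r σ 1, …` (the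
chord's crossing mid-edges are sides of `r`, never on the ray: `rayMid_ne_side`); only the excursion's mid-edges
count, not those of the walk before its first hit of `∂r`. [cite: CourantRobbins1958, Ch. V Appendix §2 (The Jordan Curve Theorem for Polygons: the even–odd rule)] -/
def rayCount (h : ω.IsB2a) (σ : Side) : ℕ :=
  ((Finset.range ω.Mv).filter fun j => ∃ m : ℕ, (ω.jFace h j).side (ω.jOut hr h j) = rayMid r σ m).card

open scoped Classical in
/-- The ray count equals the number of crossed ray edges below any index beyond the last crossing. [folklore] -/
private theorem card_filter_rayCrossed_eq_rayCount (h : ω.IsB2a) (σ : Side) {M : ℕ}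
    (hM : ∀ m, ω.RayCrossed hr h σ m → m < M) :
    ((Finset.range M).filter (ω.RayCrossed hr h σ)).card = ω.rayCount hr h σ := by
  unfold rayCount
  refine Finset.card_bij (fun m hm => Classical.choose (Finset.mem_filter.1 hm).2) ?_ ?_ ?_
  · intro m hm
    have hs := Classical.choose_spec (Finset.mem_filter.1 hm).2
    exact Finset.mem_filter.2 ⟨Finset.mem_range.2 hs.1, m, hs.2⟩
  · intro m₁ hm₁ m₂ hm₂ heq
    have hs₁ := Classical.choose_spec (Finset.mem_filter.1 hm₁).2
    have hs₂ := Classical.choose_spec (Finset.mem_filter.1 hm₂).2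
    apply rayMid_injective r σ
    rw [← hs₁.2, ← hs₂.2]
    exact congrArg (fun j => (ω.jFace h j).side (ω.jOut hr h j)) heq
  · intro j hj
    obtain ⟨hjM, m, hm⟩ := Finset.mem_filter.1 hj
    have hc : ω.RayCrossed hr h σ m := ⟨j, Finset.mem_range.1 hjM, hm⟩
    have hmem : m ∈ (Finset.range M).filter (ω.RayCrossed hr h σ) :=
      Finset.mem_filter.2 ⟨Finset.mem_range.2 (hM m hc), hc⟩
    refine ⟨m, hmem, ?_⟩
    have hs := Classical.choose_spec (Finset.mem_filter.1 hmem).2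
    exact jOut_side_inj h hs.1 (Finset.mem_range.1 hjM) (hs.2.trans hm.symm)

/-- The base point transport: the winding number of `J` about the midpoint of a free side `σ` of `r` equals the
one about the start of the ray behind `σ`. [cite: Glazman2015WeightedSAW, Lemma 3.1 (proof, pp. 6–7: the classes of walks through a rhombus)]
[cite: AhlforsCA1979, Ch. 4 §2.1 (index of a point with respect to a closed curve)] -/
theorem wind_midPt_side_eq_windRay_zero (h : ω.IsB2a) {σ : Side} (hσ1 : σ ≠ ω.z1 hr h) (hσ2 : σ ≠ ω.1) :
    wind (fun t ↦ polygonLoop (ω.pJlist hr h) t - toC (midPt (r.side σ))) = ω.windRay hr h σ 0 :=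
  wind_eq_of_segment_disjoint h fun _ hz _ hk hzk => halfSide_disjoint_edges h hσ1 hσ2 hk hzk hz

/-- ★★ **THE WINDING PARITY LAW (mod-2 form).** For a walk of class `B2a` at `r` and a side `σ` of `r` other than
the exit and return sides, the winding number of the excursion polygon `J` about the midpoint of `r.side σ` is
congruent mod `2` to the ray count: the number of crossings of the excursion with the lattice half-line behind
the side `σ` (even–odd rule for the simple closed lattice polygon `J`, by transport of the base point along the
ray: no jump across an uncrossed unit edge, a jump `±1` across a crossed one, winding number `0` far away).
[cite: GlazmanManolescu2019, Lemma 2.1 (statement, "in the form given in [Gl]")]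
[cite: Glazman2015WeightedSAW, Lemma 3.1 (proof, pp. 6–7: the classes of walks through a rhombus)]
[cite: Mccleary2006, Ch. 9, p. 129 (The Jordan Curve Theorem)]
[cite: CourantRobbins1958, Ch. V Appendix §2 (The Jordan Curve Theorem for Polygons: the even–odd rule)] -/
theorem wind_midPt_side_eq_rayCount_mod_two (h : ω.IsB2a) {σ : Side} (hσ1 : σ ≠ ω.z1 hr h) (hσ2 : σ ≠ ω.1) :
    ((wind (fun t ↦ polygonLoop (ω.pJlist hr h) t - toC (midPt (r.side σ))) : ℤ) : ZMod 2) =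
      (ω.rayCount hr h σ : ZMod 2) := by
  classical
  obtain ⟨M, hM, h0⟩ := exists_far (hr := hr) h σ
  rw [wind_midPt_side_eq_windRay_zero h hσ1 hσ2, windRay_zero_mod_two h σ M, h0,
    card_filter_rayCrossed_eq_rayCount h σ hM]
  simp

/-- ★★★ **THE WINDING PARITY LAW.** For every finite face domain, every non-interior root, every walk `ω` of class
`B2a` at `r` and every side `σ` of `r` other than the exit side `z₁` and the return side `z₂`: **the excursion
polygon winds around the midpoint of `r.side σ` (`AJ ≠ 0`, equivalently `AJ = 2π·chordSign σ z₁ z₂`, equivalently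
the midpoint lies inside `J`) iff the excursion crosses the lattice half-line behind the side `σ` of `r` an ODD
number of times.** With the parent files' winding laws (`WE − excursionWinding = 2·AJ` at the root's own
plaquette) this makes «wound» — and hence, by the lane's root-plaquette defect law, the failure of the
Yang–Baxter vertex identity at a hole root's own plaquette on the open range of `θ` — a decidable combinatorial
property of the walk. [cite: GlazmanManolescu2019, Lemma 2.1 (statement, "in the form given in [Gl]")]
[cite: Glazman2015WeightedSAW, Lemma 3.1 (proof, pp. 6–7: the classes of walks through a rhombus)]
[cite: DuminilCopinSmirnov2012, proof of Lemma 1] [cite: Mccleary2006, Ch. 9, p. 129 (The Jordan Curve Theorem)]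
[cite: CourantRobbins1958, Ch. V Appendix §2 (The Jordan Curve Theorem for Polygons: the even–odd rule)] -/
theorem AJ_midPt_side_ne_zero_iff_odd_rayCount (h : ω.IsB2a) {σ : Side} (hσ1 : σ ≠ ω.z1 hr h) (hσ2 : σ ≠ ω.1) :
    ω.AJ hr h (toC (midPt (r.side σ))) ≠ 0 ↔ Odd (ω.rayCount hr h σ) := by
  have hJ := isJordanLoop_pJ (hr := hr) h
  have hb := not_mem_range_of_forall h (midPt_side_not_mem_edges h hσ1 hσ2)
  have hpar := wind_midPt_side_eq_rayCount_mod_two h hσ1 hσ2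
  rw [AJ_midPt_side_eq_two_pi_mul_wind h hσ1 hσ2, ← ZMod.natCast_eq_one_iff_odd, ← hpar]
  set w := wind (fun t ↦ polygonLoop (ω.pJlist hr h) t - toC (midPt (r.side σ))) with hw
  have tri : w = 0 ∨ w = 1 ∨ w = -1 := by
    rcases IsJordanLoop.mem_inside_or_mem_outside hb with hi | ho
    · right; exact hJ.wind_eq_one_or_neg_one_of_mem_inside hi
    · left; exact (hJ.mem_outside_iff_wind_eq_zero hb).1 ho
  have h2 : (2 : ℝ) * Real.pi ≠ 0 := by positivity
  constructor
  · intro hne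
    have hw0 : w ≠ 0 := fun h0 => hne (by rw [h0]; simp)
    rcases tri with e | e | e
    · exact absurd e hw0
    · rw [e]; simp
    · rw [e]; decide
  · intro hodd hzero
    have hw0 : (w : ℝ) = 0 := (mul_eq_zero.1 hzero).resolve_left h2
    have : w = 0 := by exact_mod_cast hw0
    rw [this, Int.cast_zero] at hodd
    exact zero_ne_one hodd

/-- The parity law, «unwound» form: `AJ = 0` iff the ray count is even. [cite: GlazmanManolescu2019, Lemma 2.1 (statement, "in the form given in [Gl]")]
[cite: Glazman2015WeightedSAW, Lemma 3.1 (proof, pp. 6–7: the classes of walks through a rhombus)]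
[cite: CourantRobbins1958, Ch. V Appendix §2 (The Jordan Curve Theorem for Polygons: the even–odd rule)] -/
theorem AJ_midPt_side_eq_zero_iff_even_rayCount (h : ω.IsB2a) {σ : Side} (hσ1 : σ ≠ ω.z1 hr h) (hσ2 : σ ≠ ω.1) :
    ω.AJ hr h (toC (midPt (r.side σ))) = 0 ↔ Even (ω.rayCount hr h σ) := by
  rw [← Nat.not_odd_iff_even, ← AJ_midPt_side_ne_zero_iff_odd_rayCount h hσ1 hσ2, not_not]

/-- The parity law, «inside» form: the midpoint of a free side `σ` of `r` lies inside the excursion polygon iff the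
ray count is odd. [cite: GlazmanManolescu2019, Lemma 2.1 (statement, "in the form given in [Gl]")]
[cite: Mccleary2006, Ch. 9, p. 129 (The Jordan Curve Theorem)]
[cite: CourantRobbins1958, Ch. V Appendix §2 (The Jordan Curve Theorem for Polygons: the even–odd rule)] -/
theorem midPt_side_mem_inside_iff_odd_rayCount (h : ω.IsB2a) {σ : Side} (hσ1 : σ ≠ ω.z1 hr h) (hσ2 : σ ≠ ω.1) :
    toC (midPt (r.side σ)) ∈ IsJordanLoop.inside (polygonLoop (ω.pJlist hr h)) ↔ Odd (ω.rayCount hr h σ) := by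
  rw [← AJ_midPt_side_ne_zero_iff_mem_inside h hσ1 hσ2, AJ_midPt_side_ne_zero_iff_odd_rayCount h hσ1 hσ2]

/-! ## Part P′. The winding parity law behind an arbitrary mid-edge (general base edge)

Part P transports the base point from the midpoint of a FREE SIDE `σ` of the class rhombus `r` along the ray
behind that side. The same argument works verbatim for the midpoint of ANY lattice mid-edge `b.side τ` that is
not a crossing mid-edge of the excursion polygon `J` (hypothesis `hb` below), transporting along the ray behind
the side `τ` of the face `b` (`rayCorner b τ ·`, `rayMid b τ ·` of Part P): the winding number of `J` about
`midPt (b.side τ)` is, mod 2, the number `rayCountAt b τ` of slots of `J` whose exit mid-edge lies on that ray.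
The case that matters for the tree is the ROOT: for a walk of class `B2a` at an ARBITRARY rooted rhombus `r`
(not only the root plaquette) the root mid-edge `a` is never a crossing mid-edge of `J` (`exit_ne_root`), so the
polygon is wound about the root (`AJ (midPt a) ≠ 0`, the quantity of `YangBaxterSAWUnwoundPlaquette.UnwoundAt`)
iff the excursion crosses the lattice half-line behind `a` an odd number of times
(`AJ_root_ne_zero_iff_odd_rayCountAt`). [cite: CourantRobbins1958, Ch. V Appendix §2 (The Jordan Curve Theorem for Polygons: the even–odd rule)]
[cite: Glazman2015WeightedSAW, Lemma 3.1 (proof, pp. 6–7: the classes of walks through a rhombus)] -/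

/-- Edges of `J` meeting the `m`-th edge of the ray behind the side `τ` of an arbitrary face `b` are exactly the
crossing edges of that ray mid-edge, met at its midpoint. [folklore] -/
private theorem exit_eq_rayMid_of_mem_edge_at (h : ω.IsB2a) {b : Face} {τ : Side} {m k : ℕ} (hk : k < 2 * ω.Mv) {p : ℂ}
    (hp : p ∈ segment ℝ (ω.pJ hr h k) (ω.pJ hr h (k + 1)))
    (hq : p ∈ segment ℝ (toC (cornerPt (rayCorner b τ m))) (toC (cornerPt (rayCorner b τ (m + 1))))) :
    ∃ j, j < ω.Mv ∧ k = 2 * j ∧ (ω.jFace h j).side (ω.jOut hr h j) = rayMid b τ m ∧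
      p = toC (midPt (rayMid b τ m)) := by
  rw [segment_rayCorner_eq] at hq
  exact exit_eq_of_mem_edge_sideSeg h hk hp hq

/-- **The half-edge from the midpoint of `b.side τ` to the start of the ray behind it is off `J`** whenever
`b.side τ` is not a crossing mid-edge of `J`. [folklore] -/
private theorem halfEdge_disjoint_edges_at (h : ω.IsB2a) {b : Face} {τ : Side}
    (hb : ∀ j < ω.Mv, (ω.jFace h j).side (ω.jOut hr h j) ≠ b.side τ) {k : ℕ} (hk : k < 2 * ω.Mv) {p : ℂ}
    (hp : p ∈ segment ℝ (ω.pJ hr h k) (ω.pJ hr h (k + 1)))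
    (hq : p ∈ segment ℝ (toC (midPt (b.side τ))) (toC (cornerPt (rayCorner b τ 0)))) : False := by
  have hsub : segment ℝ (toC (midPt (b.side τ))) (toC (cornerPt (rayCorner b τ 0))) ⊆ sideSeg b τ := by
    rw [cornerPt_rayCorner_zero]
    exact (convex_segment _ _).segment_subset (toC_midPt_side_mem_sideSeg b τ) (left_mem_segment _ _ _)
  obtain ⟨j, hj, -, he, -⟩ := exit_eq_of_mem_edge_sideSeg h hk hp (hsub hq)
  exact hb j hj he

/-- The midpoint of a mid-edge that is not a crossing mid-edge of `J` is off the closed edges of `J`. [folklore] -/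
private theorem midPt_not_mem_edges_at (h : ω.IsB2a) {b : Face} {τ : Side}
    (hb : ∀ j < ω.Mv, (ω.jFace h j).side (ω.jOut hr h j) ≠ b.side τ) :
    ∀ k < 2 * ω.Mv, toC (midPt (b.side τ)) ∉ segment ℝ (ω.pJ hr h k) (ω.pJ hr h (k + 1)) := by
  intro k hk hmem
  obtain ⟨j, hj, -, he, -⟩ := exit_eq_of_mem_edge_sideSeg h hk hmem (toC_midPt_side_mem_sideSeg b τ)
  exact hb j hj he

/-- The root mid-edge `a` is never a crossing mid-edge of the excursion polygon (the walk is self-avoiding and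
`a` is its first mid-edge). [cite: Glazman2015WeightedSAW, Lemma 3.1 (proof, pp. 6–7: the classes of walks through a rhombus)] -/
theorem exit_ne_root (h : ω.IsB2a) {j : ℕ} (hj : j < ω.Mv) : (ω.jFace h j).side (ω.jOut hr h j) ≠ a := by
  rw [side_jOut h hj]
  intro e
  have := nth_inj h (i := ω.2.firstHitG + j + 1) (i' := 0) (by rw [len_eq h]; omega) (Nat.zero_le _)
    (e.trans ω.2.nth_zero.symm)
  omega

/-! ### Transport and jumps along the ray behind `b.side τ` -/

variable (ω hr) in
/-- The winding number of `J` about the `m`-th corner of the ray behind the side `τ` of the face `b`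
(general base edge; Part P's `windRay` is the case `b = r`).
[cite: AhlforsCA1979, Ch. 4 §2.1 (index of a point with respect to a closed curve)] -/
def windRayAt (h : ω.IsB2a) (b : Face) (τ : Side) (m : ℕ) : ℤ :=
  wind (fun t ↦ polygonLoop (ω.pJlist hr h) t - toC (cornerPt (rayCorner b τ m)))

variable (ω hr) in
/-- The `m`-th edge of the ray behind the side `τ` of the face `b` is **crossed** by `J`: its mid-edge is the
exit mid-edge of some slot (general base edge; Part P's `RayCrossed` is the case `b = r`). [cite: CourantRobbins1958, Ch. V Appendix §2 (The Jordan Curve Theorem for Polygons: the even–odd rule)] -/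
def RayCrossedAt (h : ω.IsB2a) (b : Face) (τ : Side) (m : ℕ) : Prop := ∃ j, j < ω.Mv ∧ (ω.jFace h j).side (ω.jOut hr h j) = rayMid b τ m

/-- **No jump across an uncrossed ray edge.** [cite: AhlforsCA1979, Ch. 4 §2.1 (index of a point with respect to a closed curve)]
[cite: CourantRobbins1958, Ch. V Appendix §2 (The Jordan Curve Theorem for Polygons: the even–odd rule)] -/
theorem windRayAt_succ_of_not_crossed (h : ω.IsB2a) {b : Face} {τ : Side} {m : ℕ} (hm : ¬ω.RayCrossedAt hr h b τ m) :
    ω.windRayAt hr h b τ m = ω.windRayAt hr h b τ (m + 1) := by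
  refine wind_eq_of_segment_disjoint h fun z hz k hk hzk => hm ?_
  obtain ⟨j, hj, -, he, -⟩ := exit_eq_rayMid_of_mem_edge_at h hk hzk hz
  exact ⟨j, hj, he⟩


/-- **The jump across a crossed ray edge**: if the `m`-th ray mid-edge is the exit mid-edge of a slot, the
winding numbers of `J` about the two ends of the `m`-th ray edge differ by one. [cite: AhlforsCA1979, Ch. 4 §2.1 (index of a point with respect to a closed curve)]
[cite: CourantRobbins1958, Ch. V Appendix §2 (The Jordan Curve Theorem for Polygons: the even–odd rule)] -/
theorem windRayAt_jump (h : ω.IsB2a) {b : Face} {τ : Side} {m j : ℕ} (hj : j < ω.Mv)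
    (he : (ω.jFace h j).side (ω.jOut hr h j) = rayMid b τ m) :
    ω.windRayAt hr h b τ m - ω.windRayAt hr h b τ (m + 1) = 1 ∨ ω.windRayAt hr h b τ (m + 1) - ω.windRayAt hr h b τ m = 1 := by
  have hM := three_le_Mv hr h
  have hJ := isJordanLoop_pJ (hr := hr) h
  set l := ω.pJlist hr h with hl
  set N := 2 * ω.Mv with hN
  have hlen : l.length = N := length_pJlist h
  have hl0 : l ≠ [] := List.ne_nil_of_length_pos (pJlist_pos h)
  have hNr : (0 : ℝ) < (l.length : ℝ) := by rw [hlen]; exact_mod_cast (show 0 < N by omega)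
  have h2j : 2 * j < l.length := by rw [hlen]; omega
  have h2j1 : 2 * j + 1 < l.length := by rw [hlen]; omega
  set L : ℝ → ℂ := polygonLoop l with hL
  set u : ℝ := ((2 * j : ℕ) : ℝ) / (l.length : ℝ) with hu
  set u' : ℝ := ((2 * j + 1 : ℕ) : ℝ) / (l.length : ℝ) with hu'
  have hu0 : 0 ≤ u := div_nonneg (Nat.cast_nonneg _) hNr.le
  have huu' : u < u' := by
    rw [hu, hu']; exact div_lt_div_of_pos_right (by push_cast; linarith) hNr
  have hu'1 : u' ≤ 1 := by
    rw [hu', div_le_one hNr]; exact_mod_cast h2j1.le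
  have hd : u' - u = 1 / (l.length : ℝ) := by rw [hu, hu']; push_cast; field_simp; ring
  -- the ends of the crossing edge
  set e := rayMid b τ m with he'
  set v := (ω.jOut hr h j).nIn with hv
  have hLu : L u = toC (midPt e + v) := by
    rw [hL, hu, polygonLoop_vertex h2j, pJlist_getElem, ω.pJ_eq_toC h, pJpt_two_mul h hj, he]
  have hLu' : L u' = toC (midPt e - v) := by
    rw [hL, hu', polygonLoop_vertex h2j1, pJlist_getElem, ω.pJ_eq_toC h, pJpt_two_mul_add_one h hj, he]
  -- the crossing edge is straight
  have hmid : ∀ s ∈ Icc u u', L s = AffineMap.lineMap (L u) (L u') ((s - u) / (u' - u)) := by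
    intro s hs
    have hθ : (s - u) / (u' - u) ∈ Icc (0 : ℝ) 1 :=
      ⟨div_nonneg (by linarith [hs.1]) (by linarith), (div_le_one (by linarith)).2 (by linarith [hs.2])⟩
    have hsu : s = (((2 * j : ℕ) : ℝ) + (s - u) / (u' - u)) / (l.length : ℝ) := by
      rw [hd, hu]; field_simp; ring
    have e := polygonLoop_apply_div (l := l) (k := 2 * j) h2j hθ
    rw [← hsu] at e
    have eB : l[(2 * j + 1) % l.length]'(Nat.mod_lt _ (by omega)) = l[2 * j + 1] :=
      getElem_congr_idx (Nat.mod_eq_of_lt h2j1)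
    rw [eB] at e
    rw [hL, e, hu, hu', polygonLoop_vertex h2j, polygonLoop_vertex h2j1]
  -- the midpoint of the ray edge is on the crossing edge, at time `s⋆ ∈ (u, u')`
  set c : ℂ := toC (midPt e) with hc
  set sStar : ℝ := (((2 * j : ℕ) : ℝ) + 1 / 2) / (l.length : ℝ) with hsStar
  have hsStar_mem : sStar ∈ Icc u u' := by
    rw [hsStar, hu, hu']; constructor
    · exact div_le_div_of_nonneg_right (by linarith) hNr.le
    · exact div_le_div_of_nonneg_right (by push_cast; linarith) hNr.le
  have hsStar_lt : u < sStar ∧ sStar < u' := by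
    rw [hsStar, hu, hu']; constructor
    · exact div_lt_div_of_pos_right (by linarith) hNr
    · exact div_lt_div_of_pos_right (by push_cast; linarith) hNr
  have hLsStar : L sStar = c := by
    rw [hmid sStar hsStar_mem, hLu, hLu', hc]
    have : (sStar - u) / (u' - u) = 1 / 2 := by rw [hd, hsStar, hu]; field_simp; ring
    rw [this, lineMap_toC_add_sub_half]
  have hsStar01 : sStar ∈ Ico (0 : ℝ) 1 := ⟨by linarith [hsStar_lt.1], by linarith [hsStar_lt.2]⟩
  -- off the straight piece, the loop misses the closed ray edge
  have hout_gen : ∀ s ∈ Icc 0 u ∪ Icc u' 1,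
      L s ∉ segment ℝ (toC (cornerPt (rayCorner b τ m))) (toC (cornerPt (rayCorner b τ (m + 1)))) := by
    intro s hs hmem
    -- `L s` is on some closed edge of `J`
    have hex : ∃ k, k < 2 * ω.Mv ∧ L s ∈ segment ℝ (ω.pJ hr h k) (ω.pJ hr h (k + 1)) := by
      by_contra hh
      push Not at hh
      exact not_mem_range_of_forall h (fun k hk => hh k hk) ⟨s, rfl⟩
    obtain ⟨k, hk, hLk⟩ := hex
    obtain ⟨j', hj', -, hej', hp⟩ := exit_eq_rayMid_of_mem_edge_at h hk hLk hmem
    -- so `L s = c = L s⋆`, and by injectivity `s = s⋆ ∈ (u, u')`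
    rw [← he', ← hc] at hp
    rcases hs with hs | hs
    · have hs01 : s ∈ Ico (0 : ℝ) 1 := ⟨hs.1, lt_of_le_of_lt hs.2 (lt_of_lt_of_le huu' hu'1)⟩
      have := hJ.injOn hs01 hsStar01 (hp.trans hLsStar.symm)
      rw [this] at hs; linarith [hs.2, hsStar_lt.1]
    · rcases hs.2.lt_or_eq with hs1 | hs1
      · have hs01 : s ∈ Ico (0 : ℝ) 1 := ⟨le_trans hu0 (le_trans huu'.le hs.1), hs1⟩
        have := hJ.injOn hs01 hsStar01 (hp.trans hLsStar.symm)
        rw [this] at hs; linarith [hs.1, hsStar_lt.2]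
      · -- `s = 1`: `L 1 = L 0`
        have h10 : L 0 = c := by
          rw [← hp, hs1, hL]; simpa using (periodic_polygonLoop l 0).symm
        have h0mem : (0 : ℝ) ∈ Ico (0 : ℝ) 1 := ⟨le_rfl, one_pos⟩
        have := hJ.injOn h0mem hsStar01 (h10.trans hLsStar.symm)
        linarith [hsStar_lt.1]
  -- a point of the crossing edge in the open ray edge
  have hx_gen : c ∈ segment ℝ (L u) (L u') := by
    rw [hLu, hLu', segment_eq_image_lineMap]
    exact ⟨1 / 2, ⟨by norm_num, by norm_num⟩, lineMap_toC_add_sub_half _ _⟩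
  have hc_open := toC_midPt_rayMid_mem_openSegment b τ m
  rw [← he', ← hc] at hc_open
  -- the signs of the side functional at the two ends: `v = ± nrm e`
  have hsides : ∀ Z : ℤ × ℤ, segSide (toC (cornerPt (rayCorner b τ m))) (toC (cornerPt (rayCorner b τ (m + 1)))) (toC Z) =
      segSideZ (cornerPt (rayCorner b τ m)) (cornerPt (rayCorner b τ (m + 1))) Z := fun Z => segSide_toC _ _ _
  have hswap : ∀ Z : ℂ, segSide (toC (cornerPt (rayCorner b τ (m + 1)))) (toC (cornerPt (rayCorner b τ m))) Z =
      -segSide (toC (cornerPt (rayCorner b τ m))) (toC (cornerPt (rayCorner b τ (m + 1)))) Z := by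
    intro Z; rw [segSide_eq, segSide_eq]; ring
  have hvn : v = e.nrm ∨ v = -e.nrm := by
    rw [hv, ← he]; exact nIn_eq_nrm_or _ _
  -- signs at the ends: `S(L u) = ±4`, `S(L u') = ∓4`
  have hsign : (0 < segSide (toC (cornerPt (rayCorner b τ m))) (toC (cornerPt (rayCorner b τ (m + 1)))) (L u) ∧
        segSide (toC (cornerPt (rayCorner b τ m))) (toC (cornerPt (rayCorner b τ (m + 1)))) (L u') < 0) ∨
      (segSide (toC (cornerPt (rayCorner b τ m))) (toC (cornerPt (rayCorner b τ (m + 1)))) (L u) < 0 ∧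
        0 < segSide (toC (cornerPt (rayCorner b τ m))) (toC (cornerPt (rayCorner b τ (m + 1)))) (L u')) := by
    rw [hLu, hLu', hsides, hsides]
    obtain ⟨h1, h2⟩ | ⟨h1, h2⟩ := segSideZ_ray b τ m <;> rw [← he'] at h1 h2 <;> rcases hvn with hvn | hvn
    · left; rw [hvn, h1, h2]; norm_num
    · right; rw [hvn, ← sub_eq_add_neg, sub_neg_eq_add, h2, h1]; norm_num
    · right; rw [hvn, h1, h2]; norm_num
    · left; rw [hvn, ← sub_eq_add_neg, sub_neg_eq_add, h2, h1]; norm_num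
  have hcont : ContinuousOn L (Icc 0 1) := (continuous_polygonLoop l).continuousOn
  have h01 : L 0 = L 1 := by rw [hL]; simpa using (periodic_polygonLoop l 0).symm
  rcases hsign with ⟨hA, hB⟩ | ⟨hA, hB⟩
  · left
    have key := wind_sub_wind_of_straight_cross (L := L) (a := 0) (u := u) (u' := u') (b := 1)
      (ℓ := toC (cornerPt (rayCorner b τ m))) (r := toC (cornerPt (rayCorner b τ (m + 1)))) hu0 huu' hu'1
      hcont h01 hmid hout_gen hA hB ⟨c, hx_gen, hc_open⟩
    simpa [windRayAt] using key
  · right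
    rw [openSegment_symm] at hc_open
    have key := wind_sub_wind_of_straight_cross (L := L) (a := 0) (u := u) (u' := u') (b := 1)
      (ℓ := toC (cornerPt (rayCorner b τ (m + 1)))) (r := toC (cornerPt (rayCorner b τ m))) hu0 huu' hu'1
      hcont h01 hmid (fun s hs hmem => hout_gen s hs (by rwa [segment_symm] at hmem))
      (by rw [hswap]; linarith) (by rw [hswap]; linarith) ⟨c, hx_gen, hc_open⟩
    simpa [windRayAt] using key


/-! ### Parity bookkeeping along the ray -/

/-- **One step along the ray, mod 2**: the winding number about corner `m` equals the one about corner `m + 1`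
plus one if the `m`-th ray edge is crossed, plus zero if not. [cite: AhlforsCA1979, Ch. 4 §2.1 (index of a point with respect to a closed curve)] -/
theorem windRayAt_step_mod_two (h : ω.IsB2a) (b : Face) (τ : Side) (m : ℕ) [Decidable (ω.RayCrossedAt hr h b τ m)] :
    ((ω.windRayAt hr h b τ m : ℤ) : ZMod 2) =
      (ω.windRayAt hr h b τ (m + 1) : ZMod 2) + (if ω.RayCrossedAt hr h b τ m then 1 else 0) := by
  split_ifs with hc
  · obtain ⟨j, hj, he⟩ := hc
    rcases windRayAt_jump h hj he with e | e
    · have : ω.windRayAt hr h b τ m = ω.windRayAt hr h b τ (m + 1) + 1 := by omega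
      rw [this]; push_cast; ring
    · have : ω.windRayAt hr h b τ m = ω.windRayAt hr h b τ (m + 1) - 1 := by omega
      rw [this]; push_cast
      have h2 : (2 : ZMod 2) = 0 := by decide
      linear_combination -h2
  · rw [windRayAt_succ_of_not_crossed h hc, add_zero]

open scoped Classical in
/-- **Parity along the ray**: for every `M`, the winding number about the start of the ray is, mod 2, the one
about corner `M` plus the number of crossed ray edges below `M`. [cite: AhlforsCA1979, Ch. 4 §2.1 (index of a point with respect to a closed curve)]
[cite: CourantRobbins1958, Ch. V Appendix §2 (The Jordan Curve Theorem for Polygons: the even–odd rule)] -/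
theorem windRayAt_zero_mod_two (h : ω.IsB2a) (b : Face) (τ : Side) (M : ℕ) :
    ((ω.windRayAt hr h b τ 0 : ℤ) : ZMod 2) =
      (ω.windRayAt hr h b τ M : ZMod 2) + (((Finset.range M).filter (ω.RayCrossedAt hr h b τ)).card : ZMod 2) := by
  induction M with
  | zero => simp
  | succ M ih =>
    rw [ih, windRayAt_step_mod_two h b τ M, Finset.range_add_one, Finset.filter_insert]
    split_ifs with hc
    · rw [Finset.card_insert_of_notMem (fun hm => Finset.notMem_range_self (Finset.mem_filter.1 hm).1)]
      push_cast; ring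
    · rw [add_zero]

/-- **Far along the ray**: beyond some index no ray edge is crossed, and the winding number of `J` about the
ray corners vanishes. [cite: AhlforsCA1979, Ch. 4 §2.1 (index of a point with respect to a closed curve)]
[cite: Mccleary2006, Ch. 9, p. 129 (The Jordan Curve Theorem)] -/
theorem exists_far_at (h : ω.IsB2a) (b : Face) (τ : Side) :
    ∃ M : ℕ, (∀ m, ω.RayCrossedAt hr h b τ m → m < M) ∧ ω.windRayAt hr h b τ M = 0 := by
  have hM := three_le_Mv hr h
  have hJ := isJordanLoop_pJ (hr := hr) h
  obtain ⟨R, hv, hR⟩ := exists_norm_le (hr := hr) h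
  set C : ℝ := 4 * (|(b.1 : ℝ)| + |(b.2 : ℝ)| + 1) with hC
  obtain ⟨M, hMge⟩ := exists_nat_ge ((R + C + 2) / 4)
  have hM4 : R + C + 2 ≤ 4 * (M : ℝ) := by
    have := (div_le_iff₀ (show (0 : ℝ) < 4 by norm_num)).1 hMge; linarith
  refine ⟨M, fun m ⟨j, hj, hej⟩ => ?_, ?_⟩
  · -- the midpoint of a crossed ray mid-edge is on `J`, hence within `R` of the origin
    by_contra hmM
    push Not at hmM
    have hmid : toC (midPt (rayMid b τ m)) ∈ segment ℝ (ω.pJ hr h (2 * j)) (ω.pJ hr h (2 * j + 1)) := by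
      rw [ω.pJ_eq_toC h, ω.pJ_eq_toC h, pJpt_two_mul h hj, pJpt_two_mul_add_one h hj, hej, segment_eq_image_lineMap]
      exact ⟨1 / 2, ⟨by norm_num, by norm_num⟩, lineMap_toC_add_sub_half _ _⟩
    have h1 := norm_sub_le_of_mem_segment (c := 0) (ρ := R) (by rw [sub_zero]; exact hv (2 * j) (by omega))
      (by rw [sub_zero]; exact hv (2 * j + 1) (by omega)) hmid
    rw [sub_zero] at h1
    have h2 := norm_toC_midPt_rayMid_ge b τ m
    have h3 : (M : ℝ) ≤ m := by exact_mod_cast hmM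
    linarith
  · -- the far corner is off `J` and not inside: outside, winding number `0`
    have hq : toC (cornerPt (rayCorner b τ M)) ∉ range (polygonLoop (ω.pJlist hr h)) :=
      not_mem_range_of_forall h fun k hk => toC_cornerPt_not_mem_edge h _ hk
    rcases IsJordanLoop.mem_inside_or_mem_outside hq with hin | hout
    · exfalso
      have h1 := hJ.norm_lt_of_mem_inside hR hin
      have h2 := norm_toC_cornerPt_rayCorner_ge b τ M
      linarith
    · exact (hJ.mem_outside_iff_wind_eq_zero hq).1 hout

/-! ### The ray count behind `b.side τ` and the parity law -/

variable (ω hr) in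
open scoped Classical in
/-- ★ **The ray count behind the mid-edge `b.side τ`**: the number of slots of the excursion polygon `J` (chord
slot and excursion arcs alike) whose exit mid-edge lies on the ray `rayMid b τ 0, rayMid b τ 1, …` behind the
side `τ` of the face `b` (general base edge; Part P's `rayCount σ` is the case `b = r`). [cite: CourantRobbins1958, Ch. V Appendix §2 (The Jordan Curve Theorem for Polygons: the even–odd rule)] -/
def rayCountAt (h : ω.IsB2a) (b : Face) (τ : Side) : ℕ :=
  ((Finset.range ω.Mv).filter fun j => ∃ m : ℕ, (ω.jFace h j).side (ω.jOut hr h j) = rayMid b τ m).card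

open scoped Classical in
/-- The ray count equals the number of crossed ray edges below any index beyond the last crossing. [folklore] -/
private theorem card_filter_rayCrossedAt_eq_rayCountAt (h : ω.IsB2a) (b : Face) (τ : Side) {M : ℕ}
    (hM : ∀ m, ω.RayCrossedAt hr h b τ m → m < M) :
    ((Finset.range M).filter (ω.RayCrossedAt hr h b τ)).card = ω.rayCountAt hr h b τ := by
  unfold rayCountAt
  refine Finset.card_bij (fun m hm => Classical.choose (Finset.mem_filter.1 hm).2) ?_ ?_ ?_
  · intro m hm
    have hs := Classical.choose_spec (Finset.mem_filter.1 hm).2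
    exact Finset.mem_filter.2 ⟨Finset.mem_range.2 hs.1, m, hs.2⟩
  · intro m₁ hm₁ m₂ hm₂ heq
    have hs₁ := Classical.choose_spec (Finset.mem_filter.1 hm₁).2
    have hs₂ := Classical.choose_spec (Finset.mem_filter.1 hm₂).2
    apply rayMid_injective b τ
    rw [← hs₁.2, ← hs₂.2]
    exact congrArg (fun j => (ω.jFace h j).side (ω.jOut hr h j)) heq
  · intro j hj
    obtain ⟨hjM, m, hm⟩ := Finset.mem_filter.1 hj
    have hc : ω.RayCrossedAt hr h b τ m := ⟨j, Finset.mem_range.1 hjM, hm⟩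
    have hmem : m ∈ (Finset.range M).filter (ω.RayCrossedAt hr h b τ) :=
      Finset.mem_filter.2 ⟨Finset.mem_range.2 (hM m hc), hc⟩
    refine ⟨m, hmem, ?_⟩
    have hs := Classical.choose_spec (Finset.mem_filter.1 hmem).2
    exact jOut_side_inj h hs.1 (Finset.mem_range.1 hjM) (hs.2.trans hm.symm)

/-- The base point transport: the winding number of `J` about the midpoint of a mid-edge `b.side τ` that `J`
does not cross equals the one about the start of the ray behind it. [cite: AhlforsCA1979, Ch. 4 §2.1 (index of a point with respect to a closed curve)] -/
theorem wind_midPt_eq_windRayAt_zero (h : ω.IsB2a) {b : Face} {τ : Side}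
    (hb : ∀ j < ω.Mv, (ω.jFace h j).side (ω.jOut hr h j) ≠ b.side τ) :
    wind (fun t ↦ polygonLoop (ω.pJlist hr h) t - toC (midPt (b.side τ))) = ω.windRayAt hr h b τ 0 :=
  wind_eq_of_segment_disjoint h fun _ hz _ hk hzk => halfEdge_disjoint_edges_at h hb hk hzk hz

/-- ★★ **THE WINDING PARITY LAW, general base edge (mod-2 form).** For a walk of class `B2a` at `r` and a
mid-edge `b.side τ` that the excursion polygon `J` does not cross, the winding number of `J` about the midpoint
of `b.side τ` is congruent mod 2 to the number of times `J` crosses the lattice half-line behind the side `τ` of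
`b` (even–odd rule, by transport of the base point along the ray). [cite: CourantRobbins1958, Ch. V Appendix §2 (The Jordan Curve Theorem for Polygons: the even–odd rule)]
[cite: AhlforsCA1979, Ch. 4 §2.1 (index of a point with respect to a closed curve)] -/
theorem wind_midPt_eq_rayCountAt_mod_two (h : ω.IsB2a) {b : Face} {τ : Side}
    (hb : ∀ j < ω.Mv, (ω.jFace h j).side (ω.jOut hr h j) ≠ b.side τ) :
    ((wind (fun t ↦ polygonLoop (ω.pJlist hr h) t - toC (midPt (b.side τ))) : ℤ) : ZMod 2) =
      (ω.rayCountAt hr h b τ : ZMod 2) := by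
  classical
  obtain ⟨M, hM, h0⟩ := exists_far_at (hr := hr) h b τ
  rw [wind_midPt_eq_windRayAt_zero h hb, windRayAt_zero_mod_two h b τ M, h0,
    card_filter_rayCrossedAt_eq_rayCountAt h b τ hM]
  simp

/-- ★★★ **THE WINDING PARITY LAW, general base edge.** For a walk of class `B2a` at `r` and a mid-edge
`b.side τ` that the excursion polygon `J` does not cross: `J` winds around the midpoint of `b.side τ`
(swept angle `AJ ≠ 0`) iff `J` crosses the lattice half-line behind the side `τ` of `b` an ODD number of times.
[cite: CourantRobbins1958, Ch. V Appendix §2 (The Jordan Curve Theorem for Polygons: the even–odd rule)]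
[cite: Glazman2015WeightedSAW, Lemma 3.1 (proof, pp. 6–7: the classes of walks through a rhombus)]
[cite: AhlforsCA1979, Ch. 4 §2.1 (index of a point with respect to a closed curve)] -/
theorem AJ_midPt_ne_zero_iff_odd_rayCountAt (h : ω.IsB2a) {b : Face} {τ : Side}
    (hb : ∀ j < ω.Mv, (ω.jFace h j).side (ω.jOut hr h j) ≠ b.side τ) :
    ω.AJ hr h (toC (midPt (b.side τ))) ≠ 0 ↔ Odd (ω.rayCountAt hr h b τ) := by
  have hJ := isJordanLoop_pJ (hr := hr) h
  have hoff := midPt_not_mem_edges_at h hb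
  have hq := not_mem_range_of_forall h hoff
  have hpar := wind_midPt_eq_rayCountAt_mod_two h hb
  rw [AJ_eq_two_pi_mul_wind h hoff, ← ZMod.natCast_eq_one_iff_odd, ← hpar]
  set w := wind (fun t ↦ polygonLoop (ω.pJlist hr h) t - toC (midPt (b.side τ))) with hw
  have tri : w = 0 ∨ w = 1 ∨ w = -1 := by
    rcases IsJordanLoop.mem_inside_or_mem_outside hq with hi | ho
    · right; exact hJ.wind_eq_one_or_neg_one_of_mem_inside hi
    · left; exact (hJ.mem_outside_iff_wind_eq_zero hq).1 ho
  have h2 : (2 : ℝ) * Real.pi ≠ 0 := by positivity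
  constructor
  · intro hne
    have hw0 : w ≠ 0 := fun h0 => hne (by rw [h0]; simp)
    rcases tri with e | e | e
    · exact absurd e hw0
    · rw [e]; simp
    · rw [e]; decide
  · intro hodd hzero
    have hw0 : (w : ℝ) = 0 := (mul_eq_zero.1 hzero).resolve_left h2
    have : w = 0 := by exact_mod_cast hw0
    rw [this, Int.cast_zero] at hodd
    exact zero_ne_one hodd

/-- The parity law, general base edge, complementary form: `AJ = 0` iff the ray count is even.
[cite: CourantRobbins1958, Ch. V Appendix §2 (The Jordan Curve Theorem for Polygons: the even–odd rule)] -/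
theorem AJ_midPt_eq_zero_iff_even_rayCountAt (h : ω.IsB2a) {b : Face} {τ : Side}
    (hb : ∀ j < ω.Mv, (ω.jFace h j).side (ω.jOut hr h j) ≠ b.side τ) :
    ω.AJ hr h (toC (midPt (b.side τ))) = 0 ↔ Even (ω.rayCountAt hr h b τ) := by
  rw [← Nat.not_odd_iff_even, ← AJ_midPt_ne_zero_iff_odd_rayCountAt h hb, not_not]

/-- The parity law, general base edge, «inside» form: the midpoint of `b.side τ` lies inside the excursion
polygon iff the ray count behind it is odd. [cite: CourantRobbins1958, Ch. V Appendix §2 (The Jordan Curve Theorem for Polygons: the even–odd rule)]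
[cite: Mccleary2006, Ch. 9, p. 129 (The Jordan Curve Theorem)] -/
theorem midPt_mem_inside_iff_odd_rayCountAt (h : ω.IsB2a) {b : Face} {τ : Side}
    (hb : ∀ j < ω.Mv, (ω.jFace h j).side (ω.jOut hr h j) ≠ b.side τ) :
    toC (midPt (b.side τ)) ∈ IsJordanLoop.inside (polygonLoop (ω.pJlist hr h)) ↔ Odd (ω.rayCountAt hr h b τ) := by
  have hJ := isJordanLoop_pJ (hr := hr) h
  have hoff := midPt_not_mem_edges_at h hb
  have hq := not_mem_range_of_forall h hoff
  rw [← AJ_midPt_ne_zero_iff_odd_rayCountAt h hb, AJ_eq_two_pi_mul_wind h hoff,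
    hJ.mem_inside_iff_wind_ne_zero hq]
  have h2 : (2 : ℝ) * Real.pi ≠ 0 := by positivity
  constructor
  · intro hw hzero
    exact hw (by exact_mod_cast (mul_eq_zero.1 hzero).resolve_left h2)
  · intro hne hw
    exact hne (by rw [hw]; simp)

/-! ### The root: wound about the root ⇔ odd ray count behind the root mid-edge -/

/-- ★★★ **WOUND ⇔ ODD CROSSINGS BEHIND THE ROOT.** For a walk of class `B2a` at an ARBITRARY rooted rhombus
`r` of `D` (not only the root plaquette) and any presentation `a = b.side τ` of the root mid-edge as a side of a
face: the excursion polygon winds around the midpoint of the root (`AJ (midPt a) ≠ 0` — the negation of the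
summand condition of `UnwoundAt D a r`) iff the excursion polygon crosses the lattice half-line behind the side
`τ` of `b` an odd number of times. With `b` the exterior face of a boundary root and `τ` pointing away from `D`
this is a crossing count along a lattice line leaving the domain through the root's hole or outer boundary.
[cite: CourantRobbins1958, Ch. V Appendix §2 (The Jordan Curve Theorem for Polygons: the even–odd rule)]
[cite: Glazman2015WeightedSAW, Lemma 3.1 (proof, pp. 6–7: the classes of walks through a rhombus)]
[cite: DuminilCopinSmirnov2012, proof of Lemma 1 ("we used the fact that a is on the boundary and Ω is simply connected")] -/
theorem AJ_root_ne_zero_iff_odd_rayCountAt (h : ω.IsB2a) {b : Face} {τ : Side} (hab : b.side τ = a) :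
    ω.AJ hr h (toC (midPt a)) ≠ 0 ↔ Odd (ω.rayCountAt hr h b τ) := by
  have key := AJ_midPt_ne_zero_iff_odd_rayCountAt (hr := hr) h (b := b) (τ := τ)
    fun j hj e => exit_ne_root (hr := hr) h hj (e.trans hab)
  rw [hab] at key
  exact key

/-- Complementary form at the root: unwound (`AJ (midPt a) = 0`) iff the ray count behind the root is even.
[cite: CourantRobbins1958, Ch. V Appendix §2 (The Jordan Curve Theorem for Polygons: the even–odd rule)] -/
theorem AJ_root_eq_zero_iff_even_rayCountAt (h : ω.IsB2a) {b : Face} {τ : Side} (hab : b.side τ = a) :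
    ω.AJ hr h (toC (midPt a)) = 0 ↔ Even (ω.rayCountAt hr h b τ) := by
  rw [← Nat.not_odd_iff_even, ← AJ_root_ne_zero_iff_odd_rayCountAt h hab, not_not]

/-- «Inside» form at the root: the midpoint of the root mid-edge lies inside the excursion polygon iff the ray
count behind the root is odd. [cite: CourantRobbins1958, Ch. V Appendix §2 (The Jordan Curve Theorem for Polygons: the even–odd rule)]
[cite: Mccleary2006, Ch. 9, p. 129 (The Jordan Curve Theorem)] -/
theorem midPt_root_mem_inside_iff_odd_rayCountAt (h : ω.IsB2a) {b : Face} {τ : Side} (hab : b.side τ = a) :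
    toC (midPt a) ∈ IsJordanLoop.inside (polygonLoop (ω.pJlist hr h)) ↔ Odd (ω.rayCountAt hr h b τ) := by
  have key := midPt_mem_inside_iff_odd_rayCountAt (hr := hr) h (b := b) (τ := τ)
    fun j hj e => exit_ne_root (hr := hr) h hj (e.trans hab)
  rw [hab] at key
  exact key

end ΩG

/-! ### Part P′ pay-off in the tree's vocabulary: `UnwoundAt` and the vertex identity as crossing parities -/

/-- ★★★ **Unwound at `r` ⇔ every excursion crosses the half-line behind the root an even number of times.**
For any presentation `a = b.side τ` of the root mid-edge: `UnwoundAt D a r` (no excursion polygon of a walk of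
class `B2a` at `r` winds around the midpoint of the root) iff every such polygon crosses the lattice half-line
behind the side `τ` of `b` an EVEN number of times — a purely combinatorial condition on exit mid-edges.
[cite: CourantRobbins1958, Ch. V Appendix §2 (The Jordan Curve Theorem for Polygons: the even–odd rule)]
[cite: GlazmanManolescu2019, Lemma 2.1 (statement, "in the form given in [Gl]")]
[cite: Glazman2015WeightedSAW, Lemma 3.1 (proof, pp. 6–7: the classes of walks through a rhombus)] -/
theorem unwoundAt_iff_forall_even_rayCountAt {D : Set Face} {a : MidEdge} {r b : Face} {τ : Side}
    (hab : b.side τ = a) :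
    UnwoundAt D a r ↔ ∀ (hr : RootedFace D a r) (ω : ΩG D a r) (h : ω.IsB2a), Even (ω.rayCountAt hr h b τ) :=
  forall₃_congr fun _ _ h => ΩG.AJ_root_eq_zero_iff_even_rayCountAt h hab

end Literature.Probability.RandomPlanarGeometry.SAW.YangBaxter

/-! ## Part P′ pay-off in the `PlaquetteWalk` vocabulary: the vertex identity as a crossing parity -/

namespace Literature.Barriers.CriticalPhenomena.PlaquetteWalk

open Real
open Literature.Probability.RandomPlanarGeometry.SAW.YangBaxter
open Literature.Probability.RandomPlanarGeometry.SAW.YangBaxter.MidEdge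

/-- ★★★ **The Yang–Baxter vertex identity at a plaquette behind which every excursion crosses evenly.** For the
printed weights at `θ ∈ [π/3, 2π/3]`, a non-interior root `a = b.side τ` and a plaquette `f₀` of the domain:
if every walk of class `B2a` at `f₀` crosses the lattice half-line behind the root an even number of times, the
vertex identity `Σ_s c_s F(f₀.side s) = 0` holds at `f₀` (the tree's `…_of_unwoundAt` with its topological
hypothesis replaced by the crossing parity). [cite: GlazmanManolescu2019, Lemma 2.1, eq. (2.2) (CR)]
[cite: CourantRobbins1958, Ch. V Appendix §2 (The Jordan Curve Theorem for Polygons: the even–odd rule)]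
[cite: DuminilCopinSmirnov2012, proof of Lemma 1] -/
theorem vertexFunctional_printed_eq_zero_of_forall_even_rayCountAt {θ : ℝ}
    (hθ : θ ∈ Set.Icc (π / 3) (2 * π / 3)) (Dl : List Face) {a : MidEdge} {b : Face} {τ : Side}
    (hab : b.side τ = a) (ha : ¬(a.faces.1 ∈ dom Dl ∧ a.faces.2 ∈ dom Dl)) (f₀ : Face) (hf : f₀ ∈ Dl)
    (hE : ∀ (hr : RootedFace (dom Dl) a f₀) (ω : ΩG (dom Dl) a f₀) (h : ω.IsB2a), Even (ω.rayCountAt hr h b τ)) :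
    vertexFunctional (printedWeights θ) tFiveEighths (ybCoeff θ) Dl a f₀ = 0 :=
  vertexFunctional_printed_eq_zero_of_unwoundAt hθ Dl a ha f₀ hf
    ((unwoundAt_iff_forall_even_rayCountAt hab).2 hE)

/-- ★★★ **A Yang–Baxter defect forces an odd crossing.** Contrapositive: if the vertex identity FAILS at `f₀`
(printed weights, `θ ∈ [π/3, 2π/3]`, non-interior root `a = b.side τ`), some walk of class `B2a` at `f₀` has an
excursion polygon crossing the lattice half-line behind the root an ODD number of times (the necessary half of
the lane's encircling criterion, in combinatorial form, at an arbitrary plaquette).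
[cite: GlazmanManolescu2019, Lemma 2.1, eq. (2.2) (CR)]
[cite: CourantRobbins1958, Ch. V Appendix §2 (The Jordan Curve Theorem for Polygons: the even–odd rule)] -/
theorem exists_odd_rayCountAt_of_vertexFunctional_printed_ne_zero {θ : ℝ}
    (hθ : θ ∈ Set.Icc (π / 3) (2 * π / 3)) (Dl : List Face) {a : MidEdge} {b : Face} {τ : Side}
    (hab : b.side τ = a) (ha : ¬(a.faces.1 ∈ dom Dl ∧ a.faces.2 ∈ dom Dl)) (f₀ : Face) (hf : f₀ ∈ Dl)
    (hne : vertexFunctional (printedWeights θ) tFiveEighths (ybCoeff θ) Dl a f₀ ≠ 0) :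
    ∃ (hr : RootedFace (dom Dl) a f₀) (ω : ΩG (dom Dl) a f₀) (h : ω.IsB2a), Odd (ω.rayCountAt hr h b τ) := by
  by_contra hcon
  push Not at hcon
  exact hne (vertexFunctional_printed_eq_zero_of_forall_even_rayCountAt hθ Dl hab ha f₀ hf
    fun hr ω h => Nat.not_odd_iff_even.1 (hcon hr ω h))

end Literature.Barriers.CriticalPhenomena.PlaquetteWalk
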